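import Summits.QuantumAdvantage.QuantumAdvantage.Theses.CubicForrelation
import Literature.Computability.QuantumComplexity.SignedCubicForrelation
import Literature.Computability.QuantumComplexity.ForrelationMSubspaceDuality
import Literature.Computability.Complexity.PromiseBPPFromFPDecider
import Literature.Computability.Complexity.F2RowReduction
import Literature.Computability.Complexity.StackLists
import Summits.QuantumAdvantage.QuantumAdvantage.Theorems.SignedCubicForrelationInPrBPP.Negative.GoldCube
import Summits.QuantumAdvantage.QuantumAdvantage.Theorems.CubicForrelationSignedExactCubicForrelationNotPrBPPStubSignReadout
import Summits.QuantumAdvantage.QuantumAdvantage.Theorems.CubicForrelationSignedExactCubicForrelationNotPrBPPStubFrameLock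
import Summits.QuantumAdvantage.QuantumAdvantage.Theorems.CubicForrelationSignedExactCubicForrelationNotPrBPPStubDualShape
import Summits.QuantumAdvantage.QuantumAdvantage.Theorems.CubicForrelationSignedExactCubicForrelationNotPrBPPStubPolarGeometry
import Summits.QuantumAdvantage.QuantumAdvantage.Theorems.CubicForrelationSignedExactCubicForrelationNotPrBPPStubPlumbing
import Summits.QuantumAdvantage.QuantumAdvantage.Theorems.CubicForrelationSignedExactCubicForrelationNotPrBPPFinderMachine
import Summits.QuantumAdvantage.QuantumAdvantage.Theorems.CubicForrelationSignedExactCubicForrelationNotPrBPPStubNoTrapTemplate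
import Summits.QuantumAdvantage.QuantumAdvantage.Theorems.CubicForrelationSignedExactCubicForrelationNotPrBPPStubNoTrapTransport
import Summits.QuantumAdvantage.QuantumAdvantage.Theorems.CubicForrelationSignedExactCubicForrelationNotPrBPPStubMPairClosed
import Summits.QuantumAdvantage.QuantumAdvantage.Theorems.CubicForrelationSignedExactCubicForrelationNotPrBPPStubPlumbingCoins
import Summits.QuantumAdvantage.QuantumAdvantage.Theorems.CubicForrelationSignedExactCubicForrelationNotPrBPPGrowMachineComplete
import Summits.QuantumAdvantage.QuantumAdvantage.Theorems.CubicForrelationSignedExactCubicForrelationNotPrBPPStubSpanningOfNoDual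
import Summits.QuantumAdvantage.QuantumAdvantage.Theorems.CubicForrelationSignedExactCubicForrelationNotPrBPPStubRadicalGood
import Summits.QuantumAdvantage.QuantumAdvantage.Theorems.CubicForrelationSignedExactCubicForrelationNotPrBPPStubSpanHalf
import Summits.QuantumAdvantage.QuantumAdvantage.Theorems.CubicForrelationSignedExactCubicForrelationNotPrBPPStubKernelStatsRadical
import Summits.QuantumAdvantage.QuantumAdvantage.Theorems.CubicForrelationSignedExactCubicForrelationNotPrBPPStubKernelStatsRadicalA

/-!
# Line `dual-pingpong-frame` — skeleton for crux `SignedExactCubicForrelationNotPrBPP` (stmt-QuantumAdvantage-13932)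

Crux (route `QuantumAdvantage/CubicForrelation`, rank 3, decl
`Summit.QuantumAdvantage.QuantumAdvantage.Theses.CubicForrelation.SignedExactCubicForrelationNotPrBPP`
`= (signedExactCubicForrelationProblem 2 ∉ PromiseBPP')` by `rfl`): the SIGNED EXACT slice of cubic 2-fold
Forrelation (yes `Φ = 1`: `b` bent with cubic dual `b̃ = a`; no `Φ = -1`: `a = b̃ ⊕ 1`; `n` even, `B₂`-circuits
of 𝔽₂-degree `≤ 3`) is not in textbook promise-`BPP`.

**STATUS (continuation lead prover-line-stmt-QuantumAdvantage-13932-c1-0, 2026-08-16, RESHAPED — see §RESHAPE below).** LANDED by the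
first lead: `stub_signReadout` p86317, `stub_frameLock` p86221, `stub_dualShape` p87053, `stub_polarGeometry` p88189, `stub_plumbing` p87286
(deterministic-finder plumbing), the deterministic machine `FinderMachine.findV2` with `findV2_mem_FP` / `findV2_sound` p94496, helpers
`Finder.mem_iff_finrank_le` p89437, `Finder.orbit_step_mem` p90202, negative lemmas p90480 / p95065. The first lead's last stub
(`stub_finderComplete`, completeness of `findV2`) is RETIRED by this reshape (believed false on large Feistel-type instances); the line now runs
on the GROW finder; wave 1 (2026-08-16) LANDED `stub_noTrapTemplate` p116895, `stub_noTrapTransport` p119982, `stub_mpairClosed` p120282,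
`stub_plumbingCoins` p120617 and the GROW MACHINE `stub_growFinder` p125628 (`GrowMachine.growFind`, FP + sound + complete-from-stubs);
after the c3 reshape (2026-08-17) the bricks `stub_spanHalf` p142869, `stub_spanningOfNoDual` p142453, `stub_radicalGood` p142650 and the assemblies
`stub_kernelStatsRadical` p143469 / `stub_kernelStatsRadicalA` p144612 (radical-visible pairs on either side, `r = n+1`) are LANDED; the ONE remaining `sorry`
is the OPEN core `stub_kernelStatsCore` (radical-absorbed pairs); `stub_kernelStats` is the composition.

**DIRECTION.** The idea card `Cruxes/SignedExactCubicForrelationNotPrBPP/Ideas/dual-pingpong-frame.md` (triage r1: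
pass ×3) is a REFUTATION ENGINE: it attacks `¬ crux` (on the Maiorana–McFarland slice; with crux r5
`ExactPairsMaioranaMcFarland` on every exact pair). This file is therefore the honest skeleton of the
REFUTATION LINE: six registered stubs and the kernel-checked composition

  `SignedExactCubicForrelationNotPrBPP_false_of : stubs → ExactPairsMaioranaMcFarland → ¬ SignedExactCubicForrelationNotPrBPP`,

i.e. a NEGATIVE LEMMA blueprint (`<Crux>_false_of_<H>`, `H = PairFinderMM`, the only open stub) in the sense of the
crux protocol. There is NO by-name `SignedExactCubicForrelationNotPrBPP_of`: every proof-direction composition of a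
refutation engine would have to take a sub-promise hardness leaf `… ∉ PromiseBPP'` as hypothesis — the COSTUME for
which the triage panel failed `keyless-residual-transfer` / `selfdual-collapse` (TRIAGE-r1-1..3). The mechanical
by-name audit (`#h21_check_skeleton`) consequently reports `skeleton.missing` on this file; see the line card
`Lines/dual-pingpong-frame.md` §Audit for the verbatim verdict and the recommendation to tenure (file `¬ r3` as an
item, or land this composition as `Theorems/SignedExactCubicForrelationNotPrBPP/Negative/…FalseOfPairFinderMM.lean`
with `--negative-modulo PairFinderMM`).

THE LINE (dual ping-pong). For an exact cubic pair `(a, b)` the hidden frames are LOCKED: if `V` is an M-subspace of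
`b` (half-dimensional subspace on whose cosets `b` is affine) then `V^⊥` is an M-subspace of `a`
(`stub_frameLock`, from the landed `DerivativeWalsh.dual_affine_on_perp_cosets`), and for `u ∈ V` the LEAKED FRAME
PIECE `Y_u := (rad T_b(u,·,·))^⊥` lies in `V^⊥`, symmetrically `(rad T_a(v,·,·))^⊥ ⊆ V` for `v ∈ V^⊥`. In
Maiorana–McFarland coordinates `b = y'·π(y'') ⊕ h(y'')` the piece is EXACTLY `0 ⊕ (rad β_{u'})^⊥`,
`β_{u'} = ` the alternating form of the component `u'·π`, of dimension `rank β_{u'}` (`stub_polarGeometry` (A),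
the card's amplification lemma — triage sharpening ×3), every polar radical `rad T_b(w,·,·)` contains a non-zero
frame vector `(u', 0)` (`stub_polarGeometry` (B) = PolarLeak = F1, for ANY quadratic `π`, bijective or not —
triage r1-2 (a)), and the dual `a` has the mirror shape `x''·π⁻¹(x') ⊕ h(π⁻¹ x') ⊕ [Φ = -1]` (`stub_dualShape`,
McFarland). Iterating `u ↦ Y_u ↦ ⊕_{v ∈ Y_u} (rad T_a(v,·,·))^⊥ ↦ …` from the seeds of a polar radical grows the
coupled pair `(V, V^⊥)` by linear algebra and rejects wrong seeds by the rigid consistency "dimension `≤ n/2` on both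
sides and `S ⊥ A`"; a certified M-subspace of `b` then gives the SIGN by ONE Poisson summation
(`stub_signReadout`: `Φ = (-1)^{a(0)} (-1)^{b(μ)}`, `μ` the slope of `a` on `V^⊥` — FlatTransfer at `s = 0`, from
the landed `coset_sum_eq_of_forrelation_eq_one/neg_one`). The finder as a polynomial-time FUNCTION correct on every
MM-orbit exact cubic pair is `stub_finder` (OPEN: the running time / the closure DICHOTOMY, see its docstring); the
`FP`/`TM2` machine and `mem_PromiseBPP'_of_fp_decider` wrapper is `stub_plumbing` (mathematics closed; the r4 machine
`CubicForrelationEstimatorMachine.lean` is the pattern). Crux r5 (by name) puts every exact cubic pair on an MM orbit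
(`pairFinderExact_of`, proved here, no-side via `(¬a, b)`).

Disproof.lean (cdisprove cycle 1) used: no `_false_without_` theorem exists (S has no hypotheses — (d)); (a) sign
transport and (a′) M-subspace duality are IMPORTED (landed `ForrelationSignTransport.lean` p72523,
`ForrelationMSubspaceDuality.lean` p73295) and are exactly what `stub_signReadout` / `stub_frameLock` repackage;
(b) the E-closure of `biiso.py` = this engine in substance (triage r1-2/3: four implementations, 0 wrong signs,
n ≤ 96); (c)1 plumbing = `stub_plumbing` (debt largely paid by r4's landed machine), (c)2 worst-case finder =
`stub_finder` (the line's only open mathematics), (c)3 non-MM pairs = r5 BY NAME in the composition; (d) refuted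
strengthenings S⁺¹–S⁺⁴ are consistent with every stub (S⁺¹ false is `stub_signReadout`; S⁺²/S⁺³ families are the
finder's test set); (e) near-miss `crux_false_sketch` = this composition modulo its stubs. No `Negative/` lemma has
landed for this crux (`Theorems/SignedExactCubicForrelationNotPrBPP/` absent); the imported
`Negative.GoldCube` of the sibling crux r7 (a biquadratic permutation WITHOUT affine component) is the first test
object of `stub_polarGeometry`/`stub_finder` (`example` at the end). Negatives index
(`ledger negatives --problem QuantumAdvantage`): nothing used or approached (CubicStability 2202 concerns `Φ ≥ 3/5`).
-/

noncomputable section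

set_option linter.dupNamespace false

namespace Summit.QuantumAdvantage.QuantumAdvantage.Cruxes.SignedExactCubicForrelationNotPrBPP.DualPingpongFrame

open Finset
open Literature.Computability.Complexity Literature.Computability.QuantumComplexity
open Literature.Computability.QuantumComplexity.BuzetChailloux (bxor zeroVec)
open Summit.QuantumAdvantage.QuantumAdvantage.Theses.CubicForrelation

/-! ## Vocabulary (coordinate-free: subspaces as finsets of bit vectors, derivatives, polar radicals, frames) -/

variable {n : ℕ}

/-- A linear subspace of `𝔽₂ⁿ` as a finset: contains `0`, closed under `⊕`. -/
def IsSub (V : Finset (Fin n → Bool)) : Prop :=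
  zeroVec ∈ V ∧ ∀ x ∈ V, ∀ y ∈ V, bxor x y ∈ V

/-- The orthogonal `V^⊥ = {y : (-1)^{v·y} = 1 ∀ v ∈ V}` (spelling of `ForrelationMSubspaceDuality.lean`). -/
def perp (V : Finset (Fin n → Bool)) : Finset (Fin n → Bool) :=
  univ.filter fun y => ∀ v ∈ V, twist v y = 1

/-- Second derivative `D_u D_v b (x) = b(x) ⊕ b(x⊕u) ⊕ b(x⊕v) ⊕ b(x⊕u⊕v)` (verbatim the summand of the M-subspace
hypothesis `hM` of `DerivativeWalsh.dual_affine_on_perp_cosets`). -/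
def d2 (b : (Fin n → Bool) → Bool) (u v x : Fin n → Bool) : Bool :=
  b x ^^ b (bxor x u) ^^ b (bxor x v) ^^ b (bxor x (bxor u v))

/-- Third derivative `D_u D_v D_w b (x)`; for `b` of degree `≤ 3` it does not depend on `x` and is the symmetric
trilinear form `T_b(u,v,w)` of the cubic part of `b`. -/
def d3 (b : (Fin n → Bool) → Bool) (u v w x : Fin n → Bool) : Bool :=
  d2 b u v x ^^ d2 b u v (bxor x w)

/-- `b` is affine on every coset of `V`: all second derivatives along `V` vanish identically. -/
def AffineOnCosets (b : (Fin n → Bool) → Bool) (V : Finset (Fin n → Bool)) : Prop :=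
  ∀ u ∈ V, ∀ v ∈ V, ∀ x, d2 b u v x = false

/-- `V` is a (half-dimensional) **M-subspace** of `b`: a subspace with `|V|² = 2ⁿ` on whose cosets `b` is affine
(Dillon's criterion for the completed Maiorana–McFarland class, [Carlet2020, Prop. 54]). -/
def IsMSubspace (b : (Fin n → Bool) → Bool) (V : Finset (Fin n → Bool)) : Prop :=
  IsSub V ∧ ((V.card : ℝ) ^ 2 = (2 : ℝ) ^ n) ∧ AffineOnCosets b V

/-- The **polar radical** `rad M^b_u = {v : T_b(u,v,·) ≡ 0}` of the polar (alternating) form `M^b_u = T_b(u,·,·)`. -/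
def polarRad (b : (Fin n → Bool) → Bool) (u : Fin n → Bool) : Finset (Fin n → Bool) :=
  univ.filter fun v => ∀ w x, d3 b u v w x = false

/-- The **leaked frame piece** `Y_u := (rad M^b_u)^⊥` — the linear span of the support of the derivative Walsh row
`T_b(u,·) = W_{D_u b}` (card §(3)); the object the ping-pong bounces between the two tensors. -/
def frame (b : (Fin n → Bool) → Bool) (u : Fin n → Bool) : Finset (Fin n → Bool) :=
  perp (polarRad b u)

/-! ### Maiorana–McFarland coordinates (`n = m + m`, `y = Fin.append y' y''`) -/

variable {m : ℕ}

/-- The `𝔽₂` inner product of two bit vectors, as a bit. -/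
def bdot (u v : Fin m → Bool) : Bool :=
  ((univ.filter fun i => u i && v i).card).bodd

/-- `g` has **Maiorana–McFarland shape** `g(y', y'') = y'·π(y'') ⊕ h(y'')` in the given coordinates (frame
`U = {y'' = 0}`, `U^⊥ = {y' = 0}`). No hypothesis on `π` or `h` here. -/
def IsMMShape (g : (Fin (m + m) → Bool) → Bool) (π : (Fin m → Bool) → (Fin m → Bool)) (h : (Fin m → Bool) → Bool) :
    Prop :=
  ∀ y' y'' : Fin m → Bool, g (Fin.append y' y'') = (bdot y' (π y'') ^^ h y'')

/-- The bilinear differential `B_π(v, w) = π(v ⊕ w) ⊕ π(v) ⊕ π(w) ⊕ π(0)` of a map `π : 𝔽₂^m → 𝔽₂^m` (bilinear and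
alternating when `π` has quadratic coordinates; `u'·B_π(v,w) = β_{u'}(v,w)` is the alternating form of the
component `u'·π`, and `B_π(w, ·)` is the linear part `A_w` of the differential `D_w π`). -/
def Bdiff (π : (Fin m → Bool) → (Fin m → Bool)) (v w : Fin m → Bool) : Fin m → Bool :=
  fun i => π (bxor v w) i ^^ π v i ^^ π w i ^^ π zeroVec i

/-- `π` has quadratic coordinate functions. -/
def QuadraticCoords (π : (Fin m → Bool) → (Fin m → Bool)) : Prop :=
  ∀ i, IsDegLeFun 2 fun y => π y i

/-! ## The statements of the line

RESHAPED by the lead (2026-08-16): every registered stub below is stated in TREE VOCABULARY ONLY (Mathlib +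
`Literature.*`: `forrelation`, `signOf`, `twist`, `bxor`, `zeroVec`, `IsDegLeFun`, `FP`, `encList`, `F2Elim.rowSpan`,
`KForrelationInstance`, …) with the line's vocabulary (`d2`, `d3`, `perp`, `IsMSubspace`, `polarRad`, `spanSet`, …)
UNFOLDED, so that each stub lands as a pure `theorem` in its own `Theorems/` helper file (`--supports`) without
re-declaring any definition; the named `Prop`s are kept as the SAME text (definitional unfolding), so the composition is
unchanged. Content changes w.r.t. the planner's skeleton: `FrameLock` (ii)/(iii) are stated as the vanishing of third
derivatives along `V` (resp. `V^⊥`) — which is `V ⊆ rad M^b_u (u ∈ V)`, the frame inclusion `Y_u ⊆ V^⊥` then being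
antitonicity of `perp` (done inside the finder); `stub_plumbing` no longer takes `FrameLock` (the slope of `a` on `V^⊥`
comes straight from the landed `DerivativeWalsh.dual_affine_on_perp_cosets`). -/

/-- **Polar geometry of an MM-shaped cubic** (amplification lemma + seed leak; finite linear algebra over `𝔽₂`, for ANY
`π` with quadratic coordinates — bijectivity NOT needed, TRIAGE r1-2 (a); any `h`: the derivative along a frame vector
`(u',0)` kills `h`). For `g(y',y'') = y'·π(y'') ⊕ h(y'')`:
(A) AMPLIFICATION — `T_g((u',0),(v',v''),w) = u'·B_π(v'',w'')`, so `(v',v'') ∈ rad M^g_{(u',0)} ↔ ∀ w'', u'·B_π(v'',w'') = 0`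
    (hence `Y_u = (rad M^g_u)^⊥ = 0 ⊕ (rad β_{u'})^⊥ ⊆ U^⊥`, of dimension `rank β_{u'}`);
(B) SEED LEAK (= PolarLeak = SliceRadicalOil = Negative-note F1) — every polar radical `rad M^g_w` contains a non-zero
    frame vector `(u',0)`: `u' ⊥ im B_π(w'',·)`, which is never all of `𝔽₂^m` (`B_π(w'',w'') = 0`; `w'' = 0` trivial, uses
    `0 < m`). Third derivatives written out: `d3 g u v w x = d2 g u v x ⊕ d2 g u v (x ⊕ w)`.
[cite: Carlet2020, Prop. 54; card First lemma; TRIAGE r1-1/2/3] -/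
def PolarGeometry : Prop :=
  ∀ (m : ℕ), 0 < m → ∀ (g : (Fin (m + m) → Bool) → Bool) (π : (Fin m → Bool) → (Fin m → Bool))
    (h : (Fin m → Bool) → Bool),
    (∀ y' y'' : Fin m → Bool, g (Fin.append y' y'') = ((Finset.univ.filter fun i => y' i && (π y'') i).card.bodd ^^ h y'')) →
    (∀ i, IsDegLeFun 2 fun y => π y i) →
    (∀ u' v' v'' : Fin m → Bool,
      (∀ w x : Fin (m + m) → Bool,
        ((g x ^^ g (bxor x (Fin.append u' zeroVec)) ^^ g (bxor x (Fin.append v' v'')) ^^ g (bxor x (bxor (Fin.append u' zeroVec) (Fin.append v' v'')))) ^^ (g (bxor x w) ^^ g (bxor (bxor x w) (Fin.append u' zeroVec)) ^^ g (bxor (bxor x w) (Fin.append v' v'')) ^^ g (bxor (bxor x w) (bxor (Fin.append u' zeroVec) (Fin.append v' v''))))) = false) ↔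
      ∀ w'' : Fin m → Bool,
        (Finset.univ.filter fun i => u' i && (π (bxor v'' w'') i ^^ π v'' i ^^ π w'' i ^^ π zeroVec i)).card.bodd = false) ∧
    (∀ w : Fin (m + m) → Bool, ∃ u' : Fin m → Bool, u' ≠ zeroVec ∧ ∀ v x : Fin (m + m) → Bool,
        ((g x ^^ g (bxor x w) ^^ g (bxor x (Fin.append u' zeroVec)) ^^ g (bxor x (bxor w (Fin.append u' zeroVec)))) ^^ (g (bxor x v) ^^ g (bxor (bxor x v) w) ^^ g (bxor (bxor x v) (Fin.append u' zeroVec)) ^^ g (bxor (bxor x v) (bxor w (Fin.append u' zeroVec))))) = false)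

/-- **Dual shape (McFarland's dual formula, for exact pairs).** If `b = y'·π(y'') ⊕ h(y'')` with `π` a PERMUTATION and
`Φ(a,b) = ±1`, then `a(x',x'') = x''·π⁻¹(x') ⊕ h(π⁻¹(x')) ⊕ [Φ(a,b) = -1]`. Proof: `W_b(x',x'') = 2^m (-1)^{h(π⁻¹x') + x''·π⁻¹(x')}`
(character sum over `y'`), and `Φ = ±1` forces `(-1)^a = ± 2^{-m} W_b` pointwise (`DerivativeWalsh.two_pow_mul_W_eq`,
landed). [cite: Carlet2020, Prop. 77; Mesnager2016, Prop. 7.1.14] -/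
def DualMMShape : Prop :=
  ∀ (m : ℕ) (a b : (Fin (m + m) → Bool) → Bool) (π : (Fin m → Bool) ≃ (Fin m → Bool))
    (h : (Fin m → Bool) → Bool),
    (∀ y' y'' : Fin m → Bool, b (Fin.append y' y'') = ((Finset.univ.filter fun i => y' i && (π y'') i).card.bodd ^^ h y'')) →
    (forrelation a b = 1 ∨ forrelation a b = -1) →
    ∀ x' x'' : Fin m → Bool,
      a (Fin.append x' x'') = ((Finset.univ.filter fun i => x'' i && (π.symm x') i).card.bodd ^^ h (π.symm x') ^^ decide (forrelation a b = -1))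

/-- **Two-tensor frame lock.** For ANY pair with `Φ(a,b) = ±1` and any M-subspace `V` of `b` (subspace, `|V|² = 2ⁿ`, all
second derivatives of `b` along `V` vanish): (i) `V^⊥` is an M-subspace of `a` (`dual_affine_on_perp_cosets` per coset +
`bxor_mem_perp` + `perp_perp_eq_of_sq`); (ii) all THIRD derivatives `D_w D_u D_v b` with `u, v ∈ V` vanish (`d3 = d2 ⊕ d2∘shift`),
i.e. `V ⊆ rad M^b_u` for `u ∈ V` — whence `Y_u ⊆ V^⊥` by antitonicity of `perp`; (iii) the same for `a` along `V^⊥`.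
No degree hypothesis. [card Lever / FrameIsotropy; Negative-note F2; Disproof (a′)] [cite: Carlet2020, Prop. 77] -/
def FrameLock : Prop :=
  ∀ (n : ℕ) (a b : (Fin n → Bool) → Bool) (V : Finset (Fin n → Bool)),
    (forrelation a b = 1 ∨ forrelation a b = -1) →
    ((zeroVec ∈ V ∧ ∀ x ∈ V, ∀ y ∈ V, bxor x y ∈ V) ∧ (((V).card : ℝ) ^ 2 = (2 : ℝ) ^ (n)) ∧ (∀ u ∈ V, ∀ v ∈ V, ∀ x, (b x ^^ b (bxor x u) ^^ b (bxor x v) ^^ b (bxor x (bxor u v))) = false)) →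
    ((zeroVec ∈ (Finset.univ.filter fun y => ∀ v ∈ V, twist v y = 1) ∧ ∀ x ∈ (Finset.univ.filter fun y => ∀ v ∈ V, twist v y = 1), ∀ y ∈ (Finset.univ.filter fun y => ∀ v ∈ V, twist v y = 1), bxor x y ∈ (Finset.univ.filter fun y => ∀ v ∈ V, twist v y = 1)) ∧ ((((Finset.univ.filter fun y => ∀ v ∈ V, twist v y = 1)).card : ℝ) ^ 2 = (2 : ℝ) ^ (n)) ∧ (∀ u ∈ (Finset.univ.filter fun y => ∀ v ∈ V, twist v y = 1), ∀ v ∈ (Finset.univ.filter fun y => ∀ v ∈ V, twist v y = 1), ∀ x, (a x ^^ a (bxor x u) ^^ a (bxor x v) ^^ a (bxor x (bxor u v))) = false)) ∧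
    (∀ u ∈ V, ∀ v ∈ V, ∀ w x : Fin n → Bool, ((b x ^^ b (bxor x u) ^^ b (bxor x v) ^^ b (bxor x (bxor u v))) ^^ (b (bxor x w) ^^ b (bxor (bxor x w) u) ^^ b (bxor (bxor x w) v) ^^ b (bxor (bxor x w) (bxor u v)))) = false) ∧
    (∀ u ∈ (Finset.univ.filter fun y => ∀ v ∈ V, twist v y = 1), ∀ v ∈ (Finset.univ.filter fun y => ∀ v ∈ V, twist v y = 1), ∀ w x : Fin n → Bool,
      ((a x ^^ a (bxor x u) ^^ a (bxor x v) ^^ a (bxor x (bxor u v))) ^^ (a (bxor x w) ^^ a (bxor (bxor x w) u) ^^ a (bxor (bxor x w) v) ^^ a (bxor (bxor x w) (bxor u v)))) = false)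

/-- **Sign readout from one M-subspace** (FlatTransfer at `s = 0`; the ONLY place the sign is touched). If `Φ(a,b) = ±1`,
`V` is an M-subspace of `b`, and `μ` is a slope of `a` on `V^⊥` (`(-1)^{a(x)}(-1)^{x·μ} = (-1)^{a(0)}` on `V^⊥`; exists by
`dual_affine_on_perp_cosets` at `x₀ = 0`), then `Φ(a,b) = (-1)^{a(0)} (-1)^{b(μ)}`. Proof: sign transport
`coset_sum_eq_of_forrelation_eq_one/neg_one` (landed) with `U = V^⊥`, `r = μ`; `U^⊥ = V` (`perp_perp_eq_of_sq`); the `a`-side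
sum is `|V^⊥|(-1)^{a 0}`, so the coset sum of `(-1)^b` over `μ ⊕ V` equals `± |V|`, all its terms agree
(`all_eq_of_sum_eq_card`), read the term `y = μ`. [card (1)/(3); Disproof (a); BIISO §1] [cite: AaronsonAmbainis2018, §1.1.1] -/
def SignReadout : Prop :=
  ∀ (n : ℕ) (a b : (Fin n → Bool) → Bool) (V : Finset (Fin n → Bool)) (μ : Fin n → Bool),
    (forrelation a b = 1 ∨ forrelation a b = -1) →
    ((zeroVec ∈ V ∧ ∀ x ∈ V, ∀ y ∈ V, bxor x y ∈ V) ∧ (((V).card : ℝ) ^ 2 = (2 : ℝ) ^ (n)) ∧ (∀ u ∈ V, ∀ v ∈ V, ∀ x, (b x ^^ b (bxor x u) ^^ b (bxor x v) ^^ b (bxor x (bxor u v))) = false)) →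
    (∀ x ∈ (Finset.univ.filter fun y => ∀ v ∈ V, twist v y = 1), signOf (a x) * twist x μ = signOf (a zeroVec)) →
    forrelation a b = signOf (a zeroVec) * signOf (b μ)

/-- The bit vector `v` read in `𝔽₂ⁿ`. -/
def toF2 (v : Fin n → Bool) : Fin n → ZMod 2 := fun i => if v i then 1 else 0

/-- The finset of bit vectors in the `𝔽₂`-row span of a list of rows (`F2Elim.rowSpan`). -/
def spanSet (n : ℕ) (L : List (List Bool)) : Finset (Fin n → Bool) :=
  @Finset.filter (Fin n → Bool) (fun v => (fun i => if v i then (1 : ZMod 2) else 0) ∈ F2Elim.rowSpan n L)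
    (Classical.decPred _) Finset.univ

/-- `g : 𝔽₂^{m+m} → 𝔽₂` lies on a **completed Maiorana–McFarland orbit**: verbatim the conclusion of crux r5
`ExactPairsMaioranaMcFarland` for `g` (an affine bijection `e`, a permutation `perm` of `𝔽₂^m` and `h` with
`g ∘ e (y', y'') = y'·perm(y'') + h(y'')`, written over `ZMod 2`). -/
def MMOrbit (g : (Fin (m + m) → Bool) → Bool) : Prop :=
  ∃ e : (Fin (m + m) → Bool) ≃ (Fin (m + m) → Bool),
    (∃ M : Matrix (Fin (m + m)) (Fin (m + m)) (ZMod 2), ∃ c : Fin (m + m) → ZMod 2,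
      ∀ y i, (if e y i then (1 : ZMod 2) else 0) = (M.mulVec (fun j => if y j then (1 : ZMod 2) else 0) + c) i) ∧
    ∃ perm : (Fin m → Bool) ≃ (Fin m → Bool), ∃ h : (Fin m → Bool) → Bool, ∀ y' y'' : Fin m → Bool,
      (if g (e (Fin.append y' y'')) then (1 : ZMod 2) else 0) =
        (∑ i, (if y' i then (1 : ZMod 2) else 0) * (if perm y'' i then (1 : ZMod 2) else 0)) +
          (if h y'' then (1 : ZMod 2) else 0)

/-- **The ping-pong finder as a polynomial-time FUNCTION (Transfer target C⁻ of the card; the OPEN stub's conclusion).**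
There is `find ∈ FP` such that for every two-circuit instance `⟨m+m, 2, C⟩` over `B₂` with both functions of degree
`≤ 3`, `Φ = ±1`, and whose second function `b = C 1` lies on a completed-MM orbit, `find` maps the instance code to the
register code (`encList`) of rows spanning an M-subspace of `b`. (Deterministic; output certifiable in polynomial time.) -/
def PairFinderMM : Prop :=
  ∃ find ∈ FP, ∀ (m : ℕ) (C : Fin 2 → Circuit (Fin (m + m))),
    (⟨m + m, 2, C⟩ : KForrelationInstance).IsOverB2 →
    (∀ i, IsDegLeFun 3 (C i).eval) →
    (forrelation (C 0).eval (C 1).eval = 1 ∨ forrelation (C 0).eval (C 1).eval = -1) →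
    MMOrbit (C 1).eval →
    ∃ L : List (List Bool), find (KForrelationInstance.encode ⟨m + m, 2, C⟩) = encList L ∧
      IsMSubspace (C 1).eval (spanSet (m + m) L)

/-- The same finder, correct on EVERY exact cubic instance (what the plumbing consumes; from `PairFinderMM` and crux r5 by
`pairFinderExact_of`). Tree vocabulary only (`IsMSubspace`/`spanSet` unfolded). -/
def PairFinderExact : Prop :=
  ∃ find ∈ FP, ∀ (I : KForrelationInstance) (hk : I.k = 2), Even I.n → I.IsOverB2 →
    (∀ i, IsDegLeFun 3 (I.C i).eval) → (I.value = 1 ∨ I.value = -1) →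
    ∃ L : List (List Bool), find I.encode = encList L ∧
      ((zeroVec ∈ (@Finset.filter (Fin (I.n) → Bool) (fun v => (fun i => if v i then (1 : ZMod 2) else 0) ∈ F2Elim.rowSpan (I.n) L) (Classical.decPred _) Finset.univ) ∧ ∀ x ∈ (@Finset.filter (Fin (I.n) → Bool) (fun v => (fun i => if v i then (1 : ZMod 2) else 0) ∈ F2Elim.rowSpan (I.n) L) (Classical.decPred _) Finset.univ), ∀ y ∈ (@Finset.filter (Fin (I.n) → Bool) (fun v => (fun i => if v i then (1 : ZMod 2) else 0) ∈ F2Elim.rowSpan (I.n) L) (Classical.decPred _) Finset.univ), bxor x y ∈ (@Finset.filter (Fin (I.n) → Bool) (fun v => (fun i => if v i then (1 : ZMod 2) else 0) ∈ F2Elim.rowSpan (I.n) L) (Classical.decPred _) Finset.univ)) ∧ ((((@Finset.filter (Fin (I.n) → Bool) (fun v => (fun i => if v i then (1 : ZMod 2) else 0) ∈ F2Elim.rowSpan (I.n) L) (Classical.decPred _) Finset.univ)).card : ℝ) ^ 2 = (2 : ℝ) ^ (I.n)) ∧ (∀ u ∈ (@Finset.filter (Fin (I.n) → Bool) (fun v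 => (fun i => if v i then (1 : ZMod 2) else 0) ∈ F2Elim.rowSpan (I.n) L) (Classical.decPred _) Finset.univ), ∀ v ∈ (@Finset.filter (Fin (I.n) → Bool) (fun v => (fun i => if v i then (1 : ZMod 2) else 0) ∈ F2Elim.rowSpan (I.n) L) (Classical.decPred _) Finset.univ), ∀ x, ((I.C (Fin.cast hk.symm 1)).eval x ^^ (I.C (Fin.cast hk.symm 1)).eval (bxor x u) ^^ (I.C (Fin.cast hk.symm 1)).eval (bxor x v) ^^ (I.C (Fin.cast hk.symm 1)).eval (bxor x (bxor u v))) = false))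

/-! ## Registered stubs (the only `sorry`s; each type is TREE VOCABULARY ONLY — land verbatim with `--supports`) -/

/-- stub (M, provable now — the card's amplification lemma + seed leak). Route: `IsDegLeFun 2` coordinates ⇒ third
differences of `π` vanish (degree-2 analogue of `Negative.xor3_of_isDegLeFun_one`, via `polyPhase`/ANF or Möbius), so
`B_π(v'',·)` is additive; `D_{(u',0)} g (y) = u'·π(y'')` for ANY `h` (the `h`-terms cancel), hence
`d3 g (u',0) (v',v'') w x = u'·B_π(v'',w'')`; (B) = "a linear endomorphism of `𝔽₂^m` with `w'' ≠ 0` in its kernel is not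
surjective" + a non-zero vector orthogonal to a proper subspace (`card_mul_card_perp`). -/
theorem stub_polarGeometry :
    ∀ (m : ℕ), 0 < m → ∀ (g : (Fin (m + m) → Bool) → Bool) (π : (Fin m → Bool) → (Fin m → Bool))
    (h : (Fin m → Bool) → Bool),
    (∀ y' y'' : Fin m → Bool, g (Fin.append y' y'') = ((Finset.univ.filter fun i => y' i && (π y'') i).card.bodd ^^ h y'')) →
    (∀ i, IsDegLeFun 2 fun y => π y i) →
    (∀ u' v' v'' : Fin m → Bool,
      (∀ w x : Fin (m + m) → Bool,
        ((g x ^^ g (bxor x (Fin.append u' zeroVec)) ^^ g (bxor x (Fin.append v' v'')) ^^ g (bxor x (bxor (Fin.append u' zeroVec) (Fin.append v' v'')))) ^^ (g (bxor x w) ^^ g (bxor (bxor x w) (Fin.append u' zeroVec)) ^^ g (bxor (bxor x w) (Fin.append v' v'')) ^^ g (bxor (bxor x w) (bxor (Fin.append u' zeroVec) (Fin.append v' v''))))) = false) ↔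
      ∀ w'' : Fin m → Bool,
        (Finset.univ.filter fun i => u' i && (π (bxor v'' w'') i ^^ π v'' i ^^ π w'' i ^^ π zeroVec i)).card.bodd = false) ∧
    (∀ w : Fin (m + m) → Bool, ∃ u' : Fin m → Bool, u' ≠ zeroVec ∧ ∀ v x : Fin (m + m) → Bool,
        ((g x ^^ g (bxor x w) ^^ g (bxor x (Fin.append u' zeroVec)) ^^ g (bxor x (bxor w (Fin.append u' zeroVec)))) ^^ (g (bxor x v) ^^ g (bxor (bxor x v) w) ^^ g (bxor (bxor x v) (Fin.append u' zeroVec)) ^^ g (bxor (bxor x v) (bxor w (Fin.append u' zeroVec))))) = false) :=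
  _root_.Summit.QuantumAdvantage.QuantumAdvantage.Theorems.SignedExactCubicForrelationNotPrBPP.stub_polarGeometry

/-- stub (M, provable now — McFarland's dual formula): `W_b(Fin.append x' x'') = 2^m (-1)^{h(π⁻¹ x') ⊕ x''·π⁻¹(x')}` by the
character sum over `y'` (split `∑` over `Fin (m+m) → Bool` along `Fin.append`, `Simon.sum_twist`-type orthogonality), then
`DerivativeWalsh.two_pow_mul_W_eq` + `fsum_signOf_eq` read `(-1)^{a} = Φ·2^{-m} W_b` pointwise. -/
theorem stub_dualShape :
    ∀ (m : ℕ) (a b : (Fin (m + m) → Bool) → Bool) (π : (Fin m → Bool) ≃ (Fin m → Bool))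
    (h : (Fin m → Bool) → Bool),
    (∀ y' y'' : Fin m → Bool, b (Fin.append y' y'') = ((Finset.univ.filter fun i => y' i && (π y'') i).card.bodd ^^ h y'')) →
    (forrelation a b = 1 ∨ forrelation a b = -1) →
    ∀ x' x'' : Fin m → Bool,
      a (Fin.append x' x'') = ((Finset.univ.filter fun i => x'' i && (π.symm x') i).card.bodd ^^ h (π.symm x') ^^ decide (forrelation a b = -1)) :=
  _root_.Summit.QuantumAdvantage.QuantumAdvantage.Theorems.SignedExactCubicForrelationNotPrBPP.stub_dualShape

/-- stub (S–M, provable now — the LOCK): (i) `DerivativeWalsh.dual_affine_on_perp_cosets` at `x₀ := x` gives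
`a(x ⊕ z) = a(x) ⊕ r·z` on `V^⊥`, so the four-term second difference along `u, v ∈ V^⊥` cancels; `bxor_mem_perp`,
`perp_perp_eq_of_sq` supply the subspace and cardinality clauses; (ii) `d3 = d2 ⊕ d2∘shift = false ⊕ false`; (iii) = (ii) for `a`
using (i). -/
theorem stub_frameLock :
    ∀ (n : ℕ) (a b : (Fin n → Bool) → Bool) (V : Finset (Fin n → Bool)),
    (forrelation a b = 1 ∨ forrelation a b = -1) →
    ((zeroVec ∈ V ∧ ∀ x ∈ V, ∀ y ∈ V, bxor x y ∈ V) ∧ (((V).card : ℝ) ^ 2 = (2 : ℝ) ^ (n)) ∧ (∀ u ∈ V, ∀ v ∈ V, ∀ x, (b x ^^ b (bxor x u) ^^ b (bxor x v) ^^ b (bxor x (bxor u v))) = false)) →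
    ((zeroVec ∈ (Finset.univ.filter fun y => ∀ v ∈ V, twist v y = 1) ∧ ∀ x ∈ (Finset.univ.filter fun y => ∀ v ∈ V, twist v y = 1), ∀ y ∈ (Finset.univ.filter fun y => ∀ v ∈ V, twist v y = 1), bxor x y ∈ (Finset.univ.filter fun y => ∀ v ∈ V, twist v y = 1)) ∧ ((((Finset.univ.filter fun y => ∀ v ∈ V, twist v y = 1)).card : ℝ) ^ 2 = (2 : ℝ) ^ (n)) ∧ (∀ u ∈ (Finset.univ.filter fun y => ∀ v ∈ V, twist v y = 1), ∀ v ∈ (Finset.univ.filter fun y => ∀ v ∈ V, twist v y = 1), ∀ x, (a x ^^ a (bxor x u) ^^ a (bxor x v) ^^ a (bxor x (bxor u v))) = false)) ∧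
    (∀ u ∈ V, ∀ v ∈ V, ∀ w x : Fin n → Bool, ((b x ^^ b (bxor x u) ^^ b (bxor x v) ^^ b (bxor x (bxor u v))) ^^ (b (bxor x w) ^^ b (bxor (bxor x w) u) ^^ b (bxor (bxor x w) v) ^^ b (bxor (bxor x w) (bxor u v)))) = false) ∧
    (∀ u ∈ (Finset.univ.filter fun y => ∀ v ∈ V, twist v y = 1), ∀ v ∈ (Finset.univ.filter fun y => ∀ v ∈ V, twist v y = 1), ∀ w x : Fin n → Bool,
      ((a x ^^ a (bxor x u) ^^ a (bxor x v) ^^ a (bxor x (bxor u v))) ^^ (a (bxor x w) ^^ a (bxor (bxor x w) u) ^^ a (bxor (bxor x w) v) ^^ a (bxor (bxor x w) (bxor u v)))) = false) :=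
  _root_.Summit.QuantumAdvantage.QuantumAdvantage.Theorems.SignedExactCubicForrelationNotPrBPP.stub_frameLock

/-- stub (S–M, provable now — the one sign identity of the line): `coset_sum_eq_of_forrelation_eq_one/_neg_one`
(`ForrelationSignTransport.lean`) at `U := V^⊥` (`bxor_mem_perp`), `r := μ`; `V^⊥⊥ = V` and `|V^⊥| = |V|` (`perp_perp_eq_of_sq`);
the `a`-side sum is `|V^⊥|·(-1)^{a 0}` by the slope hypothesis; the `b`-side coset sum over `{y : μ ⊕ y ∈ V}` is then `± |V|`,
so all its `±1` terms agree (`all_eq_of_sum_eq_card`); evaluate at `y = μ`. (The M-subspace clause of `b` is not even needed.) -/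
theorem stub_signReadout :
    ∀ (n : ℕ) (a b : (Fin n → Bool) → Bool) (V : Finset (Fin n → Bool)) (μ : Fin n → Bool),
    (forrelation a b = 1 ∨ forrelation a b = -1) →
    ((zeroVec ∈ V ∧ ∀ x ∈ V, ∀ y ∈ V, bxor x y ∈ V) ∧ (((V).card : ℝ) ^ 2 = (2 : ℝ) ^ (n)) ∧ (∀ u ∈ V, ∀ v ∈ V, ∀ x, (b x ^^ b (bxor x u) ^^ b (bxor x v) ^^ b (bxor x (bxor u v))) = false)) →
    (∀ x ∈ (Finset.univ.filter fun y => ∀ v ∈ V, twist v y = 1), signOf (a x) * twist x μ = signOf (a zeroVec)) →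
    forrelation a b = signOf (a zeroVec) * signOf (b μ) :=
  _root_.Summit.QuantumAdvantage.QuantumAdvantage.Theorems.SignedExactCubicForrelationNotPrBPP.stub_signReadout

/-- stub (L–XL formalisation, mathematics closed given its hypotheses — the `FP`/`TM2` decider and its wrapper).
Machine on `⟨x, y⟩` (coins `y` unused): parse `x = encode I` (reject junk), guard `k = 2` and the size guard
`n ≤ |x| + 1` (on the promise `b` is bent, so no input wire is idle: cf. `ForrelationIdleWires.lean`, `two_pow_mul_W_eq`);
`L := rows(find x)`; Gaussian elimination (`F2Elim`): a basis `x₁ … x_d` of `V^⊥ = {x : ⟨rows⟩·x = 0}`; evaluate `f := C 0` at `0`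
and at the `xᵢ` (`evalP`), solve `μ·xᵢ = f(xᵢ) ⊕ f(0)` for some `μ`, evaluate `g := C 1` at `μ`; ACCEPT iff `f(0) = g(μ)`.
Correctness on the promise: the first hypothesis ⇒ `V` is an M-subspace of `g`; `DerivativeWalsh.dual_affine_on_perp_cosets`
(landed) at `x₀ = 0` ⇒ a slope `μ₀` of `f` on `V^⊥` exists, and any solution `μ` of the basis equations has `μ·x = μ₀·x` on `V^⊥`;
the second hypothesis ⇒ `Φ = (-1)^{f 0}(-1)^{g μ}`, i.e. accept iff `Φ = 1`. Wrapper: `PromiseProblem.mem_PromiseBPP'_of_fp_decider`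
/ the pattern `CubicDequant.accept_codeFP`, `dec_mem_FP`, `mem_PromiseBPP'_of_accept` (`CubicForrelationEstimatorMachine.lean`),
`ForrCode` parsing, `F2Elim`, `StackLists.encList`; coin-independent event (`uniformProb ∈ {0,1}`). -/
theorem stub_plumbing :
    (∃ find ∈ FP, ∀ (I : KForrelationInstance) (hk : I.k = 2), Even I.n → I.IsOverB2 →
    (∀ i, IsDegLeFun 3 (I.C i).eval) → (I.value = 1 ∨ I.value = -1) →
    ∃ L : List (List Bool), find I.encode = encList L ∧
      ((zeroVec ∈ (@Finset.filter (Fin (I.n) → Bool) (fun v => (fun i => if v i then (1 : ZMod 2) else 0) ∈ F2Elim.rowSpan (I.n) L) (Classical.decPred _) Finset.univ) ∧ ∀ x ∈ (@Finset.filter (Fin (I.n) → Bool) (fun v => (fun i => if v i then (1 : ZMod 2) else 0) ∈ F2Elim.rowSpan (I.n) L) (Classical.decPred _) Finset.univ), ∀ y ∈ (@Finset.filter (Fin (I.n) → Bool) (fun v => (fun i => if v i then (1 : ZMod 2) else 0) ∈ F2Elim.rowSpan (I.n) L) (Classical.decPred _) Finset.univ), bxor x y ∈ (@Finset.filter (Fin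 (I.n) → Bool) (fun v => (fun i => if v i then (1 : ZMod 2) else 0) ∈ F2Elim.rowSpan (I.n) L) (Classical.decPred _) Finset.univ)) ∧ ((((@Finset.filter (Fin (I.n) → Bool) (fun v => (fun i => if v i then (1 : ZMod 2) else 0) ∈ F2Elim.rowSpan (I.n) L) (Classical.decPred _) Finset.univ)).card : ℝ) ^ 2 = (2 : ℝ) ^ (I.n)) ∧ (∀ u ∈ (@Finset.filter (Fin (I.n) → Bool) (fun v => (fun i => if v i then (1 : ZMod 2) else 0) ∈ F2Elim.rowSpan (I.n) L) (Classical.decPred _) Finset.univ), ∀ v ∈ (@Finset.filter (Fin (I.n) → Bool) (fun v => (fun i => if v i then (1 : ZMod 2) else 0) ∈ F2Elim.rowSpan (I.n) L) (Classical.decPred _) Finset.univ), ∀ x, ((I.C (Fin.cast hk.symm 1)).eval x ^^ (I.C (Fin.cast hk.symm 1)).eval (bxor x u) ^^ (I.C (Fin.cast hk.symm 1)).eval (bxor x v) ^^ (I.C (Fin.cast hk.symm 1)).eval (bxor x (bxor u v))) = false))) →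
    (∀ (n : ℕ) (a b : (Fin n → Bool) → Bool) (V : Finset (Fin n → Bool)) (μ : Fin n → Bool),
    (forrelation a b = 1 ∨ forrelation a b = -1) →
    ((zeroVec ∈ V ∧ ∀ x ∈ V, ∀ y ∈ V, bxor x y ∈ V) ∧ (((V).card : ℝ) ^ 2 = (2 : ℝ) ^ (n)) ∧ (∀ u ∈ V, ∀ v ∈ V, ∀ x, (b x ^^ b (bxor x u) ^^ b (bxor x v) ^^ b (bxor x (bxor u v))) = false)) →
    (∀ x ∈ (Finset.univ.filter fun y => ∀ v ∈ V, twist v y = 1), signOf (a x) * twist x μ = signOf (a zeroVec)) →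
    forrelation a b = signOf (a zeroVec) * signOf (b μ)) →
    signedExactCubicForrelationProblem 2 ∈ PromiseBPP' :=
  _root_.Summit.QuantumAdvantage.QuantumAdvantage.Theorems.SignedExactCubicForrelationNotPrBPP.stub_plumbing

/-! ## Proved glue: crux r5 puts every exact cubic instance on an MM orbit -/

/-! ## Proved glue: crux r5 puts every exact cubic instance on an MM orbit -/

/-- `Φ(¬f, g) = -Φ(f, g)`. -/
theorem forrelation_not_left (f g : (Fin n → Bool) → Bool) :
    forrelation (fun x => !f x) g = -forrelation f g := by
  unfold forrelation
  rw [← mul_neg, ← Finset.sum_neg_distrib]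
  congr 1
  refine Finset.sum_congr rfl fun x _ => ?_
  rw [← Finset.sum_neg_distrib]
  refine Finset.sum_congr rfl fun y _ => ?_
  rw [DerivativeWalsh.signOf_not]
  ring

/-- **r5 ⇒ the MM-orbit finder is total on the exact slice.** On an instance with `k = 2`, `n` even, cubic circuits
and `Φ = ±1`, crux r5 `ExactPairsMaioranaMcFarland` (applied to `(f, g)` if `Φ = 1`, to `(¬f, g)` if `Φ = -1`)
puts `g` on a completed-MM orbit, so `PairFinderMM` applies. -/
theorem pairFinderExact_of (hF : PairFinderMM) (h5 : ExactPairsMaioranaMcFarland) : PairFinderExact := by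
  obtain ⟨find, hfind, hspec⟩ := hF
  refine ⟨find, hfind, ?_⟩
  rintro ⟨n, k, C⟩ hk heven hB hdeg hv
  dsimp only at hk heven hB hdeg hv ⊢
  subst hk
  obtain ⟨m, rfl⟩ := heven
  rw [KForrelationInstance.value_mk_two] at hv
  have horb : MMOrbit (C 1).eval := by
    rcases hv with h | h
    · exact h5 m _ _ (hdeg 0) (hdeg 1) h
    · refine h5 m (fun x => !(C 0).eval x) _ (hdeg 0).not (hdeg 1) ?_
      rw [forrelation_not_left, h, neg_neg]
  exact hspec m C hB hdeg hv horb


/-! ## RESHAPE (continuation lead c1, 2026-08-16): the GROW finder — offset two-sided closure, no-trap theorem, kernel statistics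

The single open stub of the first lead (`stub_finderComplete`: completeness of the landed deterministic machine `findV2`,
budget `8(n+1)³`) is RETIRED: it is believed false on large Feistel-type instances with admissible cubic `h` (first lead's own
diagnosis, kit j015846) and a completeness proof about its list code is not a realistic proof object. The line is re-cut
"mathematics first" around the finder found in this session (toolkit `work/py`, kit j018063/j018132):

* OFFSET CLOSURE. For `v` in an M-subspace `V` of `b` the whole Walsh SUPPORT of `D_v b` lies in `V^⊥` (not only the row space
  of the slice `B_v = T_b(v,·,·)`): the support is the coset `ℓ_v + rowsp(B_v)` where `ℓ_v` represents the linear part of `D_v b`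
  on `rad B_v` — one more linear solve. A pair `(S ≤ 𝔽₂ⁿ, U ≤ 𝔽₂ⁿ)` is CLOSED when `rowsp(B_s) + ℓ_s ⊆ U` for `s ∈ S` and the same
  for `a` from `U` into `S`; closed + orthogonal ⇒ bi-flat; every M-pair `(V, V^⊥)` of an exact cubic pair is closed orthogonal
  (`stub_mpairClosed`).
* NO-TRAP THEOREM (`stub_noTrapTemplate`, `stub_noTrapTransport`; proved on paper this session, numerically 0 violations): for a
  Maiorana–McFarland pair EVERY closed orthogonal pair `(S, U)` extends to an M-pair: `V* := S + (Z_b(S) ∩ V)`. Key identity: writing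
  `S''`, `U'` for the hidden projections, closedness forces `U' = Σ_{t∈S''} (Im Dπ_t + ⟨π t + π 0⟩)` and the four-term chain
  `|S''| ≥ |ℰ_σ(U')| ≥ |U'| ≥ |ℰ_π(S'')| ≥ |S''|` (injectivity of `π`, `σ`) is all equalities — `S''` is a BLOCK of `π`.
* GROW = greedy extension of a closed orthogonal pair by candidates from random probe kernels `K(x₁…x_r) = ⋂ rad B_{x_j} ∩ Z_b(S) ∩ U^⊥`,
  accepted iff the closure of `(S + v, U)` stays orthogonal with both dimensions `≤ m`; by the no-trap theorem it is never stuck as long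
  as a good candidate is drawn, which is the ONE open statement `stub_kernelStats` (randomised seed supply). Locally and on the kit the
  procedure solves every family incl. the `findV2`-killers (Feistel `m = 24` admissible cubic `h`, `cube⁸`, mixtures; `n ≤ 96`).
* The finder uses COINS (random probes are uniform in the hidden coordinates, which makes the statistics disguise-free), so the
  plumbing is re-cut for a coin finder (`stub_plumbingCoins`, threshold `2/3`, decider = certified ? readout : reject).

Composition: `stub_kernelStats → stub_mpairClosed → PairFinderMMCoins` (`stub_growFinder`, the machine) ; `+ r5 → PairFinderExactCoins`
(`pairFinderExactCoins_of`, proved) ; `+ stub_signReadout → signedExact… ∈ PromiseBPP'` (`stub_plumbingCoins`) — concluding the route's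
negation item `SignedExactCubicForrelationInPrBPP` by name (`SignedExactCubicForrelationInPrBPP_of_stubs`). The two no-trap stubs feed
`seedExists` (existence half of the kernel statistics) and are the proof road of `stub_kernelStats`.

Every registered stub below is stated in TREE VOCABULARY ONLY (the notions `ClosedF`, `Orth`, `MSub`, `Good`, `Kset`, `goodMass` of
namespace `Grow` are UNFOLDED verbatim; the named `Prop`s are the same text, checked by the `example`s at the end). -/

namespace Grow

/-! ### Vocabulary of the GROW line (documentation; each notion is UNFOLDED verbatim inside the registered stub statements) -/

/-- Unit vector `e_k`. -/
def unitV (k : Fin n) : Fin n → Bool := fun j => decide (j = k)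

/-- `𝔽₂` dot product as a bit (any length). -/
def bd (u v : Fin n → Bool) : Bool := ((Finset.univ.filter fun i => u i && v i).card).bodd

/-- `v ∈ rad B^f_x`: the second derivative `D_x D_v f` is constant (all third derivatives `D_x D_v D_y f` vanish). -/
def InRad (f : (Fin n → Bool) → Bool) (x v : Fin n → Bool) : Prop :=
  ∀ y z : Fin n → Bool, (d2 f x v z ^^ d2 f x v (bxor z y)) = false

/-- CLOSEDNESS of `(S, U)` for `f` (machine form): every slice row `T_f(s, y, ·)` (`s ∈ S`) lies in `U`, and for every `s ∈ S`
some `ℓ ∈ U` represents the linear part of `D_s f` on `rad B_s` (the Walsh-support OFFSET of `D_s f`). -/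
def ClosedF (f : (Fin n → Bool) → Bool) (S U : Finset (Fin n → Bool)) : Prop :=
  (∀ s ∈ S, ∀ y : Fin n → Bool, (fun k => d2 f s y zeroVec ^^ d2 f s y (unitV k)) ∈ U) ∧
  (∀ s ∈ S, ∃ ℓ ∈ U, ∀ r : Fin n → Bool, InRad f s r → (f r ^^ f (bxor r s) ^^ f zeroVec ^^ f s) = bd ℓ r)

/-- Orthogonality of two finsets of vectors. -/
def Orth (S U : Finset (Fin n → Bool)) : Prop := ∀ s ∈ S, ∀ u ∈ U, bd s u = false

/-- M-subspace (= `IsMSubspace`). -/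
def MSub (f : (Fin n → Bool) → Bool) (V : Finset (Fin n → Bool)) : Prop :=
  (zeroVec ∈ V ∧ ∀ x ∈ V, ∀ y ∈ V, bxor x y ∈ V) ∧ ((V.card : ℝ) ^ 2 = (2 : ℝ) ^ n) ∧
    ∀ u ∈ V, ∀ v ∈ V, ∀ x, d2 f u v x = false

/-- `v` is a GOOD extension of `(S, U)`: it lies in an M-subspace of `f` containing `S` and orthogonal to `U`. -/
def Good (f : (Fin n → Bool) → Bool) (S U : Finset (Fin n → Bool)) (v : Fin n → Bool) : Prop :=
  ∃ V : Finset (Fin n → Bool), MSub f V ∧ S ⊆ V ∧ v ∈ V ∧ Orth V U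

/-- `Z_f(S) = {v : D_s D_v f ≡ 0 ∀ s ∈ S}` (a subspace). -/
def ZB (f : (Fin n → Bool) → Bool) (S : Finset (Fin n → Bool)) : Finset (Fin n → Bool) :=
  Finset.univ.filter fun v => ∀ s ∈ S, ∀ x, d2 f s v x = false

/-- Dot-orthogonal of a finset. -/
def perpB (S : Finset (Fin n → Bool)) : Finset (Fin n → Bool) := Finset.univ.filter fun y => ∀ s ∈ S, bd s y = false

/-- The candidate space of the probes `xs`: `K(xs) = Z_f(S) ∩ U^⊥ ∩ ⋂_j rad B^f_{xs j}`. Always contains `0`. -/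
def Kset (f : (Fin n → Bool) → Bool) (S U : Finset (Fin n → Bool)) {r : ℕ} (xs : Fin r → (Fin n → Bool)) :
    Finset (Fin n → Bool) :=
  Finset.univ.filter fun v => (∀ s ∈ S, ∀ x, d2 f s v x = false) ∧ (∀ u ∈ U, bd u v = false) ∧
    ∀ j, ∀ y z : Fin n → Bool, (d2 f (xs j) v z ^^ d2 f (xs j) v (bxor z y)) = false

/-- The GOOD FRACTION of the candidate space, summed over all probe tuples of length `r` ("average ≥ 1/q" reads `goodMass ≥ 2^{n r}/q`). -/
def goodMass (f : (Fin n → Bool) → Bool) (S U : Finset (Fin n → Bool)) (r : ℕ) : ℝ :=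
  ∑ xs : Fin r → (Fin n → Bool),
    ((@Finset.filter (Fin n → Bool) (fun v => v ∉ S ∧ Good f S U v) (Classical.decPred _) (Kset f S U xs)).card : ℝ) /
      ((Kset f S U xs).card : ℝ)

/-- **KERNEL STATISTICS (randomised seed supply) — the ONE open statement of the line.** On every two-circuit instance over `B₂`
with both functions cubic, `Φ = ±1` and `b = C 1` on a completed Maiorana–McFarland orbit, for every closed orthogonal pair `(S, U)`
(`S`, `U` subspaces, closed both ways, orthogonal) with `|S| < 2^m` and `|U| < 2^m`, for some number of probes `r ≤ n + 1` a uniformly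
random element of the candidate space of `r` uniform probes is a NEW GOOD vector with probability `≥ 1/(n+2)^8` — on the `b`-side
(growing `S`) or on the `a`-side (growing `U`). Evidence: kit j018063/j018132 + local sweeps (every family, `n ≤ 96`); proof road:
`seedExists` (no-trap) + kernel/junk codimension counts (lead NOTES). -/
def KernelStats : Prop :=
  ∀ (m : ℕ) (C : Fin 2 → Circuit (Fin (m + m))),
        (⟨m + m, 2, C⟩ : KForrelationInstance).IsOverB2 →
        (∀ i, IsDegLeFun 3 (C i).eval) →
        (forrelation (C 0).eval (C 1).eval = 1 ∨ forrelation (C 0).eval (C 1).eval = -1) →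
        (∃ e : (Fin (m + m) → Bool) ≃ (Fin (m + m) → Bool),
          (∃ M : Matrix (Fin (m + m)) (Fin (m + m)) (ZMod 2), ∃ c : Fin (m + m) → ZMod 2,
            ∀ y i, (if e y i then (1 : ZMod 2) else 0) = (M.mulVec (fun j => if y j then (1 : ZMod 2) else 0) + c) i) ∧
          ∃ perm : (Fin m → Bool) ≃ (Fin m → Bool), ∃ h : (Fin m → Bool) → Bool, ∀ y' y'' : Fin m → Bool,
            (if (C 1).eval (e (Fin.append y' y'')) then (1 : ZMod 2) else 0) =
              (∑ i, (if y' i then (1 : ZMod 2) else 0) * (if perm y'' i then (1 : ZMod 2) else 0)) +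
                (if h y'' then (1 : ZMod 2) else 0)) →
        ∀ S U : Finset (Fin (m + m) → Bool),
          (zeroVec ∈ S ∧ ∀ x ∈ S, ∀ y ∈ S, bxor x y ∈ S) → (zeroVec ∈ U ∧ ∀ x ∈ U, ∀ y ∈ U, bxor x y ∈ U) →
          ((∀ s ∈ S, ∀ y : Fin (m + m) → Bool, (fun k => ((C 1).eval zeroVec ^^ (C 1).eval (bxor zeroVec s) ^^ (C 1).eval (bxor zeroVec y) ^^ (C 1).eval (bxor zeroVec (bxor s y))) ^^ ((C 1).eval (fun j => decide (j = k)) ^^ (C 1).eval (bxor (fun j => decide (j = k)) s) ^^ (C 1).eval (bxor (fun j => decide (j = k)) y) ^^ (C 1).eval (bxor (fun j => decide (j = k)) (bxor s y)))) ∈ U) ∧ (∀ s ∈ S, ∃ ℓ ∈ U, ∀ r : Fin (m + m) → Bool, (∀ y z : Fin (m + m) → Bool, (((C 1).eval z ^^ (C 1).eval (bxor z s) ^^ (C 1).eval (bxor z r) ^^ (C 1).eval (bxor z (bxor s r))) ^^ ((C 1).eval (bxor z y) ^^ (C 1).eval (bxor (bxor z y) s) ^^ (C 1).eval (bxor (bxor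 z y) r) ^^ (C 1).eval (bxor (bxor z y) (bxor s r)))) = false) → ((C 1).eval r ^^ (C 1).eval (bxor r s) ^^ (C 1).eval zeroVec ^^ (C 1).eval s) = ((Finset.univ.filter fun i => ℓ i && r i).card).bodd)) →
          ((∀ s ∈ U, ∀ y : Fin (m + m) → Bool, (fun k => ((C 0).eval zeroVec ^^ (C 0).eval (bxor zeroVec s) ^^ (C 0).eval (bxor zeroVec y) ^^ (C 0).eval (bxor zeroVec (bxor s y))) ^^ ((C 0).eval (fun j => decide (j = k)) ^^ (C 0).eval (bxor (fun j => decide (j = k)) s) ^^ (C 0).eval (bxor (fun j => decide (j = k)) y) ^^ (C 0).eval (bxor (fun j => decide (j = k)) (bxor s y)))) ∈ S) ∧ (∀ s ∈ U, ∃ ℓ ∈ S, ∀ r : Fin (m + m) → Bool, (∀ y z : Fin (m + m) → Bool, (((C 0).eval z ^^ (C 0).eval (bxor z s) ^^ (C 0).eval (bxor z r) ^^ (C 0).eval (bxor z (bxor s r))) ^^ ((C 0).eval (bxor z y) ^^ (C 0).eval (bxor (bxor z y) s) ^^ (C 0).eval (bxor (bxor z y) r) ^^ (C 0).eval (bxor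 (bxor z y) (bxor s r)))) = false) → ((C 0).eval r ^^ (C 0).eval (bxor r s) ^^ (C 0).eval zeroVec ^^ (C 0).eval s) = ((Finset.univ.filter fun i => ℓ i && r i).card).bodd)) →
          (∀ s ∈ S, ∀ u ∈ U, ((Finset.univ.filter fun i => s i && u i).card).bodd = false) →
          S.card < 2 ^ m → U.card < 2 ^ m →
          (∃ r : ℕ, r ≤ m + m + 1 ∧ (2 : ℝ) ^ ((m + m) * r) / ((m + m + 2 : ℝ) ^ 8) ≤ (∑ xs : Fin (r) → (Fin (m + m) → Bool), (((@Finset.filter (Fin (m + m) → Bool) (fun v => v ∉ S ∧ (∃ V : Finset (Fin (m + m) → Bool), ((zeroVec ∈ V ∧ ∀ x ∈ V, ∀ y ∈ V, bxor x y ∈ V) ∧ (((V).card : ℝ) ^ 2 = (2 : ℝ) ^ (m + m)) ∧ ∀ u ∈ V, ∀ v ∈ V, ∀ x, ((C 1).eval x ^^ (C 1).eval (bxor x u) ^^ (C 1).eval (bxor x v) ^^ (C 1).eval (bxor x (bxor u v))) = false) ∧ S ⊆ V ∧ v ∈ V ∧ (∀ s ∈ V, ∀ u ∈ U, ((Finset.univ.filter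 fun i => s i && u i).card).bodd = false))) (Classical.decPred _) (Finset.univ.filter fun (v : Fin (m + m) → Bool) => (∀ s ∈ S, ∀ x, ((C 1).eval x ^^ (C 1).eval (bxor x s) ^^ (C 1).eval (bxor x v) ^^ (C 1).eval (bxor x (bxor s v))) = false) ∧ (∀ u ∈ U, ((Finset.univ.filter fun i => u i && v i).card).bodd = false) ∧ ∀ j, (∀ y z : Fin (m + m) → Bool, (((C 1).eval z ^^ (C 1).eval (bxor z (xs j)) ^^ (C 1).eval (bxor z v) ^^ (C 1).eval (bxor z (bxor (xs j) v))) ^^ ((C 1).eval (bxor z y) ^^ (C 1).eval (bxor (bxor z y) (xs j)) ^^ (C 1).eval (bxor (bxor z y) v) ^^ (C 1).eval (bxor (bxor z y) (bxor (xs j) v)))) = false))).card : ℝ) / (((Finset.univ.filter fun (v : Fin (m + m) → Bool) => (∀ s ∈ S, ∀ x, ((C 1).eval x ^^ (C 1).eval (bxor x s) ^^ (C 1).eval (bxor x v) ^^ (C 1).eval (bxor x (bxor s v))) = false) ∧ (∀ u ∈ U, ((Finset.univ.filter fun i => u i && v i).card).bodd = false) ∧ ∀ j, (∀ y z : Fin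 (m + m) → Bool, (((C 1).eval z ^^ (C 1).eval (bxor z (xs j)) ^^ (C 1).eval (bxor z v) ^^ (C 1).eval (bxor z (bxor (xs j) v))) ^^ ((C 1).eval (bxor z y) ^^ (C 1).eval (bxor (bxor z y) (xs j)) ^^ (C 1).eval (bxor (bxor z y) v) ^^ (C 1).eval (bxor (bxor z y) (bxor (xs j) v)))) = false))).card : ℝ)))) ∨
          (∃ r : ℕ, r ≤ m + m + 1 ∧ (2 : ℝ) ^ ((m + m) * r) / ((m + m + 2 : ℝ) ^ 8) ≤ (∑ xs : Fin (r) → (Fin (m + m) → Bool), (((@Finset.filter (Fin (m + m) → Bool) (fun v => v ∉ U ∧ (∃ V : Finset (Fin (m + m) → Bool), ((zeroVec ∈ V ∧ ∀ x ∈ V, ∀ y ∈ V, bxor x y ∈ V) ∧ (((V).card : ℝ) ^ 2 = (2 : ℝ) ^ (m + m)) ∧ ∀ u ∈ V, ∀ v ∈ V, ∀ x, ((C 0).eval x ^^ (C 0).eval (bxor x u) ^^ (C 0).eval (bxor x v) ^^ (C 0).eval (bxor x (bxor u v))) = false) ∧ U ⊆ V ∧ v ∈ V ∧ (∀ s ∈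 V, ∀ u ∈ S, ((Finset.univ.filter fun i => s i && u i).card).bodd = false))) (Classical.decPred _) (Finset.univ.filter fun (v : Fin (m + m) → Bool) => (∀ s ∈ U, ∀ x, ((C 0).eval x ^^ (C 0).eval (bxor x s) ^^ (C 0).eval (bxor x v) ^^ (C 0).eval (bxor x (bxor s v))) = false) ∧ (∀ u ∈ S, ((Finset.univ.filter fun i => u i && v i).card).bodd = false) ∧ ∀ j, (∀ y z : Fin (m + m) → Bool, (((C 0).eval z ^^ (C 0).eval (bxor z (xs j)) ^^ (C 0).eval (bxor z v) ^^ (C 0).eval (bxor z (bxor (xs j) v))) ^^ ((C 0).eval (bxor z y) ^^ (C 0).eval (bxor (bxor z y) (xs j)) ^^ (C 0).eval (bxor (bxor z y) v) ^^ (C 0).eval (bxor (bxor z y) (bxor (xs j) v)))) = false))).card : ℝ) / (((Finset.univ.filter fun (v : Fin (m + m) → Bool) => (∀ s ∈ U, ∀ x, ((C 0).eval x ^^ (C 0).eval (bxor x s) ^^ (C 0).eval (bxor x v) ^^ (C 0).eval (bxor x (bxor s v))) = false) ∧ (∀ u ∈ S, ((Finset.univ.filter fun i => u i && v i).card).bodd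 = false) ∧ ∀ j, (∀ y z : Fin (m + m) → Bool, (((C 0).eval z ^^ (C 0).eval (bxor z (xs j)) ^^ (C 0).eval (bxor z v) ^^ (C 0).eval (bxor z (bxor (xs j) v))) ^^ ((C 0).eval (bxor z y) ^^ (C 0).eval (bxor (bxor z y) (xs j)) ^^ (C 0).eval (bxor (bxor z y) v) ^^ (C 0).eval (bxor (bxor z y) (bxor (xs j) v)))) = false))).card : ℝ))))

/-- **Coin finder on the MM slice.** Some `find ∈ FP` on `⟨instance code, coins⟩` is SOUND on every coin string (a non-empty output
is the register code of rows spanning an M-subspace of `b`) and, with a polynomial number of coins, non-empty with probability `≥ 2/3`. -/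
def PairFinderMMCoins : Prop :=
  ∃ find ∈ FP, ∃ p : Polynomial ℕ, ∀ (m : ℕ) (C : Fin 2 → Circuit (Fin (m + m))),
        (⟨m + m, 2, C⟩ : KForrelationInstance).IsOverB2 →
        (∀ i, IsDegLeFun 3 (C i).eval) →
        (forrelation (C 0).eval (C 1).eval = 1 ∨ forrelation (C 0).eval (C 1).eval = -1) →
        (∃ e : (Fin (m + m) → Bool) ≃ (Fin (m + m) → Bool),
          (∃ M : Matrix (Fin (m + m)) (Fin (m + m)) (ZMod 2), ∃ c : Fin (m + m) → ZMod 2,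
            ∀ y i, (if e y i then (1 : ZMod 2) else 0) = (M.mulVec (fun j => if y j then (1 : ZMod 2) else 0) + c) i) ∧
          ∃ perm : (Fin m → Bool) ≃ (Fin m → Bool), ∃ h : (Fin m → Bool) → Bool, ∀ y' y'' : Fin m → Bool,
            (if (C 1).eval (e (Fin.append y' y'')) then (1 : ZMod 2) else 0) =
              (∑ i, (if y' i then (1 : ZMod 2) else 0) * (if perm y'' i then (1 : ZMod 2) else 0)) +
                (if h y'' then (1 : ZMod 2) else 0)) →
        (∀ (y : List Bool) (L : List (List Bool)),
            find (boolPair (KForrelationInstance.encode ⟨m + m, 2, C⟩) y) = encList L → L ≠ [] →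
            ((zeroVec ∈ (@Finset.filter (Fin (m + m) → Bool) (fun v => (fun i => if v i then (1 : ZMod 2) else 0) ∈ F2Elim.rowSpan (m + m) L) (Classical.decPred _) Finset.univ) ∧ ∀ x ∈ (@Finset.filter (Fin (m + m) → Bool) (fun v => (fun i => if v i then (1 : ZMod 2) else 0) ∈ F2Elim.rowSpan (m + m) L) (Classical.decPred _) Finset.univ), ∀ y ∈ (@Finset.filter (Fin (m + m) → Bool) (fun v => (fun i => if v i then (1 : ZMod 2) else 0) ∈ F2Elim.rowSpan (m + m) L) (Classical.decPred _) Finset.univ), bxor x y ∈ (@Finset.filter (Fin (m + m) → Bool) (fun v => (fun i => if v i then (1 : ZMod 2) else 0) ∈ F2Elim.rowSpan (m + m) L) (Classical.decPred _) Finset.univ)) ∧ ((((@Finset.filter (Fin (m + m) → Bool) (fun v => (fun i => if v i then (1 : ZMod 2) else 0) ∈ F2Elim.rowSpan (m + m) L) (Classical.decPred _) Finset.univ)).card : ℝ) ^ 2 = (2 : ℝ) ^ (m + m)) ∧ ∀ u ∈ (@Finset.filter (Fin (m + m) → Bool) (fun v => (fun i => if v i then (1 : ZMod 2) else 0) ∈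 F2Elim.rowSpan (m + m) L) (Classical.decPred _) Finset.univ), ∀ v ∈ (@Finset.filter (Fin (m + m) → Bool) (fun v => (fun i => if v i then (1 : ZMod 2) else 0) ∈ F2Elim.rowSpan (m + m) L) (Classical.decPred _) Finset.univ), ∀ x, ((C 1).eval x ^^ (C 1).eval (bxor x u) ^^ (C 1).eval (bxor x v) ^^ (C 1).eval (bxor x (bxor u v))) = false)) ∧
        (2 / 3 : ℝ) ≤ uniformProb (p.eval (KForrelationInstance.encode ⟨m + m, 2, C⟩).length)
            {y | ∃ L : List (List Bool), L ≠ [] ∧ find (boolPair (KForrelationInstance.encode ⟨m + m, 2, C⟩) y) = encList L}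

/-- The same coin finder, correct on EVERY exact cubic instance (what the coin plumbing consumes; from `PairFinderMMCoins` and
crux r5 by `pairFinderExactCoins_of`). -/
def PairFinderExactCoins : Prop :=
  ∃ find ∈ FP, ∃ p : Polynomial ℕ, ∀ (I : KForrelationInstance) (hk : I.k = 2), Even I.n → I.IsOverB2 →
        (∀ i, IsDegLeFun 3 (I.C i).eval) → (I.value = 1 ∨ I.value = -1) →
        (∀ (y : List Bool) (L : List (List Bool)), find (boolPair I.encode y) = encList L → L ≠ [] →
          ((zeroVec ∈ (@Finset.filter (Fin (I.n) → Bool) (fun v => (fun i => if v i then (1 : ZMod 2) else 0) ∈ F2Elim.rowSpan (I.n) L) (Classical.decPred _) Finset.univ) ∧ ∀ x ∈ (@Finset.filter (Fin (I.n) → Bool) (fun v => (fun i => if v i then (1 : ZMod 2) else 0) ∈ F2Elim.rowSpan (I.n) L) (Classical.decPred _) Finset.univ), ∀ y ∈ (@Finset.filter (Fin (I.n) → Bool) (fun v => (fun i => if v i then (1 : ZMod 2) else 0) ∈ F2Elim.rowSpan (I.n) L) (Classical.decPred _) Finset.univ), bxor x y ∈ (@Finset.filter (Fin (I.n) → Bool)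 (fun v => (fun i => if v i then (1 : ZMod 2) else 0) ∈ F2Elim.rowSpan (I.n) L) (Classical.decPred _) Finset.univ)) ∧ ((((@Finset.filter (Fin (I.n) → Bool) (fun v => (fun i => if v i then (1 : ZMod 2) else 0) ∈ F2Elim.rowSpan (I.n) L) (Classical.decPred _) Finset.univ)).card : ℝ) ^ 2 = (2 : ℝ) ^ (I.n)) ∧ ∀ u ∈ (@Finset.filter (Fin (I.n) → Bool) (fun v => (fun i => if v i then (1 : ZMod 2) else 0) ∈ F2Elim.rowSpan (I.n) L) (Classical.decPred _) Finset.univ), ∀ v ∈ (@Finset.filter (Fin (I.n) → Bool) (fun v => (fun i => if v i then (1 : ZMod 2) else 0) ∈ F2Elim.rowSpan (I.n) L) (Classical.decPred _) Finset.univ), ∀ x, ((I.C (Fin.cast hk.symm 1)).eval x ^^ (I.C (Fin.cast hk.symm 1)).eval (bxor x u) ^^ (I.C (Fin.cast hk.symm 1)).eval (bxor x v) ^^ (I.C (Fin.cast hk.symm 1)).eval (bxor x (bxor u v))) = false)) ∧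
        (2 / 3 : ℝ) ≤ uniformProb (p.eval I.encode.length)
            {y | ∃ L : List (List Bool), L ≠ [] ∧ find (boolPair I.encode y) = encList L}

/-- The no-trap theorem in TEMPLATE coordinates (statement of `stub_noTrapTemplate`). -/
def NoTrapTemplate : Prop :=
  ∀ (m : ℕ) (a b : (Fin (m + m) → Bool) → Bool) (π : (Fin m → Bool) ≃ (Fin m → Bool))
        (h : (Fin m → Bool) → Bool) (c : Bool),
        (∀ i, IsDegLeFun 2 fun y => π y i) → (∀ i, IsDegLeFun 2 fun x => π.symm x i) →
        IsDegLeFun 3 a → IsDegLeFun 3 b →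
        (∀ y' y'' : Fin m → Bool, b (Fin.append y' y'') = (((Finset.univ.filter fun i => y' i && (π y'') i).card.bodd) ^^ h y'')) →
        (∀ x' x'' : Fin m → Bool, a (Fin.append x' x'') =
          (((Finset.univ.filter fun i => x'' i && (π.symm x') i).card.bodd) ^^ h (π.symm x') ^^ c)) →
        ∀ S U : Finset (Fin (m + m) → Bool),
          (zeroVec ∈ S ∧ ∀ x ∈ S, ∀ y ∈ S, bxor x y ∈ S) → (zeroVec ∈ U ∧ ∀ x ∈ U, ∀ y ∈ U, bxor x y ∈ U) →
          ((∀ s ∈ S, ∀ y : Fin (m + m) → Bool, (fun k => (b zeroVec ^^ b (bxor zeroVec s) ^^ b (bxor zeroVec y) ^^ b (bxor zeroVec (bxor s y))) ^^ (b (fun j => decide (j = k)) ^^ b (bxor (fun j => decide (j = k)) s) ^^ b (bxor (fun j => decide (j = k)) y) ^^ b (bxor (fun j => decide (j = k)) (bxor s y)))) ∈ U) ∧ (∀ s ∈ S, ∃ ℓ ∈ U, ∀ r : Fin (m + m) → Bool, (∀ y z : Fin (m + m) → Bool, ((b z ^^ b (bxor z s) ^^ b (bxor z r) ^^ b (bxor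 z (bxor s r))) ^^ (b (bxor z y) ^^ b (bxor (bxor z y) s) ^^ b (bxor (bxor z y) r) ^^ b (bxor (bxor z y) (bxor s r)))) = false) → (b r ^^ b (bxor r s) ^^ b zeroVec ^^ b s) = ((Finset.univ.filter fun i => ℓ i && r i).card).bodd)) →
          ((∀ s ∈ U, ∀ y : Fin (m + m) → Bool, (fun k => (a zeroVec ^^ a (bxor zeroVec s) ^^ a (bxor zeroVec y) ^^ a (bxor zeroVec (bxor s y))) ^^ (a (fun j => decide (j = k)) ^^ a (bxor (fun j => decide (j = k)) s) ^^ a (bxor (fun j => decide (j = k)) y) ^^ a (bxor (fun j => decide (j = k)) (bxor s y)))) ∈ S) ∧ (∀ s ∈ U, ∃ ℓ ∈ S, ∀ r : Fin (m + m) → Bool, (∀ y z : Fin (m + m) → Bool, ((a z ^^ a (bxor z s) ^^ a (bxor z r) ^^ a (bxor z (bxor s r))) ^^ (a (bxor z y) ^^ a (bxor (bxor z y) s) ^^ a (bxor (bxor z y) r) ^^ a (bxor (bxor z y) (bxor s r)))) = false) → (a r ^^ a (bxor r s) ^^ a zeroVec ^^ a s) = ((Finset.univ.filter fun i => ℓ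 i && r i).card).bodd)) →
          (∀ s ∈ S, ∀ u ∈ U, ((Finset.univ.filter fun i => s i && u i).card).bodd = false) →
          ∃ V : Finset (Fin (m + m) → Bool), ((zeroVec ∈ V ∧ ∀ x ∈ V, ∀ y ∈ V, bxor x y ∈ V) ∧ (((V).card : ℝ) ^ 2 = (2 : ℝ) ^ (m + m)) ∧ ∀ u ∈ V, ∀ v ∈ V, ∀ x, (b x ^^ b (bxor x u) ^^ b (bxor x v) ^^ b (bxor x (bxor u v))) = false) ∧ S ⊆ V ∧ (∀ s ∈ V, ∀ u ∈ U, ((Finset.univ.filter fun i => s i && u i).card).bodd = false)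

/-- The no-trap theorem on ORBITS (conclusion of `stub_noTrapTransport`). -/
def NoTrapOrbit : Prop :=
  ∀ (m : ℕ) (a b : (Fin (m + m) → Bool) → Bool),
        IsDegLeFun 3 a → IsDegLeFun 3 b → (forrelation a b = 1 ∨ forrelation a b = -1) →
        (∃ e : (Fin (m + m) → Bool) ≃ (Fin (m + m) → Bool),
          (∃ M : Matrix (Fin (m + m)) (Fin (m + m)) (ZMod 2), ∃ c : Fin (m + m) → ZMod 2,
            ∀ y i, (if e y i then (1 : ZMod 2) else 0) = (M.mulVec (fun j => if y j then (1 : ZMod 2) else 0) + c) i) ∧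
          ∃ perm : (Fin m → Bool) ≃ (Fin m → Bool), ∃ h : (Fin m → Bool) → Bool, ∀ y' y'' : Fin m → Bool,
            (if b (e (Fin.append y' y'')) then (1 : ZMod 2) else 0) =
              (∑ i, (if y' i then (1 : ZMod 2) else 0) * (if perm y'' i then (1 : ZMod 2) else 0)) +
                (if h y'' then (1 : ZMod 2) else 0)) →
        ∀ S U : Finset (Fin (m + m) → Bool),
          (zeroVec ∈ S ∧ ∀ x ∈ S, ∀ y ∈ S, bxor x y ∈ S) → (zeroVec ∈ U ∧ ∀ x ∈ U, ∀ y ∈ U, bxor x y ∈ U) →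
          ((∀ s ∈ S, ∀ y : Fin (m + m) → Bool, (fun k => (b zeroVec ^^ b (bxor zeroVec s) ^^ b (bxor zeroVec y) ^^ b (bxor zeroVec (bxor s y))) ^^ (b (fun j => decide (j = k)) ^^ b (bxor (fun j => decide (j = k)) s) ^^ b (bxor (fun j => decide (j = k)) y) ^^ b (bxor (fun j => decide (j = k)) (bxor s y)))) ∈ U) ∧ (∀ s ∈ S, ∃ ℓ ∈ U, ∀ r : Fin (m + m) → Bool, (∀ y z : Fin (m + m) → Bool, ((b z ^^ b (bxor z s) ^^ b (bxor z r) ^^ b (bxor z (bxor s r))) ^^ (b (bxor z y) ^^ b (bxor (bxor z y) s) ^^ b (bxor (bxor z y) r) ^^ b (bxor (bxor z y) (bxor s r)))) = false) → (b r ^^ b (bxor r s) ^^ b zeroVec ^^ b s) = ((Finset.univ.filter fun i => ℓ i && r i).card).bodd)) →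
          ((∀ s ∈ U, ∀ y : Fin (m + m) → Bool, (fun k => (a zeroVec ^^ a (bxor zeroVec s) ^^ a (bxor zeroVec y) ^^ a (bxor zeroVec (bxor s y))) ^^ (a (fun j => decide (j = k)) ^^ a (bxor (fun j => decide (j = k)) s) ^^ a (bxor (fun j => decide (j = k)) y) ^^ a (bxor (fun j => decide (j = k)) (bxor s y)))) ∈ S) ∧ (∀ s ∈ U, ∃ ℓ ∈ S, ∀ r : Fin (m + m) → Bool, (∀ y z : Fin (m + m) → Bool, ((a z ^^ a (bxor z s) ^^ a (bxor z r) ^^ a (bxor z (bxor s r))) ^^ (a (bxor z y) ^^ a (bxor (bxor z y) s) ^^ a (bxor (bxor z y) r) ^^ a (bxor (bxor z y) (bxor s r)))) = false) → (a r ^^ a (bxor r s) ^^ a zeroVec ^^ a s) = ((Finset.univ.filter fun i => ℓ i && r i).card).bodd)) →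
          (∀ s ∈ S, ∀ u ∈ U, ((Finset.univ.filter fun i => s i && u i).card).bodd = false) →
          ∃ V : Finset (Fin (m + m) → Bool), ((zeroVec ∈ V ∧ ∀ x ∈ V, ∀ y ∈ V, bxor x y ∈ V) ∧ (((V).card : ℝ) ^ 2 = (2 : ℝ) ^ (m + m)) ∧ ∀ u ∈ V, ∀ v ∈ V, ∀ x, (b x ^^ b (bxor x u) ^^ b (bxor x v) ^^ b (bxor x (bxor u v))) = false) ∧ S ⊆ V ∧ (∀ s ∈ V, ∀ u ∈ U, ((Finset.univ.filter fun i => s i && u i).card).bodd = false)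

/-- M-PAIRS ARE CLOSED ORTHOGONAL PAIRS (statement of `stub_mpairClosed`). -/
def MPairClosed : Prop :=
  ∀ (n : ℕ) (a b : (Fin n → Bool) → Bool) (V : Finset (Fin n → Bool)),
        IsDegLeFun 3 a → IsDegLeFun 3 b → (forrelation a b = 1 ∨ forrelation a b = -1) →
        ((zeroVec ∈ V ∧ ∀ x ∈ V, ∀ y ∈ V, bxor x y ∈ V) ∧ (((V).card : ℝ) ^ 2 = (2 : ℝ) ^ (n)) ∧ ∀ u ∈ V, ∀ v ∈ V, ∀ x, (b x ^^ b (bxor x u) ^^ b (bxor x v) ^^ b (bxor x (bxor u v))) = false) →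
        ((∀ s ∈ V, ∀ y : Fin (n) → Bool, (fun k => (b zeroVec ^^ b (bxor zeroVec s) ^^ b (bxor zeroVec y) ^^ b (bxor zeroVec (bxor s y))) ^^ (b (fun j => decide (j = k)) ^^ b (bxor (fun j => decide (j = k)) s) ^^ b (bxor (fun j => decide (j = k)) y) ^^ b (bxor (fun j => decide (j = k)) (bxor s y)))) ∈ (Finset.univ.filter fun (y : Fin (n) → Bool) => ∀ s ∈ V, ((Finset.univ.filter fun i => s i && y i).card).bodd = false)) ∧ (∀ s ∈ V, ∃ ℓ ∈ (Finset.univ.filter fun (y : Fin (n) → Bool) => ∀ s ∈ V, ((Finset.univ.filter fun i => s i && y i).card).bodd = false), ∀ r : Fin (n) → Bool, (∀ y z : Fin (n) → Bool, ((b z ^^ b (bxor z s) ^^ b (bxor z r) ^^ b (bxor z (bxor s r))) ^^ (b (bxor z y) ^^ b (bxor (bxor z y) s) ^^ b (bxor (bxor z y) r) ^^ b (bxor (bxor z y) (bxor s r)))) = false) → (b r ^^ b (bxor r s) ^^ b zeroVec ^^ b s) = ((Finset.univ.filter fun i => ℓ i && r i).card).bodd)) ∧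
        ((∀ s ∈ (Finset.univ.filter fun (y : Fin (n) → Bool) => ∀ s ∈ V, ((Finset.univ.filter fun i => s i && y i).card).bodd = false), ∀ y : Fin (n) → Bool, (fun k => (a zeroVec ^^ a (bxor zeroVec s) ^^ a (bxor zeroVec y) ^^ a (bxor zeroVec (bxor s y))) ^^ (a (fun j => decide (j = k)) ^^ a (bxor (fun j => decide (j = k)) s) ^^ a (bxor (fun j => decide (j = k)) y) ^^ a (bxor (fun j => decide (j = k)) (bxor s y)))) ∈ V) ∧ (∀ s ∈ (Finset.univ.filter fun (y : Fin (n) → Bool) => ∀ s ∈ V, ((Finset.univ.filter fun i => s i && y i).card).bodd = false), ∃ ℓ ∈ V, ∀ r : Fin (n) → Bool, (∀ y z : Fin (n) → Bool, ((a z ^^ a (bxor z s) ^^ a (bxor z r) ^^ a (bxor z (bxor s r))) ^^ (a (bxor z y) ^^ a (bxor (bxor z y) s) ^^ a (bxor (bxor z y) r) ^^ a (bxor (bxor z y) (bxor s r)))) = false) → (a r ^^ a (bxor r s) ^^ a zeroVec ^^ a s) = ((Finset.univ.filter fun i => ℓ i && r i).card).bodd)) ∧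
        (∀ s ∈ V, ∀ u ∈ (Finset.univ.filter fun (y : Fin (n) → Bool) => ∀ s ∈ V, ((Finset.univ.filter fun i => s i && y i).card).bodd = false), ((Finset.univ.filter fun i => s i && u i).card).bodd = false)

/-! ### Registered stubs of the GROW line (the only `sorry`s; each type is TREE VOCABULARY ONLY — land verbatim with `--supports`) -/

/-- stub (LANDED p116895 by wave-1 worker, 2026-08-16; helpers p110099, p112742): the NO-TRAP theorem in template coordinates. For
`b = y'·π(y'') ⊕ h(y'')`, `a = x''·σ(x') ⊕ h(σ x') ⊕ c` (`σ = π⁻¹`, both with quadratic coordinates) and a closed orthogonal pair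
`(S, U)`: with `S'' = proj''(S)`, `U' = proj'(U)`, `E_π(t) = Im P_t + ⟨π t ⊕ π 0⟩` (`P_t` = linear part of `D_t π`):
(a) closedness ⇒ `U' ⊇ Σ_{t∈S''} E_π(t)` (the slice rows of `s = (w',t)` project onto `Im P_t`, the offset onto `π t ⊕ π 0 + Im P_t`)
and symmetrically `S'' ⊇ Σ_{u'∈U'} E_σ(u')`; (b) `|Σ_{t∈T} E_π(t)| ≥ |T|` (it contains the `|T|` distinct vectors `π t ⊕ π 0`); (c) hence
the chain `|S''| ≥ |ℰ_σ(U')| ≥ |U'| ≥ |ℰ_π(S'')| ≥ |S''|` is all equalities and `U' = ℰ_π(S'')`; (d) `V* := S + (G × 0)` with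
`G := ℰ_π(S'')^⊥ = {v' : D_{(v',0)} D_s b ≡ 0 ∀ s ∈ S}` is `b`-flat (closed+orthogonal ⇒ `S` flat; `G × 0 ⊆ V` flat; cross terms by
definition of `G`), `S ∩ (G × 0) = S ∩ V`, so `|V*| = 2^m`; and `U ⊥ G × 0` because `U' = ℰ_π(S'')`. -/
theorem stub_noTrapTemplate :
    ∀ (m : ℕ) (a b : (Fin (m + m) → Bool) → Bool) (π : (Fin m → Bool) ≃ (Fin m → Bool))
        (h : (Fin m → Bool) → Bool) (c : Bool),
        (∀ i, IsDegLeFun 2 fun y => π y i) → (∀ i, IsDegLeFun 2 fun x => π.symm x i) →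
        IsDegLeFun 3 a → IsDegLeFun 3 b →
        (∀ y' y'' : Fin m → Bool, b (Fin.append y' y'') = (((Finset.univ.filter fun i => y' i && (π y'') i).card.bodd) ^^ h y'')) →
        (∀ x' x'' : Fin m → Bool, a (Fin.append x' x'') =
          (((Finset.univ.filter fun i => x'' i && (π.symm x') i).card.bodd) ^^ h (π.symm x') ^^ c)) →
        ∀ S U : Finset (Fin (m + m) → Bool),
          (zeroVec ∈ S ∧ ∀ x ∈ S, ∀ y ∈ S, bxor x y ∈ S) → (zeroVec ∈ U ∧ ∀ x ∈ U, ∀ y ∈ U, bxor x y ∈ U) →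
          ((∀ s ∈ S, ∀ y : Fin (m + m) → Bool, (fun k => (b zeroVec ^^ b (bxor zeroVec s) ^^ b (bxor zeroVec y) ^^ b (bxor zeroVec (bxor s y))) ^^ (b (fun j => decide (j = k)) ^^ b (bxor (fun j => decide (j = k)) s) ^^ b (bxor (fun j => decide (j = k)) y) ^^ b (bxor (fun j => decide (j = k)) (bxor s y)))) ∈ U) ∧ (∀ s ∈ S, ∃ ℓ ∈ U, ∀ r : Fin (m + m) → Bool, (∀ y z : Fin (m + m) → Bool, ((b z ^^ b (bxor z s) ^^ b (bxor z r) ^^ b (bxor z (bxor s r))) ^^ (b (bxor z y) ^^ b (bxor (bxor z y) s) ^^ b (bxor (bxor z y) r) ^^ b (bxor (bxor z y) (bxor s r)))) = false) → (b r ^^ b (bxor r s) ^^ b zeroVec ^^ b s) = ((Finset.univ.filter fun i => ℓ i && r i).card).bodd)) →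
          ((∀ s ∈ U, ∀ y : Fin (m + m) → Bool, (fun k => (a zeroVec ^^ a (bxor zeroVec s) ^^ a (bxor zeroVec y) ^^ a (bxor zeroVec (bxor s y))) ^^ (a (fun j => decide (j = k)) ^^ a (bxor (fun j => decide (j = k)) s) ^^ a (bxor (fun j => decide (j = k)) y) ^^ a (bxor (fun j => decide (j = k)) (bxor s y)))) ∈ S) ∧ (∀ s ∈ U, ∃ ℓ ∈ S, ∀ r : Fin (m + m) → Bool, (∀ y z : Fin (m + m) → Bool, ((a z ^^ a (bxor z s) ^^ a (bxor z r) ^^ a (bxor z (bxor s r))) ^^ (a (bxor z y) ^^ a (bxor (bxor z y) s) ^^ a (bxor (bxor z y) r) ^^ a (bxor (bxor z y) (bxor s r)))) = false) → (a r ^^ a (bxor r s) ^^ a zeroVec ^^ a s) = ((Finset.univ.filter fun i => ℓ i && r i).card).bodd)) →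
          (∀ s ∈ S, ∀ u ∈ U, ((Finset.univ.filter fun i => s i && u i).card).bodd = false) →
          ∃ V : Finset (Fin (m + m) → Bool), ((zeroVec ∈ V ∧ ∀ x ∈ V, ∀ y ∈ V, bxor x y ∈ V) ∧ (((V).card : ℝ) ^ 2 = (2 : ℝ) ^ (m + m)) ∧ ∀ u ∈ V, ∀ v ∈ V, ∀ x, (b x ^^ b (bxor x u) ^^ b (bxor x v) ^^ b (bxor x (bxor u v))) = false) ∧ S ⊆ V ∧ (∀ s ∈ V, ∀ u ∈ U, ((Finset.univ.filter fun i => s i && u i).card).bodd = false) :=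
  _root_.Summit.QuantumAdvantage.QuantumAdvantage.Theorems.SignedExactCubicForrelationNotPrBPP.stub_noTrapTemplate

/-- stub (LANDED p119982 by wave-1 worker, 2026-08-16; helper p119429): the no-trap theorem transported along the orbit. From the MM-orbit datum
`(e, perm, h)` of `b` put `b₀ := b ∘ e` (template shape; `perm`, `perm⁻¹` have quadratic coordinates because `b₀` and the dual are
cubic), transport `a` to the template dual `a₀` (`stub_dualShape` on the transported exact pair: `forrelation` is invariant under
`y ↦ My ⊕ c`, `x ↦ M⁻ᵀ x` with the dual affine twists), apply the hypothesis to the transported pair `(S₀, U₀)` and map the M-subspace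
back; closedness / orthogonality / M-subspaces are covariant (third and second derivatives transform by `M`, offsets by `M⁻ᵀ`, added
affine terms drop out of every second derivative). -/
theorem stub_noTrapTransport :
    (∀ (m : ℕ) (a b : (Fin (m + m) → Bool) → Bool) (π : (Fin m → Bool) ≃ (Fin m → Bool))
        (h : (Fin m → Bool) → Bool) (c : Bool),
        (∀ i, IsDegLeFun 2 fun y => π y i) → (∀ i, IsDegLeFun 2 fun x => π.symm x i) →
        IsDegLeFun 3 a → IsDegLeFun 3 b →
        (∀ y' y'' : Fin m → Bool, b (Fin.append y' y'') = (((Finset.univ.filter fun i => y' i && (π y'') i).card.bodd) ^^ h y'')) →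
        (∀ x' x'' : Fin m → Bool, a (Fin.append x' x'') =
          (((Finset.univ.filter fun i => x'' i && (π.symm x') i).card.bodd) ^^ h (π.symm x') ^^ c)) →
        ∀ S U : Finset (Fin (m + m) → Bool),
          (zeroVec ∈ S ∧ ∀ x ∈ S, ∀ y ∈ S, bxor x y ∈ S) → (zeroVec ∈ U ∧ ∀ x ∈ U, ∀ y ∈ U, bxor x y ∈ U) →
          ((∀ s ∈ S, ∀ y : Fin (m + m) → Bool, (fun k => (b zeroVec ^^ b (bxor zeroVec s) ^^ b (bxor zeroVec y) ^^ b (bxor zeroVec (bxor s y))) ^^ (b (fun j => decide (j = k)) ^^ b (bxor (fun j => decide (j = k)) s) ^^ b (bxor (fun j => decide (j = k)) y) ^^ b (bxor (fun j => decide (j = k)) (bxor s y)))) ∈ U) ∧ (∀ s ∈ S, ∃ ℓ ∈ U, ∀ r : Fin (m + m) → Bool, (∀ y z : Fin (m + m) → Bool, ((b z ^^ b (bxor z s) ^^ b (bxor z r) ^^ b (bxor z (bxor s r))) ^^ (b (bxor z y) ^^ b (bxor (bxor z y) s) ^^ b (bxor (bxor z y) r) ^^ b (bxor (bxor z y) (bxor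 s r)))) = false) → (b r ^^ b (bxor r s) ^^ b zeroVec ^^ b s) = ((Finset.univ.filter fun i => ℓ i && r i).card).bodd)) →
          ((∀ s ∈ U, ∀ y : Fin (m + m) → Bool, (fun k => (a zeroVec ^^ a (bxor zeroVec s) ^^ a (bxor zeroVec y) ^^ a (bxor zeroVec (bxor s y))) ^^ (a (fun j => decide (j = k)) ^^ a (bxor (fun j => decide (j = k)) s) ^^ a (bxor (fun j => decide (j = k)) y) ^^ a (bxor (fun j => decide (j = k)) (bxor s y)))) ∈ S) ∧ (∀ s ∈ U, ∃ ℓ ∈ S, ∀ r : Fin (m + m) → Bool, (∀ y z : Fin (m + m) → Bool, ((a z ^^ a (bxor z s) ^^ a (bxor z r) ^^ a (bxor z (bxor s r))) ^^ (a (bxor z y) ^^ a (bxor (bxor z y) s) ^^ a (bxor (bxor z y) r) ^^ a (bxor (bxor z y) (bxor s r)))) = false) → (a r ^^ a (bxor r s) ^^ a zeroVec ^^ a s) = ((Finset.univ.filter fun i => ℓ i && r i).card).bodd)) →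
          (∀ s ∈ S, ∀ u ∈ U, ((Finset.univ.filter fun i => s i && u i).card).bodd = false) →
          ∃ V : Finset (Fin (m + m) → Bool), ((zeroVec ∈ V ∧ ∀ x ∈ V, ∀ y ∈ V, bxor x y ∈ V) ∧ (((V).card : ℝ) ^ 2 = (2 : ℝ) ^ (m + m)) ∧ ∀ u ∈ V, ∀ v ∈ V, ∀ x, (b x ^^ b (bxor x u) ^^ b (bxor x v) ^^ b (bxor x (bxor u v))) = false) ∧ S ⊆ V ∧ (∀ s ∈ V, ∀ u ∈ U, ((Finset.univ.filter fun i => s i && u i).card).bodd = false)) →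
    ∀ (m : ℕ) (a b : (Fin (m + m) → Bool) → Bool),
        IsDegLeFun 3 a → IsDegLeFun 3 b → (forrelation a b = 1 ∨ forrelation a b = -1) →
        (∃ e : (Fin (m + m) → Bool) ≃ (Fin (m + m) → Bool),
          (∃ M : Matrix (Fin (m + m)) (Fin (m + m)) (ZMod 2), ∃ c : Fin (m + m) → ZMod 2,
            ∀ y i, (if e y i then (1 : ZMod 2) else 0) = (M.mulVec (fun j => if y j then (1 : ZMod 2) else 0) + c) i) ∧
          ∃ perm : (Fin m → Bool) ≃ (Fin m → Bool), ∃ h : (Fin m → Bool) → Bool, ∀ y' y'' : Fin m → Bool,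
            (if b (e (Fin.append y' y'')) then (1 : ZMod 2) else 0) =
              (∑ i, (if y' i then (1 : ZMod 2) else 0) * (if perm y'' i then (1 : ZMod 2) else 0)) +
                (if h y'' then (1 : ZMod 2) else 0)) →
        ∀ S U : Finset (Fin (m + m) → Bool),
          (zeroVec ∈ S ∧ ∀ x ∈ S, ∀ y ∈ S, bxor x y ∈ S) → (zeroVec ∈ U ∧ ∀ x ∈ U, ∀ y ∈ U, bxor x y ∈ U) →
          ((∀ s ∈ S, ∀ y : Fin (m + m) → Bool, (fun k => (b zeroVec ^^ b (bxor zeroVec s) ^^ b (bxor zeroVec y) ^^ b (bxor zeroVec (bxor s y))) ^^ (b (fun j => decide (j = k)) ^^ b (bxor (fun j => decide (j = k)) s) ^^ b (bxor (fun j => decide (j = k)) y) ^^ b (bxor (fun j => decide (j = k)) (bxor s y)))) ∈ U) ∧ (∀ s ∈ S, ∃ ℓ ∈ U, ∀ r : Fin (m + m) → Bool, (∀ y z : Fin (m + m) → Bool, ((b z ^^ b (bxor z s) ^^ b (bxor z r) ^^ b (bxor z (bxor s r))) ^^ (b (bxor z y) ^^ b (bxor (bxor z y) s) ^^ b (bxor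 (bxor z y) r) ^^ b (bxor (bxor z y) (bxor s r)))) = false) → (b r ^^ b (bxor r s) ^^ b zeroVec ^^ b s) = ((Finset.univ.filter fun i => ℓ i && r i).card).bodd)) →
          ((∀ s ∈ U, ∀ y : Fin (m + m) → Bool, (fun k => (a zeroVec ^^ a (bxor zeroVec s) ^^ a (bxor zeroVec y) ^^ a (bxor zeroVec (bxor s y))) ^^ (a (fun j => decide (j = k)) ^^ a (bxor (fun j => decide (j = k)) s) ^^ a (bxor (fun j => decide (j = k)) y) ^^ a (bxor (fun j => decide (j = k)) (bxor s y)))) ∈ S) ∧ (∀ s ∈ U, ∃ ℓ ∈ S, ∀ r : Fin (m + m) → Bool, (∀ y z : Fin (m + m) → Bool, ((a z ^^ a (bxor z s) ^^ a (bxor z r) ^^ a (bxor z (bxor s r))) ^^ (a (bxor z y) ^^ a (bxor (bxor z y) s) ^^ a (bxor (bxor z y) r) ^^ a (bxor (bxor z y) (bxor s r)))) = false) → (a r ^^ a (bxor r s) ^^ a zeroVec ^^ a s) = ((Finset.univ.filter fun i => ℓ i && r i).card).bodd)) →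
          (∀ s ∈ S, ∀ u ∈ U, ((Finset.univ.filter fun i => s i && u i).card).bodd = false) →
          ∃ V : Finset (Fin (m + m) → Bool), ((zeroVec ∈ V ∧ ∀ x ∈ V, ∀ y ∈ V, bxor x y ∈ V) ∧ (((V).card : ℝ) ^ 2 = (2 : ℝ) ^ (m + m)) ∧ ∀ u ∈ V, ∀ v ∈ V, ∀ x, (b x ^^ b (bxor x u) ^^ b (bxor x v) ^^ b (bxor x (bxor u v))) = false) ∧ S ⊆ V ∧ (∀ s ∈ V, ∀ u ∈ U, ((Finset.univ.filter fun i => s i && u i).card).bodd = false) :=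
  _root_.Summit.QuantumAdvantage.QuantumAdvantage.Theorems.SignedExactCubicForrelationNotPrBPP.stub_noTrapTransport

/-- stub (LANDED p120282 by wave-1 worker, 2026-08-16): M-pairs of an exact cubic pair are closed orthogonal pairs. Rows: `T_b(s, y, v) = 0` for `s, v ∈ V`
(landed `stub_frameLock` (ii)); offsets: `r ↦ D_s b(r) ⊕ D_s b(0)` is additive on `rad B_s ⊇ V` (`b` cubic) and vanishes on `V`
(flatness), so it is represented by some `ℓ ⊥ V` (extend a basis of `V` inside `rad B_s`); the `a`-side by `stub_frameLock` (i),(iii)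
with `V^⊥⊥ = V` (`perp_perp_eq_of_sq`). -/
theorem stub_mpairClosed :
    ∀ (n : ℕ) (a b : (Fin n → Bool) → Bool) (V : Finset (Fin n → Bool)),
        IsDegLeFun 3 a → IsDegLeFun 3 b → (forrelation a b = 1 ∨ forrelation a b = -1) →
        ((zeroVec ∈ V ∧ ∀ x ∈ V, ∀ y ∈ V, bxor x y ∈ V) ∧ (((V).card : ℝ) ^ 2 = (2 : ℝ) ^ (n)) ∧ ∀ u ∈ V, ∀ v ∈ V, ∀ x, (b x ^^ b (bxor x u) ^^ b (bxor x v) ^^ b (bxor x (bxor u v))) = false) →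
        ((∀ s ∈ V, ∀ y : Fin (n) → Bool, (fun k => (b zeroVec ^^ b (bxor zeroVec s) ^^ b (bxor zeroVec y) ^^ b (bxor zeroVec (bxor s y))) ^^ (b (fun j => decide (j = k)) ^^ b (bxor (fun j => decide (j = k)) s) ^^ b (bxor (fun j => decide (j = k)) y) ^^ b (bxor (fun j => decide (j = k)) (bxor s y)))) ∈ (Finset.univ.filter fun (y : Fin (n) → Bool) => ∀ s ∈ V, ((Finset.univ.filter fun i => s i && y i).card).bodd = false)) ∧ (∀ s ∈ V, ∃ ℓ ∈ (Finset.univ.filter fun (y : Fin (n) → Bool) => ∀ s ∈ V, ((Finset.univ.filter fun i => s i && y i).card).bodd = false), ∀ r : Fin (n) → Bool, (∀ y z : Fin (n) → Bool, ((b z ^^ b (bxor z s) ^^ b (bxor z r) ^^ b (bxor z (bxor s r))) ^^ (b (bxor z y) ^^ b (bxor (bxor z y) s) ^^ b (bxor (bxor z y) r) ^^ b (bxor (bxor z y) (bxor s r)))) = false) → (b r ^^ b (bxor r s) ^^ b zeroVec ^^ b s) = ((Finset.univ.filter fun i => ℓ i && r i).card).bodd)) ∧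
        ((∀ s ∈ (Finset.univ.filter fun (y : Fin (n) → Bool) => ∀ s ∈ V, ((Finset.univ.filter fun i => s i && y i).card).bodd = false), ∀ y : Fin (n) → Bool, (fun k => (a zeroVec ^^ a (bxor zeroVec s) ^^ a (bxor zeroVec y) ^^ a (bxor zeroVec (bxor s y))) ^^ (a (fun j => decide (j = k)) ^^ a (bxor (fun j => decide (j = k)) s) ^^ a (bxor (fun j => decide (j = k)) y) ^^ a (bxor (fun j => decide (j = k)) (bxor s y)))) ∈ V) ∧ (∀ s ∈ (Finset.univ.filter fun (y : Fin (n) → Bool) => ∀ s ∈ V, ((Finset.univ.filter fun i => s i && y i).card).bodd = false), ∃ ℓ ∈ V, ∀ r : Fin (n) → Bool, (∀ y z : Fin (n) → Bool, ((a z ^^ a (bxor z s) ^^ a (bxor z r) ^^ a (bxor z (bxor s r))) ^^ (a (bxor z y) ^^ a (bxor (bxor z y) s) ^^ a (bxor (bxor z y) r) ^^ a (bxor (bxor z y) (bxor s r)))) = false) → (a r ^^ a (bxor r s) ^^ a zeroVec ^^ a s) = ((Finset.univ.filter fun i => ℓ i && r i).card).bodd)) ∧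
        (∀ s ∈ V, ∀ u ∈ (Finset.univ.filter fun (y : Fin (n) → Bool) => ∀ s ∈ V, ((Finset.univ.filter fun i => s i && y i).card).bodd = false), ((Finset.univ.filter fun i => s i && u i).card).bodd = false) :=
  _root_.Summit.QuantumAdvantage.QuantumAdvantage.Theorems.SignedExactCubicForrelationNotPrBPP.stub_mpairClosed

/-- stub (RESHAPE by lead c3, 2026-08-17; LANDED p142869 by wave-1 worker): SPANNING TUPLES ARE THE MAJORITY. At most half of the `(n+1)`-tuples of vectors
of `𝔽₂ⁿ` have a common non-zero annihilator: union bound over the `2ⁿ − 1` non-zero `w`, each annihilating exactly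
`(2^(n-1))^(n+1)` tuples, and `2 · (2ⁿ − 1) · 2^((n−1)(n+1)) ≤ 2^(n(n+1))`. Pure counting (no `b`). -/
theorem stub_spanHalf :
    ∀ n : ℕ, 2 * (Finset.univ.filter fun xs : Fin (n + 1) → (Fin n → Bool) =>
        ∃ w : Fin n → Bool, w ≠ zeroVec ∧ ∀ j, ((Finset.univ.filter fun i => w i && xs j i).card).bodd = false).card
      ≤ 2 ^ (n * (n + 1)) :=
  _root_.Summit.QuantumAdvantage.QuantumAdvantage.Theorems.SignedExactCubicForrelationNotPrBPP.stub_spanHalf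

/-- stub (RESHAPE by lead c3, 2026-08-17; LANDED p142453 by wave-1 worker): NO COMMON ANNIHILATOR ⇒ SPANNING. If the only `w` orthogonal to every `xs j` is `0`, then
every `⊕`-closed set containing `0` and all the `xs j` is the whole space (a proper `⊕`-closed `W ∋ 0` has `|W^⊥| = 2ⁿ/|W| ≥ 2`,
`DerivativeWalsh.card_mul_card_perp`). Pure linear algebra (no `b`). -/
theorem stub_spanningOfNoDual :
    ∀ (n r : ℕ) (xs : Fin r → (Fin n → Bool)),
      (∀ w : Fin n → Bool, (∀ j, ((Finset.univ.filter fun i => w i && xs j i).card).bodd = false) → w = zeroVec) →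
      ∀ W : Finset (Fin n → Bool), zeroVec ∈ W → (∀ x ∈ W, ∀ y ∈ W, bxor x y ∈ W) → (∀ j, xs j ∈ W) → W = Finset.univ :=
  _root_.Summit.QuantumAdvantage.QuantumAdvantage.Theorems.SignedExactCubicForrelationNotPrBPP.stub_spanningOfNoDual

/-- stub (RESHAPE by lead c3, 2026-08-17; LANDED p142650 by wave-1 worker): RADICAL DIRECTIONS ARE GOOD — for EVERY Boolean function `b`. If `V` is an M-subspace
of `b` through `S`, orthogonal to `U`, with `S ⊊ V` (the no-trap extension), and `v` is a RADICAL direction of `b` (`D_x D_v b`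
constant for every `x`) lying in `Z_b(S) ∩ U^⊥`, then some M-subspace through `S` and `v` is orthogonal to `U`: `V` itself if
`v ∈ V`; otherwise, with `c(u) :=` the constant value of `D_u D_v b` (additive in `u`; `c = 0` on `S` because `v ∈ Z_b(S)`):
if `c ≢ 0` on `V`, `V' = V₀ ∪ (V₀ ⊕ v)` with `V₀ = V ∩ ker c` (index 2 by the translation trick); if `c ≡ 0` on `V`,
`V' = V₀ ∪ (V₀ ⊕ v)` with `V₀` an index-2 subgroup of `V` containing `S` (cut out by a `w ∈ S^⊥ ∖ V^⊥`, which exists since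
`|S^⊥| > |V^⊥|` by `card_mul_card_perp`). Flatness of `V'` is the four-term identity `D_u D_(u'⊕v) b (x) = D_u D_u' b (x) ⊕ D_u D_v b (x ⊕ u')`. -/
theorem stub_radicalGood :
    ∀ (n : ℕ) (b : (Fin n → Bool) → Bool) (S U V : Finset (Fin n → Bool)) (v : Fin n → Bool),
      (zeroVec ∈ S ∧ ∀ x ∈ S, ∀ y ∈ S, bxor x y ∈ S) →
      ((zeroVec ∈ V ∧ ∀ x ∈ V, ∀ y ∈ V, bxor x y ∈ V) ∧ (((V).card : ℝ) ^ 2 = (2 : ℝ) ^ n) ∧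
        ∀ u ∈ V, ∀ w ∈ V, ∀ x, (b x ^^ b (bxor x u) ^^ b (bxor x w) ^^ b (bxor x (bxor u w))) = false) →
      S ⊆ V → (∀ s ∈ V, ∀ u ∈ U, ((Finset.univ.filter fun i => s i && u i).card).bodd = false) → S.card < V.card →
      (∀ x y z : Fin n → Bool, ((b z ^^ b (bxor z x) ^^ b (bxor z v) ^^ b (bxor z (bxor x v))) ^^
          (b (bxor z y) ^^ b (bxor (bxor z y) x) ^^ b (bxor (bxor z y) v) ^^ b (bxor (bxor z y) (bxor x v)))) = false) →
      (∀ s ∈ S, ∀ x, (b x ^^ b (bxor x s) ^^ b (bxor x v) ^^ b (bxor x (bxor s v))) = false) →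
      (∀ u ∈ U, ((Finset.univ.filter fun i => u i && v i).card).bodd = false) →
      ∃ V' : Finset (Fin n → Bool), ((zeroVec ∈ V' ∧ ∀ x ∈ V', ∀ y ∈ V', bxor x y ∈ V') ∧ (((V').card : ℝ) ^ 2 = (2 : ℝ) ^ n) ∧
          ∀ u ∈ V', ∀ w ∈ V', ∀ x, (b x ^^ b (bxor x u) ^^ b (bxor x w) ^^ b (bxor x (bxor u w))) = false) ∧
        S ⊆ V' ∧ v ∈ V' ∧ (∀ s ∈ V', ∀ u ∈ U, ((Finset.univ.filter fun i => s i && u i).card).bodd = false) :=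
  _root_.Summit.QuantumAdvantage.QuantumAdvantage.Theorems.SignedExactCubicForrelationNotPrBPP.stub_radicalGood

/-- stub (RESHAPE by lead c3, 2026-08-17; LANDED p143469 by wave-1 worker): KERNEL STATISTICS AT RADICAL-VISIBLE PAIRS, `r = n + 1`. Given the three bricks above:
if some radical direction `v` of `b` lies in `Z_b(S) ∩ U^⊥ ∖ S`, the `b`-side disjunct of `KernelStats` holds with `r = m+m+1` probes.
Proof: the probe clause `v' ∈ rad B_x` is `⊕`-closed in `x` and holds at `x = 0`, so for a SPANNING tuple (`stub_spanningOfNoDual`)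
the candidate space is `K∞ = Z_b(S) ∩ U^⊥ ∩ R(b)` (independent of the tuple), every element of `K∞ ∖ S` is good
(`stub_radicalGood` with the no-trap extension `V ⊋ S` from the LANDED `stub_noTrapTransport stub_noTrapTemplate`, `|V| = 2^m > |S|`),
and `|K∞ ∖ S| ≥ |K∞|/2` (`u ↦ u ⊕ v` injects `K∞ ∩ S` into `K∞ ∖ S`); non-spanning tuples contribute `≥ 0` and are at most half of all
tuples (`stub_spanHalf`), so the sum is `≥ 2^(n(n+1))/4 ≥ 2^(n(n+1))/(n+2)^8`. -/
theorem stub_kernelStatsRadical :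
    (∀ n : ℕ, 2 * (Finset.univ.filter fun xs : Fin (n + 1) → (Fin n → Bool) =>
        ∃ w : Fin n → Bool, w ≠ zeroVec ∧ ∀ j, ((Finset.univ.filter fun i => w i && xs j i).card).bodd = false).card
      ≤ 2 ^ (n * (n + 1))) →
    (∀ (n r : ℕ) (xs : Fin r → (Fin n → Bool)),
      (∀ w : Fin n → Bool, (∀ j, ((Finset.univ.filter fun i => w i && xs j i).card).bodd = false) → w = zeroVec) →
      ∀ W : Finset (Fin n → Bool), zeroVec ∈ W → (∀ x ∈ W, ∀ y ∈ W, bxor x y ∈ W) → (∀ j, xs j ∈ W) → W = Finset.univ) →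
    (∀ (n : ℕ) (b : (Fin n → Bool) → Bool) (S U V : Finset (Fin n → Bool)) (v : Fin n → Bool),
      (zeroVec ∈ S ∧ ∀ x ∈ S, ∀ y ∈ S, bxor x y ∈ S) →
      ((zeroVec ∈ V ∧ ∀ x ∈ V, ∀ y ∈ V, bxor x y ∈ V) ∧ (((V).card : ℝ) ^ 2 = (2 : ℝ) ^ n) ∧
        ∀ u ∈ V, ∀ w ∈ V, ∀ x, (b x ^^ b (bxor x u) ^^ b (bxor x w) ^^ b (bxor x (bxor u w))) = false) →
      S ⊆ V → (∀ s ∈ V, ∀ u ∈ U, ((Finset.univ.filter fun i => s i && u i).card).bodd = false) → S.card < V.card →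
      (∀ x y z : Fin n → Bool, ((b z ^^ b (bxor z x) ^^ b (bxor z v) ^^ b (bxor z (bxor x v))) ^^
          (b (bxor z y) ^^ b (bxor (bxor z y) x) ^^ b (bxor (bxor z y) v) ^^ b (bxor (bxor z y) (bxor x v)))) = false) →
      (∀ s ∈ S, ∀ x, (b x ^^ b (bxor x s) ^^ b (bxor x v) ^^ b (bxor x (bxor s v))) = false) →
      (∀ u ∈ U, ((Finset.univ.filter fun i => u i && v i).card).bodd = false) →
      ∃ V' : Finset (Fin n → Bool), ((zeroVec ∈ V' ∧ ∀ x ∈ V', ∀ y ∈ V', bxor x y ∈ V') ∧ (((V').card : ℝ) ^ 2 = (2 : ℝ) ^ n) ∧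
          ∀ u ∈ V', ∀ w ∈ V', ∀ x, (b x ^^ b (bxor x u) ^^ b (bxor x w) ^^ b (bxor x (bxor u w))) = false) ∧
        S ⊆ V' ∧ v ∈ V' ∧ (∀ s ∈ V', ∀ u ∈ U, ((Finset.univ.filter fun i => s i && u i).card).bodd = false)) →
    ∀ (m : ℕ) (C : Fin 2 → Circuit (Fin (m + m))),
        (⟨m + m, 2, C⟩ : KForrelationInstance).IsOverB2 →
        (∀ i, IsDegLeFun 3 (C i).eval) →
        (forrelation (C 0).eval (C 1).eval = 1 ∨ forrelation (C 0).eval (C 1).eval = -1) →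
        (∃ e : (Fin (m + m) → Bool) ≃ (Fin (m + m) → Bool),
          (∃ M : Matrix (Fin (m + m)) (Fin (m + m)) (ZMod 2), ∃ c : Fin (m + m) → ZMod 2,
            ∀ y i, (if e y i then (1 : ZMod 2) else 0) = (M.mulVec (fun j => if y j then (1 : ZMod 2) else 0) + c) i) ∧
          ∃ perm : (Fin m → Bool) ≃ (Fin m → Bool), ∃ h : (Fin m → Bool) → Bool, ∀ y' y'' : Fin m → Bool,
            (if (C 1).eval (e (Fin.append y' y'')) then (1 : ZMod 2) else 0) =
              (∑ i, (if y' i then (1 : ZMod 2) else 0) * (if perm y'' i then (1 : ZMod 2) else 0)) +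
                (if h y'' then (1 : ZMod 2) else 0)) →
        ∀ S U : Finset (Fin (m + m) → Bool),
          (zeroVec ∈ S ∧ ∀ x ∈ S, ∀ y ∈ S, bxor x y ∈ S) → (zeroVec ∈ U ∧ ∀ x ∈ U, ∀ y ∈ U, bxor x y ∈ U) →
          ((∀ s ∈ S, ∀ y : Fin (m + m) → Bool, (fun k => ((C 1).eval zeroVec ^^ (C 1).eval (bxor zeroVec s) ^^ (C 1).eval (bxor zeroVec y) ^^ (C 1).eval (bxor zeroVec (bxor s y))) ^^ ((C 1).eval (fun j => decide (j = k)) ^^ (C 1).eval (bxor (fun j => decide (j = k)) s) ^^ (C 1).eval (bxor (fun j => decide (j = k)) y) ^^ (C 1).eval (bxor (fun j => decide (j = k)) (bxor s y)))) ∈ U) ∧ (∀ s ∈ S, ∃ ℓ ∈ U, ∀ r : Fin (m + m) → Bool, (∀ y z : Fin (m + m) → Bool, (((C 1).eval z ^^ (C 1).eval (bxor z s) ^^ (C 1).eval (bxor z r) ^^ (C 1).eval (bxor z (bxor s r))) ^^ ((C 1).eval (bxor z y) ^^ (C 1).eval (bxor (bxor z y) s) ^^ (C 1).eval (bxor (bxor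 z y) r) ^^ (C 1).eval (bxor (bxor z y) (bxor s r)))) = false) → ((C 1).eval r ^^ (C 1).eval (bxor r s) ^^ (C 1).eval zeroVec ^^ (C 1).eval s) = ((Finset.univ.filter fun i => ℓ i && r i).card).bodd)) →
          ((∀ s ∈ U, ∀ y : Fin (m + m) → Bool, (fun k => ((C 0).eval zeroVec ^^ (C 0).eval (bxor zeroVec s) ^^ (C 0).eval (bxor zeroVec y) ^^ (C 0).eval (bxor zeroVec (bxor s y))) ^^ ((C 0).eval (fun j => decide (j = k)) ^^ (C 0).eval (bxor (fun j => decide (j = k)) s) ^^ (C 0).eval (bxor (fun j => decide (j = k)) y) ^^ (C 0).eval (bxor (fun j => decide (j = k)) (bxor s y)))) ∈ S) ∧ (∀ s ∈ U, ∃ ℓ ∈ S, ∀ r : Fin (m + m) → Bool, (∀ y z : Fin (m + m) → Bool, (((C 0).eval z ^^ (C 0).eval (bxor z s) ^^ (C 0).eval (bxor z r) ^^ (C 0).eval (bxor z (bxor s r))) ^^ ((C 0).eval (bxor z y) ^^ (C 0).eval (bxor (bxor z y) s) ^^ (C 0).eval (bxor (bxor z y) r) ^^ (C 0).eval (bxor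 (bxor z y) (bxor s r)))) = false) → ((C 0).eval r ^^ (C 0).eval (bxor r s) ^^ (C 0).eval zeroVec ^^ (C 0).eval s) = ((Finset.univ.filter fun i => ℓ i && r i).card).bodd)) →
          (∀ s ∈ S, ∀ u ∈ U, ((Finset.univ.filter fun i => s i && u i).card).bodd = false) →
          S.card < 2 ^ m → U.card < 2 ^ m →
          (∃ v : Fin (m + m) → Bool, (∀ x y z : Fin (m + m) → Bool, (((C 1).eval z ^^ (C 1).eval (bxor z x) ^^ (C 1).eval (bxor z v) ^^ (C 1).eval (bxor z (bxor x v))) ^^ ((C 1).eval (bxor z y) ^^ (C 1).eval (bxor (bxor z y) x) ^^ (C 1).eval (bxor (bxor z y) v) ^^ (C 1).eval (bxor (bxor z y) (bxor x v)))) = false) ∧ (∀ s ∈ S, ∀ x, ((C 1).eval x ^^ (C 1).eval (bxor x s) ^^ (C 1).eval (bxor x v) ^^ (C 1).eval (bxor x (bxor s v))) = false) ∧ (∀ u ∈ U, ((Finset.univ.filter fun i => u i && v i).card).bodd = false) ∧ v ∉ S) →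
          (∃ r : ℕ, r ≤ m + m + 1 ∧ (2 : ℝ) ^ ((m + m) * r) / ((m + m + 2 : ℝ) ^ 8) ≤ (∑ xs : Fin (r) → (Fin (m + m) → Bool), (((@Finset.filter (Fin (m + m) → Bool) (fun v => v ∉ S ∧ (∃ V : Finset (Fin (m + m) → Bool), ((zeroVec ∈ V ∧ ∀ x ∈ V, ∀ y ∈ V, bxor x y ∈ V) ∧ (((V).card : ℝ) ^ 2 = (2 : ℝ) ^ (m + m)) ∧ ∀ u ∈ V, ∀ v ∈ V, ∀ x, ((C 1).eval x ^^ (C 1).eval (bxor x u) ^^ (C 1).eval (bxor x v) ^^ (C 1).eval (bxor x (bxor u v))) = false) ∧ S ⊆ V ∧ v ∈ V ∧ (∀ s ∈ V, ∀ u ∈ U, ((Finset.univ.filter fun i => s i && u i).card).bodd = false))) (Classical.decPred _) (Finset.univ.filter fun (v : Fin (m + m) → Bool) => (∀ s ∈ S, ∀ x, ((C 1).eval x ^^ (C 1).eval (bxor x s) ^^ (C 1).eval (bxor x v) ^^ (C 1).eval (bxor x (bxor s v))) = false) ∧ (∀ u ∈ U, ((Finset.univ.filter fun i => u i && v i).card).bodd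 = false) ∧ ∀ j, (∀ y z : Fin (m + m) → Bool, (((C 1).eval z ^^ (C 1).eval (bxor z (xs j)) ^^ (C 1).eval (bxor z v) ^^ (C 1).eval (bxor z (bxor (xs j) v))) ^^ ((C 1).eval (bxor z y) ^^ (C 1).eval (bxor (bxor z y) (xs j)) ^^ (C 1).eval (bxor (bxor z y) v) ^^ (C 1).eval (bxor (bxor z y) (bxor (xs j) v)))) = false))).card : ℝ) / (((Finset.univ.filter fun (v : Fin (m + m) → Bool) => (∀ s ∈ S, ∀ x, ((C 1).eval x ^^ (C 1).eval (bxor x s) ^^ (C 1).eval (bxor x v) ^^ (C 1).eval (bxor x (bxor s v))) = false) ∧ (∀ u ∈ U, ((Finset.univ.filter fun i => u i && v i).card).bodd = false) ∧ ∀ j, (∀ y z : Fin (m + m) → Bool, (((C 1).eval z ^^ (C 1).eval (bxor z (xs j)) ^^ (C 1).eval (bxor z v) ^^ (C 1).eval (bxor z (bxor (xs j) v))) ^^ ((C 1).eval (bxor z y) ^^ (C 1).eval (bxor (bxor z y) (xs j)) ^^ (C 1).eval (bxor (bxor z y) v) ^^ (C 1).eval (bxor (bxor z y) (bxor (xs j)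 v)))) = false))).card : ℝ)))) :=
  _root_.Summit.QuantumAdvantage.QuantumAdvantage.Theorems.SignedExactCubicForrelationNotPrBPP.stub_kernelStatsRadical

/-- stub (RESHAPE 2 by lead c3, 2026-08-17; LANDED p144612 by wave-2 worker): KERNEL STATISTICS AT a-SIDE RADICAL-VISIBLE PAIRS, `r = n + 1` — the mirror image of
`stub_kernelStatsRadical` on the swapped pair `(a, U, S)`: if some radical direction `v` of `a = (C 0).eval` lies in `Z_a(U) ∩ S^⊥ ∖ U`, the
`a`-side disjunct of `KernelStats` holds with `r = m+m+1`. The no-trap M-subspace of `a` through `U` orthogonal to `S` is `V^⊥` for the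
no-trap `V` of `b` (LANDED `stub_frameLock` (i): the dual of an M-subspace of `b` is an M-subspace of `a` on an exact pair; `U ⊆ V^⊥`
because `V ⊥ U`, `V^⊥ ⊥ S` because `S ⊆ V`, `|V^⊥| = |V| = 2^m > |U|`); everything else is the b-side proof verbatim with
`(b, S, U) ↦ (a, U, S)`. -/
theorem stub_kernelStatsRadicalA :
    (∀ n : ℕ, 2 * (Finset.univ.filter fun xs : Fin (n + 1) → (Fin n → Bool) =>
        ∃ w : Fin n → Bool, w ≠ zeroVec ∧ ∀ j, ((Finset.univ.filter fun i => w i && xs j i).card).bodd = false).card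
      ≤ 2 ^ (n * (n + 1))) →
    (∀ (n r : ℕ) (xs : Fin r → (Fin n → Bool)),
      (∀ w : Fin n → Bool, (∀ j, ((Finset.univ.filter fun i => w i && xs j i).card).bodd = false) → w = zeroVec) →
      ∀ W : Finset (Fin n → Bool), zeroVec ∈ W → (∀ x ∈ W, ∀ y ∈ W, bxor x y ∈ W) → (∀ j, xs j ∈ W) → W = Finset.univ) →
    (∀ (n : ℕ) (b : (Fin n → Bool) → Bool) (S U V : Finset (Fin n → Bool)) (v : Fin n → Bool),
      (zeroVec ∈ S ∧ ∀ x ∈ S, ∀ y ∈ S, bxor x y ∈ S) →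
      ((zeroVec ∈ V ∧ ∀ x ∈ V, ∀ y ∈ V, bxor x y ∈ V) ∧ (((V).card : ℝ) ^ 2 = (2 : ℝ) ^ n) ∧
        ∀ u ∈ V, ∀ w ∈ V, ∀ x, (b x ^^ b (bxor x u) ^^ b (bxor x w) ^^ b (bxor x (bxor u w))) = false) →
      S ⊆ V → (∀ s ∈ V, ∀ u ∈ U, ((Finset.univ.filter fun i => s i && u i).card).bodd = false) → S.card < V.card →
      (∀ x y z : Fin n → Bool, ((b z ^^ b (bxor z x) ^^ b (bxor z v) ^^ b (bxor z (bxor x v))) ^^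
          (b (bxor z y) ^^ b (bxor (bxor z y) x) ^^ b (bxor (bxor z y) v) ^^ b (bxor (bxor z y) (bxor x v)))) = false) →
      (∀ s ∈ S, ∀ x, (b x ^^ b (bxor x s) ^^ b (bxor x v) ^^ b (bxor x (bxor s v))) = false) →
      (∀ u ∈ U, ((Finset.univ.filter fun i => u i && v i).card).bodd = false) →
      ∃ V' : Finset (Fin n → Bool), ((zeroVec ∈ V' ∧ ∀ x ∈ V', ∀ y ∈ V', bxor x y ∈ V') ∧ (((V').card : ℝ) ^ 2 = (2 : ℝ) ^ n) ∧
          ∀ u ∈ V', ∀ w ∈ V', ∀ x, (b x ^^ b (bxor x u) ^^ b (bxor x w) ^^ b (bxor x (bxor u w))) = false) ∧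
        S ⊆ V' ∧ v ∈ V' ∧ (∀ s ∈ V', ∀ u ∈ U, ((Finset.univ.filter fun i => s i && u i).card).bodd = false)) →
    ∀ (m : ℕ) (C : Fin 2 → Circuit (Fin (m + m))),
        (⟨m + m, 2, C⟩ : KForrelationInstance).IsOverB2 →
        (∀ i, IsDegLeFun 3 (C i).eval) →
        (forrelation (C 0).eval (C 1).eval = 1 ∨ forrelation (C 0).eval (C 1).eval = -1) →
        (∃ e : (Fin (m + m) → Bool) ≃ (Fin (m + m) → Bool),
          (∃ M : Matrix (Fin (m + m)) (Fin (m + m)) (ZMod 2), ∃ c : Fin (m + m) → ZMod 2,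
            ∀ y i, (if e y i then (1 : ZMod 2) else 0) = (M.mulVec (fun j => if y j then (1 : ZMod 2) else 0) + c) i) ∧
          ∃ perm : (Fin m → Bool) ≃ (Fin m → Bool), ∃ h : (Fin m → Bool) → Bool, ∀ y' y'' : Fin m → Bool,
            (if (C 1).eval (e (Fin.append y' y'')) then (1 : ZMod 2) else 0) =
              (∑ i, (if y' i then (1 : ZMod 2) else 0) * (if perm y'' i then (1 : ZMod 2) else 0)) +
                (if h y'' then (1 : ZMod 2) else 0)) →
        ∀ S U : Finset (Fin (m + m) → Bool),
          (zeroVec ∈ S ∧ ∀ x ∈ S, ∀ y ∈ S, bxor x y ∈ S) → (zeroVec ∈ U ∧ ∀ x ∈ U, ∀ y ∈ U, bxor x y ∈ U) →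
          ((∀ s ∈ S, ∀ y : Fin (m + m) → Bool, (fun k => ((C 1).eval zeroVec ^^ (C 1).eval (bxor zeroVec s) ^^ (C 1).eval (bxor zeroVec y) ^^ (C 1).eval (bxor zeroVec (bxor s y))) ^^ ((C 1).eval (fun j => decide (j = k)) ^^ (C 1).eval (bxor (fun j => decide (j = k)) s) ^^ (C 1).eval (bxor (fun j => decide (j = k)) y) ^^ (C 1).eval (bxor (fun j => decide (j = k)) (bxor s y)))) ∈ U) ∧ (∀ s ∈ S, ∃ ℓ ∈ U, ∀ r : Fin (m + m) → Bool, (∀ y z : Fin (m + m) → Bool, (((C 1).eval z ^^ (C 1).eval (bxor z s) ^^ (C 1).eval (bxor z r) ^^ (C 1).eval (bxor z (bxor s r))) ^^ ((C 1).eval (bxor z y) ^^ (C 1).eval (bxor (bxor z y) s) ^^ (C 1).eval (bxor (bxor z y) r) ^^ (C 1).eval (bxor (bxor z y) (bxor s r)))) = false) → ((C 1).eval r ^^ (C 1).eval (bxor r s) ^^ (C 1).eval zeroVec ^^ (C 1).eval s) = ((Finset.univ.filter fun i => ℓ i && r i).card).bodd)) →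
          ((∀ s ∈ U, ∀ y : Fin (m + m) → Bool, (fun k => ((C 0).eval zeroVec ^^ (C 0).eval (bxor zeroVec s) ^^ (C 0).eval (bxor zeroVec y) ^^ (C 0).eval (bxor zeroVec (bxor s y))) ^^ ((C 0).eval (fun j => decide (j = k)) ^^ (C 0).eval (bxor (fun j => decide (j = k)) s) ^^ (C 0).eval (bxor (fun j => decide (j = k)) y) ^^ (C 0).eval (bxor (fun j => decide (j = k)) (bxor s y)))) ∈ S) ∧ (∀ s ∈ U, ∃ ℓ ∈ S, ∀ r : Fin (m + m) → Bool, (∀ y z : Fin (m + m) → Bool, (((C 0).eval z ^^ (C 0).eval (bxor z s) ^^ (C 0).eval (bxor z r) ^^ (C 0).eval (bxor z (bxor s r))) ^^ ((C 0).eval (bxor z y) ^^ (C 0).eval (bxor (bxor z y) s) ^^ (C 0).eval (bxor (bxor z y) r) ^^ (C 0).eval (bxor (bxor z y) (bxor s r)))) = false) → ((C 0).eval r ^^ (C 0).eval (bxor r s) ^^ (C 0).eval zeroVec ^^ (C 0).eval s) = ((Finset.univ.filter fun i => ℓ i && r i).card).bodd)) →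
          (∀ s ∈ S, ∀ u ∈ U, ((Finset.univ.filter fun i => s i && u i).card).bodd = false) →
          S.card < 2 ^ m → U.card < 2 ^ m →
          (∃ v : Fin (m + m) → Bool, (∀ x y z : Fin (m + m) → Bool, (((C 0).eval z ^^ (C 0).eval (bxor z x) ^^ (C 0).eval (bxor z v) ^^ (C 0).eval (bxor z (bxor x v))) ^^ ((C 0).eval (bxor z y) ^^ (C 0).eval (bxor (bxor z y) x) ^^ (C 0).eval (bxor (bxor z y) v) ^^ (C 0).eval (bxor (bxor z y) (bxor x v)))) = false) ∧ (∀ s ∈ U, ∀ x, ((C 0).eval x ^^ (C 0).eval (bxor x s) ^^ (C 0).eval (bxor x v) ^^ (C 0).eval (bxor x (bxor s v))) = false) ∧ (∀ u ∈ S, ((Finset.univ.filter fun i => u i && v i).card).bodd = false) ∧ v ∉ U) →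
          (∃ r : ℕ, r ≤ m + m + 1 ∧ (2 : ℝ) ^ ((m + m) * r) / ((m + m + 2 : ℝ) ^ 8) ≤ (∑ xs : Fin (r) → (Fin (m + m) → Bool), (((@Finset.filter (Fin (m + m) → Bool) (fun v => v ∉ U ∧ (∃ V : Finset (Fin (m + m) → Bool), ((zeroVec ∈ V ∧ ∀ x ∈ V, ∀ y ∈ V, bxor x y ∈ V) ∧ (((V).card : ℝ) ^ 2 = (2 : ℝ) ^ (m + m)) ∧ ∀ u ∈ V, ∀ v ∈ V, ∀ x, ((C 0).eval x ^^ (C 0).eval (bxor x u) ^^ (C 0).eval (bxor x v) ^^ (C 0).eval (bxor x (bxor u v))) = false) ∧ U ⊆ V ∧ v ∈ V ∧ (∀ s ∈ V, ∀ u ∈ S, ((Finset.univ.filter fun i => s i && u i).card).bodd = false))) (Classical.decPred _) (Finset.univ.filter fun (v : Fin (m + m) → Bool) => (∀ s ∈ U, ∀ x, ((C 0).eval x ^^ (C 0).eval (bxor x s) ^^ (C 0).eval (bxor x v) ^^ (C 0).eval (bxor x (bxor s v))) = false) ∧ (∀ u ∈ S, ((Finset.univ.filter fun i => u i && v i).card).bodd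 = false) ∧ ∀ j, (∀ y z : Fin (m + m) → Bool, (((C 0).eval z ^^ (C 0).eval (bxor z (xs j)) ^^ (C 0).eval (bxor z v) ^^ (C 0).eval (bxor z (bxor (xs j) v))) ^^ ((C 0).eval (bxor z y) ^^ (C 0).eval (bxor (bxor z y) (xs j)) ^^ (C 0).eval (bxor (bxor z y) v) ^^ (C 0).eval (bxor (bxor z y) (bxor (xs j) v)))) = false))).card : ℝ) / (((Finset.univ.filter fun (v : Fin (m + m) → Bool) => (∀ s ∈ U, ∀ x, ((C 0).eval x ^^ (C 0).eval (bxor x s) ^^ (C 0).eval (bxor x v) ^^ (C 0).eval (bxor x (bxor s v))) = false) ∧ (∀ u ∈ S, ((Finset.univ.filter fun i => u i && v i).card).bodd = false) ∧ ∀ j, (∀ y z : Fin (m + m) → Bool, (((C 0).eval z ^^ (C 0).eval (bxor z (xs j)) ^^ (C 0).eval (bxor z v) ^^ (C 0).eval (bxor z (bxor (xs j) v))) ^^ ((C 0).eval (bxor z y) ^^ (C 0).eval (bxor (bxor z y) (xs j)) ^^ (C 0).eval (bxor (bxor z y) v) ^^ (C 0).eval (bxor (bxor z y) (bxor (xs j)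 v)))) = false))).card : ℝ)))) :=
  _root_.Summit.QuantumAdvantage.QuantumAdvantage.Theorems.SignedExactCubicForrelationNotPrBPP.stub_kernelStatsRadicalA

/-- **stub (OPEN — the lead's; RESHAPED c3 2026-08-17): KERNEL STATISTICS AT RADICAL-ABSORBED PAIRS.** Verbatim `KernelStats` with the
extra hypotheses that NO radical direction of `b` lies in `Z_b(S) ∩ U^⊥ ∖ S` and NO radical direction of `a` lies in `Z_a(U) ∩ S^⊥ ∖ U`
(the complementary cases are `stub_kernelStatsRadical` / `stub_kernelStatsRadicalA`).
This is the genuine core: after quotienting by the cubic radical it is the kernel statistics of RADICAL-FREE cores (affine-free,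
translator-free biquadratic data — by the census conjecturally the `𝔽₈`-cube powers, for which it is proved on paper,
KS-cube-proof-c3.md) plus the compatibility of `goodMass` with radical descent. -/
theorem stub_kernelStatsCore :
    ∀ (m : ℕ) (C : Fin 2 → Circuit (Fin (m + m))),
        (⟨m + m, 2, C⟩ : KForrelationInstance).IsOverB2 →
        (∀ i, IsDegLeFun 3 (C i).eval) →
        (forrelation (C 0).eval (C 1).eval = 1 ∨ forrelation (C 0).eval (C 1).eval = -1) →
        (∃ e : (Fin (m + m) → Bool) ≃ (Fin (m + m) → Bool),
          (∃ M : Matrix (Fin (m + m)) (Fin (m + m)) (ZMod 2), ∃ c : Fin (m + m) → ZMod 2,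
            ∀ y i, (if e y i then (1 : ZMod 2) else 0) = (M.mulVec (fun j => if y j then (1 : ZMod 2) else 0) + c) i) ∧
          ∃ perm : (Fin m → Bool) ≃ (Fin m → Bool), ∃ h : (Fin m → Bool) → Bool, ∀ y' y'' : Fin m → Bool,
            (if (C 1).eval (e (Fin.append y' y'')) then (1 : ZMod 2) else 0) =
              (∑ i, (if y' i then (1 : ZMod 2) else 0) * (if perm y'' i then (1 : ZMod 2) else 0)) +
                (if h y'' then (1 : ZMod 2) else 0)) →
        ∀ S U : Finset (Fin (m + m) → Bool),
          (zeroVec ∈ S ∧ ∀ x ∈ S, ∀ y ∈ S, bxor x y ∈ S) → (zeroVec ∈ U ∧ ∀ x ∈ U, ∀ y ∈ U, bxor x y ∈ U) →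
          ((∀ s ∈ S, ∀ y : Fin (m + m) → Bool, (fun k => ((C 1).eval zeroVec ^^ (C 1).eval (bxor zeroVec s) ^^ (C 1).eval (bxor zeroVec y) ^^ (C 1).eval (bxor zeroVec (bxor s y))) ^^ ((C 1).eval (fun j => decide (j = k)) ^^ (C 1).eval (bxor (fun j => decide (j = k)) s) ^^ (C 1).eval (bxor (fun j => decide (j = k)) y) ^^ (C 1).eval (bxor (fun j => decide (j = k)) (bxor s y)))) ∈ U) ∧ (∀ s ∈ S, ∃ ℓ ∈ U, ∀ r : Fin (m + m) → Bool, (∀ y z : Fin (m + m) → Bool, (((C 1).eval z ^^ (C 1).eval (bxor z s) ^^ (C 1).eval (bxor z r) ^^ (C 1).eval (bxor z (bxor s r))) ^^ ((C 1).eval (bxor z y) ^^ (C 1).eval (bxor (bxor z y) s) ^^ (C 1).eval (bxor (bxor z y) r) ^^ (C 1).eval (bxor (bxor z y) (bxor s r)))) = false) → ((C 1).eval r ^^ (C 1).eval (bxor r s) ^^ (C 1).eval zeroVec ^^ (C 1).eval s) = ((Finset.univ.filter fun i => ℓ i && r i).card).bodd)) →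
          ((∀ s ∈ U, ∀ y : Fin (m + m) → Bool, (fun k => ((C 0).eval zeroVec ^^ (C 0).eval (bxor zeroVec s) ^^ (C 0).eval (bxor zeroVec y) ^^ (C 0).eval (bxor zeroVec (bxor s y))) ^^ ((C 0).eval (fun j => decide (j = k)) ^^ (C 0).eval (bxor (fun j => decide (j = k)) s) ^^ (C 0).eval (bxor (fun j => decide (j = k)) y) ^^ (C 0).eval (bxor (fun j => decide (j = k)) (bxor s y)))) ∈ S) ∧ (∀ s ∈ U, ∃ ℓ ∈ S, ∀ r : Fin (m + m) → Bool, (∀ y z : Fin (m + m) → Bool, (((C 0).eval z ^^ (C 0).eval (bxor z s) ^^ (C 0).eval (bxor z r) ^^ (C 0).eval (bxor z (bxor s r))) ^^ ((C 0).eval (bxor z y) ^^ (C 0).eval (bxor (bxor z y) s) ^^ (C 0).eval (bxor (bxor z y) r) ^^ (C 0).eval (bxor (bxor z y) (bxor s r)))) = false) → ((C 0).eval r ^^ (C 0).eval (bxor r s) ^^ (C 0).eval zeroVec ^^ (C 0).eval s) = ((Finset.univ.filter fun i => ℓ i && r i).card).bodd)) →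
          (∀ s ∈ S, ∀ u ∈ U, ((Finset.univ.filter fun i => s i && u i).card).bodd = false) →
          S.card < 2 ^ m → U.card < 2 ^ m →
          (¬ ∃ v : Fin (m + m) → Bool, (∀ x y z : Fin (m + m) → Bool, (((C 1).eval z ^^ (C 1).eval (bxor z x) ^^ (C 1).eval (bxor z v) ^^ (C 1).eval (bxor z (bxor x v))) ^^ ((C 1).eval (bxor z y) ^^ (C 1).eval (bxor (bxor z y) x) ^^ (C 1).eval (bxor (bxor z y) v) ^^ (C 1).eval (bxor (bxor z y) (bxor x v)))) = false) ∧ (∀ s ∈ S, ∀ x, ((C 1).eval x ^^ (C 1).eval (bxor x s) ^^ (C 1).eval (bxor x v) ^^ (C 1).eval (bxor x (bxor s v))) = false) ∧ (∀ u ∈ U, ((Finset.univ.filter fun i => u i && v i).card).bodd = false) ∧ v ∉ S) →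
          (¬ ∃ v : Fin (m + m) → Bool, (∀ x y z : Fin (m + m) → Bool, (((C 0).eval z ^^ (C 0).eval (bxor z x) ^^ (C 0).eval (bxor z v) ^^ (C 0).eval (bxor z (bxor x v))) ^^ ((C 0).eval (bxor z y) ^^ (C 0).eval (bxor (bxor z y) x) ^^ (C 0).eval (bxor (bxor z y) v) ^^ (C 0).eval (bxor (bxor z y) (bxor x v)))) = false) ∧ (∀ s ∈ U, ∀ x, ((C 0).eval x ^^ (C 0).eval (bxor x s) ^^ (C 0).eval (bxor x v) ^^ (C 0).eval (bxor x (bxor s v))) = false) ∧ (∀ u ∈ S, ((Finset.univ.filter fun i => u i && v i).card).bodd = false) ∧ v ∉ U) →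
          (∃ r : ℕ, r ≤ m + m + 1 ∧ (2 : ℝ) ^ ((m + m) * r) / ((m + m + 2 : ℝ) ^ 8) ≤ (∑ xs : Fin (r) → (Fin (m + m) → Bool), (((@Finset.filter (Fin (m + m) → Bool) (fun v => v ∉ S ∧ (∃ V : Finset (Fin (m + m) → Bool), ((zeroVec ∈ V ∧ ∀ x ∈ V, ∀ y ∈ V, bxor x y ∈ V) ∧ (((V).card : ℝ) ^ 2 = (2 : ℝ) ^ (m + m)) ∧ ∀ u ∈ V, ∀ v ∈ V, ∀ x, ((C 1).eval x ^^ (C 1).eval (bxor x u) ^^ (C 1).eval (bxor x v) ^^ (C 1).eval (bxor x (bxor u v))) = false) ∧ S ⊆ V ∧ v ∈ V ∧ (∀ s ∈ V, ∀ u ∈ U, ((Finset.univ.filter fun i => s i && u i).card).bodd = false))) (Classical.decPred _) (Finset.univ.filter fun (v : Fin (m + m) → Bool) => (∀ s ∈ S, ∀ x, ((C 1).eval x ^^ (C 1).eval (bxor x s) ^^ (C 1).eval (bxor x v) ^^ (C 1).eval (bxor x (bxor s v))) = false) ∧ (∀ u ∈ U, ((Finset.univ.filter fun i => u i && v i).card).bodd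 = false) ∧ ∀ j, (∀ y z : Fin (m + m) → Bool, (((C 1).eval z ^^ (C 1).eval (bxor z (xs j)) ^^ (C 1).eval (bxor z v) ^^ (C 1).eval (bxor z (bxor (xs j) v))) ^^ ((C 1).eval (bxor z y) ^^ (C 1).eval (bxor (bxor z y) (xs j)) ^^ (C 1).eval (bxor (bxor z y) v) ^^ (C 1).eval (bxor (bxor z y) (bxor (xs j) v)))) = false))).card : ℝ) / (((Finset.univ.filter fun (v : Fin (m + m) → Bool) => (∀ s ∈ S, ∀ x, ((C 1).eval x ^^ (C 1).eval (bxor x s) ^^ (C 1).eval (bxor x v) ^^ (C 1).eval (bxor x (bxor s v))) = false) ∧ (∀ u ∈ U, ((Finset.univ.filter fun i => u i && v i).card).bodd = false) ∧ ∀ j, (∀ y z : Fin (m + m) → Bool, (((C 1).eval z ^^ (C 1).eval (bxor z (xs j)) ^^ (C 1).eval (bxor z v) ^^ (C 1).eval (bxor z (bxor (xs j) v))) ^^ ((C 1).eval (bxor z y) ^^ (C 1).eval (bxor (bxor z y) (xs j)) ^^ (C 1).eval (bxor (bxor z y) v) ^^ (C 1).eval (bxor (bxor z y) (bxor (xs j)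 v)))) = false))).card : ℝ)))) ∨
          (∃ r : ℕ, r ≤ m + m + 1 ∧ (2 : ℝ) ^ ((m + m) * r) / ((m + m + 2 : ℝ) ^ 8) ≤ (∑ xs : Fin (r) → (Fin (m + m) → Bool), (((@Finset.filter (Fin (m + m) → Bool) (fun v => v ∉ U ∧ (∃ V : Finset (Fin (m + m) → Bool), ((zeroVec ∈ V ∧ ∀ x ∈ V, ∀ y ∈ V, bxor x y ∈ V) ∧ (((V).card : ℝ) ^ 2 = (2 : ℝ) ^ (m + m)) ∧ ∀ u ∈ V, ∀ v ∈ V, ∀ x, ((C 0).eval x ^^ (C 0).eval (bxor x u) ^^ (C 0).eval (bxor x v) ^^ (C 0).eval (bxor x (bxor u v))) = false) ∧ U ⊆ V ∧ v ∈ V ∧ (∀ s ∈ V, ∀ u ∈ S, ((Finset.univ.filter fun i => s i && u i).card).bodd = false))) (Classical.decPred _) (Finset.univ.filter fun (v : Fin (m + m) → Bool) => (∀ s ∈ U, ∀ x, ((C 0).eval x ^^ (C 0).eval (bxor x s) ^^ (C 0).eval (bxor x v) ^^ (C 0).eval (bxor x (bxor s v))) = false) ∧ (∀ u ∈ S, ((Finset.univ.filter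 fun i => u i && v i).card).bodd = false) ∧ ∀ j, (∀ y z : Fin (m + m) → Bool, (((C 0).eval z ^^ (C 0).eval (bxor z (xs j)) ^^ (C 0).eval (bxor z v) ^^ (C 0).eval (bxor z (bxor (xs j) v))) ^^ ((C 0).eval (bxor z y) ^^ (C 0).eval (bxor (bxor z y) (xs j)) ^^ (C 0).eval (bxor (bxor z y) v) ^^ (C 0).eval (bxor (bxor z y) (bxor (xs j) v)))) = false))).card : ℝ) / (((Finset.univ.filter fun (v : Fin (m + m) → Bool) => (∀ s ∈ U, ∀ x, ((C 0).eval x ^^ (C 0).eval (bxor x s) ^^ (C 0).eval (bxor x v) ^^ (C 0).eval (bxor x (bxor s v))) = false) ∧ (∀ u ∈ S, ((Finset.univ.filter fun i => u i && v i).card).bodd = false) ∧ ∀ j, (∀ y z : Fin (m + m) → Bool, (((C 0).eval z ^^ (C 0).eval (bxor z (xs j)) ^^ (C 0).eval (bxor z v) ^^ (C 0).eval (bxor z (bxor (xs j) v))) ^^ ((C 0).eval (bxor z y) ^^ (C 0).eval (bxor (bxor z y) (xs j)) ^^ (C 0).eval (bxor (bxor z y) v) ^^ (C 0).eval (bxor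 (bxor z y) (bxor (xs j) v)))) = false))).card : ℝ)))) := by
  sorry

/-- `stub_kernelStats` (the registered `Grow.KernelStats`, consumed by the landed `stub_growFinder`) is now a COMPOSITION
(reshape c3, 2026-08-17): case split on radical visibility into `stub_kernelStatsRadical` (with its three bricks) and `stub_kernelStatsCore`. -/
theorem stub_kernelStats :
    ∀ (m : ℕ) (C : Fin 2 → Circuit (Fin (m + m))),
        (⟨m + m, 2, C⟩ : KForrelationInstance).IsOverB2 →
        (∀ i, IsDegLeFun 3 (C i).eval) →
        (forrelation (C 0).eval (C 1).eval = 1 ∨ forrelation (C 0).eval (C 1).eval = -1) →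
        (∃ e : (Fin (m + m) → Bool) ≃ (Fin (m + m) → Bool),
          (∃ M : Matrix (Fin (m + m)) (Fin (m + m)) (ZMod 2), ∃ c : Fin (m + m) → ZMod 2,
            ∀ y i, (if e y i then (1 : ZMod 2) else 0) = (M.mulVec (fun j => if y j then (1 : ZMod 2) else 0) + c) i) ∧
          ∃ perm : (Fin m → Bool) ≃ (Fin m → Bool), ∃ h : (Fin m → Bool) → Bool, ∀ y' y'' : Fin m → Bool,
            (if (C 1).eval (e (Fin.append y' y'')) then (1 : ZMod 2) else 0) =
              (∑ i, (if y' i then (1 : ZMod 2) else 0) * (if perm y'' i then (1 : ZMod 2) else 0)) +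
                (if h y'' then (1 : ZMod 2) else 0)) →
        ∀ S U : Finset (Fin (m + m) → Bool),
          (zeroVec ∈ S ∧ ∀ x ∈ S, ∀ y ∈ S, bxor x y ∈ S) → (zeroVec ∈ U ∧ ∀ x ∈ U, ∀ y ∈ U, bxor x y ∈ U) →
          ((∀ s ∈ S, ∀ y : Fin (m + m) → Bool, (fun k => ((C 1).eval zeroVec ^^ (C 1).eval (bxor zeroVec s) ^^ (C 1).eval (bxor zeroVec y) ^^ (C 1).eval (bxor zeroVec (bxor s y))) ^^ ((C 1).eval (fun j => decide (j = k)) ^^ (C 1).eval (bxor (fun j => decide (j = k)) s) ^^ (C 1).eval (bxor (fun j => decide (j = k)) y) ^^ (C 1).eval (bxor (fun j => decide (j = k)) (bxor s y)))) ∈ U) ∧ (∀ s ∈ S, ∃ ℓ ∈ U, ∀ r : Fin (m + m) → Bool, (∀ y z : Fin (m + m) → Bool, (((C 1).eval z ^^ (C 1).eval (bxor z s) ^^ (C 1).eval (bxor z r) ^^ (C 1).eval (bxor z (bxor s r))) ^^ ((C 1).eval (bxor z y) ^^ (C 1).eval (bxor (bxor z y) s) ^^ (C 1).eval (bxor (bxor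 z y) r) ^^ (C 1).eval (bxor (bxor z y) (bxor s r)))) = false) → ((C 1).eval r ^^ (C 1).eval (bxor r s) ^^ (C 1).eval zeroVec ^^ (C 1).eval s) = ((Finset.univ.filter fun i => ℓ i && r i).card).bodd)) →
          ((∀ s ∈ U, ∀ y : Fin (m + m) → Bool, (fun k => ((C 0).eval zeroVec ^^ (C 0).eval (bxor zeroVec s) ^^ (C 0).eval (bxor zeroVec y) ^^ (C 0).eval (bxor zeroVec (bxor s y))) ^^ ((C 0).eval (fun j => decide (j = k)) ^^ (C 0).eval (bxor (fun j => decide (j = k)) s) ^^ (C 0).eval (bxor (fun j => decide (j = k)) y) ^^ (C 0).eval (bxor (fun j => decide (j = k)) (bxor s y)))) ∈ S) ∧ (∀ s ∈ U, ∃ ℓ ∈ S, ∀ r : Fin (m + m) → Bool, (∀ y z : Fin (m + m) → Bool, (((C 0).eval z ^^ (C 0).eval (bxor z s) ^^ (C 0).eval (bxor z r) ^^ (C 0).eval (bxor z (bxor s r))) ^^ ((C 0).eval (bxor z y) ^^ (C 0).eval (bxor (bxor z y) s) ^^ (C 0).eval (bxor (bxor z y) r) ^^ (C 0).eval (bxor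 (bxor z y) (bxor s r)))) = false) → ((C 0).eval r ^^ (C 0).eval (bxor r s) ^^ (C 0).eval zeroVec ^^ (C 0).eval s) = ((Finset.univ.filter fun i => ℓ i && r i).card).bodd)) →
          (∀ s ∈ S, ∀ u ∈ U, ((Finset.univ.filter fun i => s i && u i).card).bodd = false) →
          S.card < 2 ^ m → U.card < 2 ^ m →
          (∃ r : ℕ, r ≤ m + m + 1 ∧ (2 : ℝ) ^ ((m + m) * r) / ((m + m + 2 : ℝ) ^ 8) ≤ (∑ xs : Fin (r) → (Fin (m + m) → Bool), (((@Finset.filter (Fin (m + m) → Bool) (fun v => v ∉ S ∧ (∃ V : Finset (Fin (m + m) → Bool), ((zeroVec ∈ V ∧ ∀ x ∈ V, ∀ y ∈ V, bxor x y ∈ V) ∧ (((V).card : ℝ) ^ 2 = (2 : ℝ) ^ (m + m)) ∧ ∀ u ∈ V, ∀ v ∈ V, ∀ x, ((C 1).eval x ^^ (C 1).eval (bxor x u) ^^ (C 1).eval (bxor x v) ^^ (C 1).eval (bxor x (bxor u v))) = false) ∧ S ⊆ V ∧ v ∈ V ∧ (∀ s ∈ V, ∀ u ∈ U, ((Finset.univ.filter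 fun i => s i && u i).card).bodd = false))) (Classical.decPred _) (Finset.univ.filter fun (v : Fin (m + m) → Bool) => (∀ s ∈ S, ∀ x, ((C 1).eval x ^^ (C 1).eval (bxor x s) ^^ (C 1).eval (bxor x v) ^^ (C 1).eval (bxor x (bxor s v))) = false) ∧ (∀ u ∈ U, ((Finset.univ.filter fun i => u i && v i).card).bodd = false) ∧ ∀ j, (∀ y z : Fin (m + m) → Bool, (((C 1).eval z ^^ (C 1).eval (bxor z (xs j)) ^^ (C 1).eval (bxor z v) ^^ (C 1).eval (bxor z (bxor (xs j) v))) ^^ ((C 1).eval (bxor z y) ^^ (C 1).eval (bxor (bxor z y) (xs j)) ^^ (C 1).eval (bxor (bxor z y) v) ^^ (C 1).eval (bxor (bxor z y) (bxor (xs j) v)))) = false))).card : ℝ) / (((Finset.univ.filter fun (v : Fin (m + m) → Bool) => (∀ s ∈ S, ∀ x, ((C 1).eval x ^^ (C 1).eval (bxor x s) ^^ (C 1).eval (bxor x v) ^^ (C 1).eval (bxor x (bxor s v))) = false) ∧ (∀ u ∈ U, ((Finset.univ.filter fun i => u i && v i).card).bodd = false) ∧ ∀ j, (∀ y z : Fin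 (m + m) → Bool, (((C 1).eval z ^^ (C 1).eval (bxor z (xs j)) ^^ (C 1).eval (bxor z v) ^^ (C 1).eval (bxor z (bxor (xs j) v))) ^^ ((C 1).eval (bxor z y) ^^ (C 1).eval (bxor (bxor z y) (xs j)) ^^ (C 1).eval (bxor (bxor z y) v) ^^ (C 1).eval (bxor (bxor z y) (bxor (xs j) v)))) = false))).card : ℝ)))) ∨
          (∃ r : ℕ, r ≤ m + m + 1 ∧ (2 : ℝ) ^ ((m + m) * r) / ((m + m + 2 : ℝ) ^ 8) ≤ (∑ xs : Fin (r) → (Fin (m + m) → Bool), (((@Finset.filter (Fin (m + m) → Bool) (fun v => v ∉ U ∧ (∃ V : Finset (Fin (m + m) → Bool), ((zeroVec ∈ V ∧ ∀ x ∈ V, ∀ y ∈ V, bxor x y ∈ V) ∧ (((V).card : ℝ) ^ 2 = (2 : ℝ) ^ (m + m)) ∧ ∀ u ∈ V, ∀ v ∈ V, ∀ x, ((C 0).eval x ^^ (C 0).eval (bxor x u) ^^ (C 0).eval (bxor x v) ^^ (C 0).eval (bxor x (bxor u v))) = false) ∧ U ⊆ V ∧ v ∈ V ∧ (∀ s ∈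 V, ∀ u ∈ S, ((Finset.univ.filter fun i => s i && u i).card).bodd = false))) (Classical.decPred _) (Finset.univ.filter fun (v : Fin (m + m) → Bool) => (∀ s ∈ U, ∀ x, ((C 0).eval x ^^ (C 0).eval (bxor x s) ^^ (C 0).eval (bxor x v) ^^ (C 0).eval (bxor x (bxor s v))) = false) ∧ (∀ u ∈ S, ((Finset.univ.filter fun i => u i && v i).card).bodd = false) ∧ ∀ j, (∀ y z : Fin (m + m) → Bool, (((C 0).eval z ^^ (C 0).eval (bxor z (xs j)) ^^ (C 0).eval (bxor z v) ^^ (C 0).eval (bxor z (bxor (xs j) v))) ^^ ((C 0).eval (bxor z y) ^^ (C 0).eval (bxor (bxor z y) (xs j)) ^^ (C 0).eval (bxor (bxor z y) v) ^^ (C 0).eval (bxor (bxor z y) (bxor (xs j) v)))) = false))).card : ℝ) / (((Finset.univ.filter fun (v : Fin (m + m) → Bool) => (∀ s ∈ U, ∀ x, ((C 0).eval x ^^ (C 0).eval (bxor x s) ^^ (C 0).eval (bxor x v) ^^ (C 0).eval (bxor x (bxor s v))) = false) ∧ (∀ u ∈ S, ((Finset.univ.filter fun i => u i && v i).card).bodd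 = false) ∧ ∀ j, (∀ y z : Fin (m + m) → Bool, (((C 0).eval z ^^ (C 0).eval (bxor z (xs j)) ^^ (C 0).eval (bxor z v) ^^ (C 0).eval (bxor z (bxor (xs j) v))) ^^ ((C 0).eval (bxor z y) ^^ (C 0).eval (bxor (bxor z y) (xs j)) ^^ (C 0).eval (bxor (bxor z y) v) ^^ (C 0).eval (bxor (bxor z y) (bxor (xs j) v)))) = false))).card : ℝ)))) := by
  intro m C hB hdeg hΦ horb S U hS hU hcb hca ho hSlt hUlt
  by_cases hrad : ∃ v : Fin (m + m) → Bool, (∀ x y z : Fin (m + m) → Bool, (((C 1).eval z ^^ (C 1).eval (bxor z x) ^^ (C 1).eval (bxor z v) ^^ (C 1).eval (bxor z (bxor x v))) ^^ ((C 1).eval (bxor z y) ^^ (C 1).eval (bxor (bxor z y) x) ^^ (C 1).eval (bxor (bxor z y) v) ^^ (C 1).eval (bxor (bxor z y) (bxor x v)))) = false) ∧ (∀ s ∈ S, ∀ x, ((C 1).eval x ^^ (C 1).eval (bxor x s) ^^ (C 1).eval (bxor x v) ^^ (C 1).eval (bxor x (bxor s v))) = false) ∧ (∀ u ∈ U, ((Finset.univ.filter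 fun i => u i && v i).card).bodd = false) ∧ v ∉ S
  · exact Or.inl (stub_kernelStatsRadical stub_spanHalf stub_spanningOfNoDual stub_radicalGood m C hB hdeg hΦ horb S U hS hU hcb
      hca ho hSlt hUlt hrad)
  · by_cases hradA : ∃ v : Fin (m + m) → Bool, (∀ x y z : Fin (m + m) → Bool, (((C 0).eval z ^^ (C 0).eval (bxor z x) ^^ (C 0).eval (bxor z v) ^^ (C 0).eval (bxor z (bxor x v))) ^^ ((C 0).eval (bxor z y) ^^ (C 0).eval (bxor (bxor z y) x) ^^ (C 0).eval (bxor (bxor z y) v) ^^ (C 0).eval (bxor (bxor z y) (bxor x v)))) = false) ∧ (∀ s ∈ U, ∀ x, ((C 0).eval x ^^ (C 0).eval (bxor x s) ^^ (C 0).eval (bxor x v) ^^ (C 0).eval (bxor x (bxor s v))) = false) ∧ (∀ u ∈ S, ((Finset.univ.filter fun i => u i && v i).card).bodd = false) ∧ v ∉ U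
    · exact Or.inr (stub_kernelStatsRadicalA stub_spanHalf stub_spanningOfNoDual stub_radicalGood m C hB hdeg hΦ horb S U hS hU hcb
        hca ho hSlt hUlt hradA)
    · exact stub_kernelStatsCore m C hB hdeg hΦ horb S U hS hU hcb hca ho hSlt hUlt hrad hradA

/-- stub (LANDED p125628 by wave-1 worker, 2026-08-16 — 13 files `…GrowMachine{Bricks,Closure,,Spec,Spans,ClosedKset,Rounds,Steps,Terminal,Stages,Coins,Law,Complete}.lean`, machine `GrowMachine.growFind`, coin polynomial `3(ℓ+1)²(ℓ+3)¹⁰`): THE GROW MACHINE. `find ⟨x, y⟩`: parse `x` (guard `k = 2`,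
`n ≤ |x|+1` as in `findV2`), tensors of both circuits (bricks of `…FinderMachineBricks.lean`); state = row bases of `(S, U)`, initially
empty; STAGE (while `|S| < m ∧ |U| < m`, at most `n` stages): for `r = 1 … n+1` and `T = (n+2)^9` trials each, read `r` probes and a
selector from the coins `y`, compute `K = Z_b(S) ∩ U^⊥ ∩ ⋂ rad B_{x_j}` (Gaussian elimination, `F2Elim`), `v :=` the selected element
of `K`; CLOSURE of `(S + v, U)` by at most `n` rounds of (rows of slices + offset solve) both ways; ACCEPT the first `v ∉ span S` whose
closure has both ranks `≤ m` and is orthogonal; same on the `a`-side; OUTPUT the `m` rows of `S` (or of `U^⊥`) iff they pass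
`MMReadout.certOK` (else `[]`). `find ∈ FP` by the `CodeFP` algebra; SOUNDNESS from `certOK` exactly as `findV2_sound`; COMPLETENESS:
by the second hypothesis a good `v` has closure below the closed orthogonal M-pair, hence is accepted, and an accepted step keeps
`(S, U)` closed orthogonal; by the first hypothesis each trial of the right `r` succeeds with probability `≥ (n+2)^{-8}` independently
(disjoint coin chunks, `CoinChunks`/`CoinCounting`), so all `≤ n` stages succeed with probability `≥ 2/3`; a terminal closed orthogonal pair
is an M-pair (closed + orthogonal ⇒ flat; `|S| = 2^m`, or `U` an M-subspace of `a` and then `U^⊥` one of `b` by `stub_frameLock`). -/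
theorem stub_growFinder :
    (∀ (m : ℕ) (C : Fin 2 → Circuit (Fin (m + m))),
        (⟨m + m, 2, C⟩ : KForrelationInstance).IsOverB2 →
        (∀ i, IsDegLeFun 3 (C i).eval) →
        (forrelation (C 0).eval (C 1).eval = 1 ∨ forrelation (C 0).eval (C 1).eval = -1) →
        (∃ e : (Fin (m + m) → Bool) ≃ (Fin (m + m) → Bool),
          (∃ M : Matrix (Fin (m + m)) (Fin (m + m)) (ZMod 2), ∃ c : Fin (m + m) → ZMod 2,
            ∀ y i, (if e y i then (1 : ZMod 2) else 0) = (M.mulVec (fun j => if y j then (1 : ZMod 2) else 0) + c) i) ∧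
          ∃ perm : (Fin m → Bool) ≃ (Fin m → Bool), ∃ h : (Fin m → Bool) → Bool, ∀ y' y'' : Fin m → Bool,
            (if (C 1).eval (e (Fin.append y' y'')) then (1 : ZMod 2) else 0) =
              (∑ i, (if y' i then (1 : ZMod 2) else 0) * (if perm y'' i then (1 : ZMod 2) else 0)) +
                (if h y'' then (1 : ZMod 2) else 0)) →
        ∀ S U : Finset (Fin (m + m) → Bool),
          (zeroVec ∈ S ∧ ∀ x ∈ S, ∀ y ∈ S, bxor x y ∈ S) → (zeroVec ∈ U ∧ ∀ x ∈ U, ∀ y ∈ U, bxor x y ∈ U) →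
          ((∀ s ∈ S, ∀ y : Fin (m + m) → Bool, (fun k => ((C 1).eval zeroVec ^^ (C 1).eval (bxor zeroVec s) ^^ (C 1).eval (bxor zeroVec y) ^^ (C 1).eval (bxor zeroVec (bxor s y))) ^^ ((C 1).eval (fun j => decide (j = k)) ^^ (C 1).eval (bxor (fun j => decide (j = k)) s) ^^ (C 1).eval (bxor (fun j => decide (j = k)) y) ^^ (C 1).eval (bxor (fun j => decide (j = k)) (bxor s y)))) ∈ U) ∧ (∀ s ∈ S, ∃ ℓ ∈ U, ∀ r : Fin (m + m) → Bool, (∀ y z : Fin (m + m) → Bool, (((C 1).eval z ^^ (C 1).eval (bxor z s) ^^ (C 1).eval (bxor z r) ^^ (C 1).eval (bxor z (bxor s r))) ^^ ((C 1).eval (bxor z y) ^^ (C 1).eval (bxor (bxor z y) s) ^^ (C 1).eval (bxor (bxor z y) r) ^^ (C 1).eval (bxor (bxor z y) (bxor s r)))) = false) → ((C 1).eval r ^^ (C 1).eval (bxor r s) ^^ (C 1).eval zeroVec ^^ (C 1).eval s) = ((Finset.univ.filter fun i => ℓ i && r i).card).bodd)) →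
          ((∀ s ∈ U, ∀ y : Fin (m + m) → Bool, (fun k => ((C 0).eval zeroVec ^^ (C 0).eval (bxor zeroVec s) ^^ (C 0).eval (bxor zeroVec y) ^^ (C 0).eval (bxor zeroVec (bxor s y))) ^^ ((C 0).eval (fun j => decide (j = k)) ^^ (C 0).eval (bxor (fun j => decide (j = k)) s) ^^ (C 0).eval (bxor (fun j => decide (j = k)) y) ^^ (C 0).eval (bxor (fun j => decide (j = k)) (bxor s y)))) ∈ S) ∧ (∀ s ∈ U, ∃ ℓ ∈ S, ∀ r : Fin (m + m) → Bool, (∀ y z : Fin (m + m) → Bool, (((C 0).eval z ^^ (C 0).eval (bxor z s) ^^ (C 0).eval (bxor z r) ^^ (C 0).eval (bxor z (bxor s r))) ^^ ((C 0).eval (bxor z y) ^^ (C 0).eval (bxor (bxor z y) s) ^^ (C 0).eval (bxor (bxor z y) r) ^^ (C 0).eval (bxor (bxor z y) (bxor s r)))) = false) → ((C 0).eval r ^^ (C 0).eval (bxor r s) ^^ (C 0).eval zeroVec ^^ (C 0).eval s) = ((Finset.univ.filter fun i => ℓ i && r i).card).bodd)) →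
          (∀ s ∈ S, ∀ u ∈ U, ((Finset.univ.filter fun i => s i && u i).card).bodd = false) →
          S.card < 2 ^ m → U.card < 2 ^ m →
          (∃ r : ℕ, r ≤ m + m + 1 ∧ (2 : ℝ) ^ ((m + m) * r) / ((m + m + 2 : ℝ) ^ 8) ≤ (∑ xs : Fin (r) → (Fin (m + m) → Bool), (((@Finset.filter (Fin (m + m) → Bool) (fun v => v ∉ S ∧ (∃ V : Finset (Fin (m + m) → Bool), ((zeroVec ∈ V ∧ ∀ x ∈ V, ∀ y ∈ V, bxor x y ∈ V) ∧ (((V).card : ℝ) ^ 2 = (2 : ℝ) ^ (m + m)) ∧ ∀ u ∈ V, ∀ v ∈ V, ∀ x, ((C 1).eval x ^^ (C 1).eval (bxor x u) ^^ (C 1).eval (bxor x v) ^^ (C 1).eval (bxor x (bxor u v))) = false) ∧ S ⊆ V ∧ v ∈ V ∧ (∀ s ∈ V, ∀ u ∈ U, ((Finset.univ.filter fun i => s i && u i).card).bodd = false))) (Classical.decPred _) (Finset.univ.filter fun (v : Fin (m + m) → Bool) => (∀ s ∈ S, ∀ x, ((C 1).eval x ^^ (C 1).eval (bxor x s) ^^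 (C 1).eval (bxor x v) ^^ (C 1).eval (bxor x (bxor s v))) = false) ∧ (∀ u ∈ U, ((Finset.univ.filter fun i => u i && v i).card).bodd = false) ∧ ∀ j, (∀ y z : Fin (m + m) → Bool, (((C 1).eval z ^^ (C 1).eval (bxor z (xs j)) ^^ (C 1).eval (bxor z v) ^^ (C 1).eval (bxor z (bxor (xs j) v))) ^^ ((C 1).eval (bxor z y) ^^ (C 1).eval (bxor (bxor z y) (xs j)) ^^ (C 1).eval (bxor (bxor z y) v) ^^ (C 1).eval (bxor (bxor z y) (bxor (xs j) v)))) = false))).card : ℝ) / (((Finset.univ.filter fun (v : Fin (m + m) → Bool) => (∀ s ∈ S, ∀ x, ((C 1).eval x ^^ (C 1).eval (bxor x s) ^^ (C 1).eval (bxor x v) ^^ (C 1).eval (bxor x (bxor s v))) = false) ∧ (∀ u ∈ U, ((Finset.univ.filter fun i => u i && v i).card).bodd = false) ∧ ∀ j, (∀ y z : Fin (m + m) → Bool, (((C 1).eval z ^^ (C 1).eval (bxor z (xs j)) ^^ (C 1).eval (bxor z v) ^^ (C 1).eval (bxor z (bxor (xs j) v))) ^^ ((C 1).eval (bxor z y)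 ^^ (C 1).eval (bxor (bxor z y) (xs j)) ^^ (C 1).eval (bxor (bxor z y) v) ^^ (C 1).eval (bxor (bxor z y) (bxor (xs j) v)))) = false))).card : ℝ)))) ∨
          (∃ r : ℕ, r ≤ m + m + 1 ∧ (2 : ℝ) ^ ((m + m) * r) / ((m + m + 2 : ℝ) ^ 8) ≤ (∑ xs : Fin (r) → (Fin (m + m) → Bool), (((@Finset.filter (Fin (m + m) → Bool) (fun v => v ∉ U ∧ (∃ V : Finset (Fin (m + m) → Bool), ((zeroVec ∈ V ∧ ∀ x ∈ V, ∀ y ∈ V, bxor x y ∈ V) ∧ (((V).card : ℝ) ^ 2 = (2 : ℝ) ^ (m + m)) ∧ ∀ u ∈ V, ∀ v ∈ V, ∀ x, ((C 0).eval x ^^ (C 0).eval (bxor x u) ^^ (C 0).eval (bxor x v) ^^ (C 0).eval (bxor x (bxor u v))) = false) ∧ U ⊆ V ∧ v ∈ V ∧ (∀ s ∈ V, ∀ u ∈ S, ((Finset.univ.filter fun i => s i && u i).card).bodd = false))) (Classical.decPred _) (Finset.univ.filter fun (v : Fin (m + m) → Bool) => (∀ s ∈ U, ∀ x, ((C 0).eval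 x ^^ (C 0).eval (bxor x s) ^^ (C 0).eval (bxor x v) ^^ (C 0).eval (bxor x (bxor s v))) = false) ∧ (∀ u ∈ S, ((Finset.univ.filter fun i => u i && v i).card).bodd = false) ∧ ∀ j, (∀ y z : Fin (m + m) → Bool, (((C 0).eval z ^^ (C 0).eval (bxor z (xs j)) ^^ (C 0).eval (bxor z v) ^^ (C 0).eval (bxor z (bxor (xs j) v))) ^^ ((C 0).eval (bxor z y) ^^ (C 0).eval (bxor (bxor z y) (xs j)) ^^ (C 0).eval (bxor (bxor z y) v) ^^ (C 0).eval (bxor (bxor z y) (bxor (xs j) v)))) = false))).card : ℝ) / (((Finset.univ.filter fun (v : Fin (m + m) → Bool) => (∀ s ∈ U, ∀ x, ((C 0).eval x ^^ (C 0).eval (bxor x s) ^^ (C 0).eval (bxor x v) ^^ (C 0).eval (bxor x (bxor s v))) = false) ∧ (∀ u ∈ S, ((Finset.univ.filter fun i => u i && v i).card).bodd = false) ∧ ∀ j, (∀ y z : Fin (m + m) → Bool, (((C 0).eval z ^^ (C 0).eval (bxor z (xs j)) ^^ (C 0).eval (bxor z v) ^^ (C 0).eval (bxor z (bxor (xs j)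 v))) ^^ ((C 0).eval (bxor z y) ^^ (C 0).eval (bxor (bxor z y) (xs j)) ^^ (C 0).eval (bxor (bxor z y) v) ^^ (C 0).eval (bxor (bxor z y) (bxor (xs j) v)))) = false))).card : ℝ))))) →
    (∀ (n : ℕ) (a b : (Fin n → Bool) → Bool) (V : Finset (Fin n → Bool)),
        IsDegLeFun 3 a → IsDegLeFun 3 b → (forrelation a b = 1 ∨ forrelation a b = -1) →
        ((zeroVec ∈ V ∧ ∀ x ∈ V, ∀ y ∈ V, bxor x y ∈ V) ∧ (((V).card : ℝ) ^ 2 = (2 : ℝ) ^ (n)) ∧ ∀ u ∈ V, ∀ v ∈ V, ∀ x, (b x ^^ b (bxor x u) ^^ b (bxor x v) ^^ b (bxor x (bxor u v))) = false) →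
        ((∀ s ∈ V, ∀ y : Fin (n) → Bool, (fun k => (b zeroVec ^^ b (bxor zeroVec s) ^^ b (bxor zeroVec y) ^^ b (bxor zeroVec (bxor s y))) ^^ (b (fun j => decide (j = k)) ^^ b (bxor (fun j => decide (j = k)) s) ^^ b (bxor (fun j => decide (j = k)) y) ^^ b (bxor (fun j => decide (j = k)) (bxor s y)))) ∈ (Finset.univ.filter fun (y : Fin (n) → Bool) => ∀ s ∈ V, ((Finset.univ.filter fun i => s i && y i).card).bodd = false)) ∧ (∀ s ∈ V, ∃ ℓ ∈ (Finset.univ.filter fun (y : Fin (n) → Bool) => ∀ s ∈ V, ((Finset.univ.filter fun i => s i && y i).card).bodd = false), ∀ r : Fin (n) → Bool, (∀ y z : Fin (n) → Bool, ((b z ^^ b (bxor z s) ^^ b (bxor z r) ^^ b (bxor z (bxor s r))) ^^ (b (bxor z y) ^^ b (bxor (bxor z y) s) ^^ b (bxor (bxor z y) r) ^^ b (bxor (bxor z y) (bxor s r)))) = false) → (b r ^^ b (bxor r s) ^^ b zeroVec ^^ b s) = ((Finset.univ.filter fun i => ℓ i && r i).card).bodd)) ∧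
        ((∀ s ∈ (Finset.univ.filter fun (y : Fin (n) → Bool) => ∀ s ∈ V, ((Finset.univ.filter fun i => s i && y i).card).bodd = false), ∀ y : Fin (n) → Bool, (fun k => (a zeroVec ^^ a (bxor zeroVec s) ^^ a (bxor zeroVec y) ^^ a (bxor zeroVec (bxor s y))) ^^ (a (fun j => decide (j = k)) ^^ a (bxor (fun j => decide (j = k)) s) ^^ a (bxor (fun j => decide (j = k)) y) ^^ a (bxor (fun j => decide (j = k)) (bxor s y)))) ∈ V) ∧ (∀ s ∈ (Finset.univ.filter fun (y : Fin (n) → Bool) => ∀ s ∈ V, ((Finset.univ.filter fun i => s i && y i).card).bodd = false), ∃ ℓ ∈ V, ∀ r : Fin (n) → Bool, (∀ y z : Fin (n) → Bool, ((a z ^^ a (bxor z s) ^^ a (bxor z r) ^^ a (bxor z (bxor s r))) ^^ (a (bxor z y) ^^ a (bxor (bxor z y) s) ^^ a (bxor (bxor z y) r) ^^ a (bxor (bxor z y) (bxor s r)))) = false) → (a r ^^ a (bxor r s) ^^ a zeroVec ^^ a s) = ((Finset.univ.filter fun i => ℓ i && r i).card).bodd)) ∧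
        (∀ s ∈ V, ∀ u ∈ (Finset.univ.filter fun (y : Fin (n) → Bool) => ∀ s ∈ V, ((Finset.univ.filter fun i => s i && y i).card).bodd = false), ((Finset.univ.filter fun i => s i && u i).card).bodd = false)) →
    ∃ find ∈ FP, ∃ p : Polynomial ℕ, ∀ (m : ℕ) (C : Fin 2 → Circuit (Fin (m + m))),
        (⟨m + m, 2, C⟩ : KForrelationInstance).IsOverB2 →
        (∀ i, IsDegLeFun 3 (C i).eval) →
        (forrelation (C 0).eval (C 1).eval = 1 ∨ forrelation (C 0).eval (C 1).eval = -1) →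
        (∃ e : (Fin (m + m) → Bool) ≃ (Fin (m + m) → Bool),
          (∃ M : Matrix (Fin (m + m)) (Fin (m + m)) (ZMod 2), ∃ c : Fin (m + m) → ZMod 2,
            ∀ y i, (if e y i then (1 : ZMod 2) else 0) = (M.mulVec (fun j => if y j then (1 : ZMod 2) else 0) + c) i) ∧
          ∃ perm : (Fin m → Bool) ≃ (Fin m → Bool), ∃ h : (Fin m → Bool) → Bool, ∀ y' y'' : Fin m → Bool,
            (if (C 1).eval (e (Fin.append y' y'')) then (1 : ZMod 2) else 0) =
              (∑ i, (if y' i then (1 : ZMod 2) else 0) * (if perm y'' i then (1 : ZMod 2) else 0)) +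
                (if h y'' then (1 : ZMod 2) else 0)) →
        (∀ (y : List Bool) (L : List (List Bool)),
            find (boolPair (KForrelationInstance.encode ⟨m + m, 2, C⟩) y) = encList L → L ≠ [] →
            ((zeroVec ∈ (@Finset.filter (Fin (m + m) → Bool) (fun v => (fun i => if v i then (1 : ZMod 2) else 0) ∈ F2Elim.rowSpan (m + m) L) (Classical.decPred _) Finset.univ) ∧ ∀ x ∈ (@Finset.filter (Fin (m + m) → Bool) (fun v => (fun i => if v i then (1 : ZMod 2) else 0) ∈ F2Elim.rowSpan (m + m) L) (Classical.decPred _) Finset.univ), ∀ y ∈ (@Finset.filter (Fin (m + m) → Bool) (fun v => (fun i => if v i then (1 : ZMod 2) else 0) ∈ F2Elim.rowSpan (m + m) L) (Classical.decPred _) Finset.univ), bxor x y ∈ (@Finset.filter (Fin (m + m) → Bool) (fun v => (fun i => if v i then (1 : ZMod 2) else 0) ∈ F2Elim.rowSpan (m + m) L) (Classical.decPred _) Finset.univ)) ∧ ((((@Finset.filter (Fin (m + m) → Bool) (fun v => (fun i => if v i then (1 : ZMod 2) else 0) ∈ F2Elim.rowSpan (m + m) L) (Classical.decPred _) Finset.univ)).card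 : ℝ) ^ 2 = (2 : ℝ) ^ (m + m)) ∧ ∀ u ∈ (@Finset.filter (Fin (m + m) → Bool) (fun v => (fun i => if v i then (1 : ZMod 2) else 0) ∈ F2Elim.rowSpan (m + m) L) (Classical.decPred _) Finset.univ), ∀ v ∈ (@Finset.filter (Fin (m + m) → Bool) (fun v => (fun i => if v i then (1 : ZMod 2) else 0) ∈ F2Elim.rowSpan (m + m) L) (Classical.decPred _) Finset.univ), ∀ x, ((C 1).eval x ^^ (C 1).eval (bxor x u) ^^ (C 1).eval (bxor x v) ^^ (C 1).eval (bxor x (bxor u v))) = false)) ∧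
        (2 / 3 : ℝ) ≤ uniformProb (p.eval (KForrelationInstance.encode ⟨m + m, 2, C⟩).length)
            {y | ∃ L : List (List Bool), L ≠ [] ∧ find (boolPair (KForrelationInstance.encode ⟨m + m, 2, C⟩) y) = encList L} :=
  _root_.Summit.QuantumAdvantage.QuantumAdvantage.Theorems.SignedExactCubicForrelationNotPrBPP.stub_growFinder

/-- stub (LANDED p120617 by wave-1 worker, 2026-08-16): COIN PLUMBING. Decider on `⟨x, y⟩`: parse `x` (junk ↦ reject), `L := rows(find ⟨x, y⟩)`;
if `L = []` REJECT; else, as the landed deterministic `stub_plumbing` (`Plumbing.acceptCore`): basis of `V^⊥`, slope `μ` of `f = C 0` on it,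
ACCEPT iff `f(0) = g(μ)`. On the promise a non-empty `L` spans an M-subspace (soundness clause, every coin string), so the answer is the
sign (`SignReadout` + `dual_affine_on_perp_cosets`): YES instances are accepted with probability `≥ 2/3` (completeness clause), NO
instances are NEVER accepted; wrapper `PromiseProblem.mem_PromiseBPP'_of_fp_decider` with the finder's polynomial. -/
theorem stub_plumbingCoins :
    (∃ find ∈ FP, ∃ p : Polynomial ℕ, ∀ (I : KForrelationInstance) (hk : I.k = 2), Even I.n → I.IsOverB2 →
        (∀ i, IsDegLeFun 3 (I.C i).eval) → (I.value = 1 ∨ I.value = -1) →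
        (∀ (y : List Bool) (L : List (List Bool)), find (boolPair I.encode y) = encList L → L ≠ [] →
          ((zeroVec ∈ (@Finset.filter (Fin (I.n) → Bool) (fun v => (fun i => if v i then (1 : ZMod 2) else 0) ∈ F2Elim.rowSpan (I.n) L) (Classical.decPred _) Finset.univ) ∧ ∀ x ∈ (@Finset.filter (Fin (I.n) → Bool) (fun v => (fun i => if v i then (1 : ZMod 2) else 0) ∈ F2Elim.rowSpan (I.n) L) (Classical.decPred _) Finset.univ), ∀ y ∈ (@Finset.filter (Fin (I.n) → Bool) (fun v => (fun i => if v i then (1 : ZMod 2) else 0) ∈ F2Elim.rowSpan (I.n) L) (Classical.decPred _) Finset.univ), bxor x y ∈ (@Finset.filter (Fin (I.n) → Bool) (fun v => (fun i => if v i then (1 : ZMod 2) else 0) ∈ F2Elim.rowSpan (I.n) L) (Classical.decPred _) Finset.univ)) ∧ ((((@Finset.filter (Fin (I.n) → Bool) (fun v => (fun i => if v i then (1 : ZMod 2) else 0) ∈ F2Elim.rowSpan (I.n) L) (Classical.decPred _) Finset.univ)).card : ℝ) ^ 2 = (2 : ℝ) ^ (I.n)) ∧ ∀ u ∈ (@Finset.filter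 (Fin (I.n) → Bool) (fun v => (fun i => if v i then (1 : ZMod 2) else 0) ∈ F2Elim.rowSpan (I.n) L) (Classical.decPred _) Finset.univ), ∀ v ∈ (@Finset.filter (Fin (I.n) → Bool) (fun v => (fun i => if v i then (1 : ZMod 2) else 0) ∈ F2Elim.rowSpan (I.n) L) (Classical.decPred _) Finset.univ), ∀ x, ((I.C (Fin.cast hk.symm 1)).eval x ^^ (I.C (Fin.cast hk.symm 1)).eval (bxor x u) ^^ (I.C (Fin.cast hk.symm 1)).eval (bxor x v) ^^ (I.C (Fin.cast hk.symm 1)).eval (bxor x (bxor u v))) = false)) ∧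
        (2 / 3 : ℝ) ≤ uniformProb (p.eval I.encode.length)
            {y | ∃ L : List (List Bool), L ≠ [] ∧ find (boolPair I.encode y) = encList L}) →
    (∀ (n : ℕ) (a b : (Fin n → Bool) → Bool) (V : Finset (Fin n → Bool)) (μ : Fin n → Bool),
    (forrelation a b = 1 ∨ forrelation a b = -1) →
    ((zeroVec ∈ V ∧ ∀ x ∈ V, ∀ y ∈ V, bxor x y ∈ V) ∧ (((V).card : ℝ) ^ 2 = (2 : ℝ) ^ (n)) ∧ (∀ u ∈ V, ∀ v ∈ V, ∀ x, (b x ^^ b (bxor x u) ^^ b (bxor x v) ^^ b (bxor x (bxor u v))) = false)) →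
    (∀ x ∈ (Finset.univ.filter fun y => ∀ v ∈ V, twist v y = 1), signOf (a x) * twist x μ = signOf (a zeroVec)) →
    forrelation a b = signOf (a zeroVec) * signOf (b μ)) →
    signedExactCubicForrelationProblem 2 ∈ PromiseBPP' :=
  _root_.Summit.QuantumAdvantage.QuantumAdvantage.Theorems.SignedExactCubicForrelationNotPrBPP.stub_plumbingCoins

/-- The second hypothesis of `stub_plumbingCoins` is literally `SignReadout`. -/
example : SignReadout ↔ (∀ (n : ℕ) (a b : (Fin n → Bool) → Bool) (V : Finset (Fin n → Bool)) (μ : Fin n → Bool),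
    (forrelation a b = 1 ∨ forrelation a b = -1) →
    ((zeroVec ∈ V ∧ ∀ x ∈ V, ∀ y ∈ V, bxor x y ∈ V) ∧ (((V).card : ℝ) ^ 2 = (2 : ℝ) ^ (n)) ∧ (∀ u ∈ V, ∀ v ∈ V, ∀ x, (b x ^^ b (bxor x u) ^^ b (bxor x v) ^^ b (bxor x (bxor u v))) = false)) →
    (∀ x ∈ (Finset.univ.filter fun y => ∀ v ∈ V, twist v y = 1), signOf (a x) * twist x μ = signOf (a zeroVec)) →
    forrelation a b = signOf (a zeroVec) * signOf (b μ)) := Iff.rfl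

/-! ### Proved glue of the GROW line -/

/-- Existence half of the kernel statistics, from the no-trap theorem: every closed orthogonal pair of an MM-orbit exact cubic pair
with `|S| < 2^m` has a NEW good vector on the `b`-side. -/
theorem seedExists (hT : NoTrapTemplate) (hTr : NoTrapTemplate → NoTrapOrbit)
    (m : ℕ) (a b : (Fin (m + m) → Bool) → Bool)
    (ha : IsDegLeFun 3 a) (hb : IsDegLeFun 3 b) (hΦ : forrelation a b = 1 ∨ forrelation a b = -1)
    (horb : (∃ e : (Fin (m + m) → Bool) ≃ (Fin (m + m) → Bool),
      (∃ M : Matrix (Fin (m + m)) (Fin (m + m)) (ZMod 2), ∃ c : Fin (m + m) → ZMod 2,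
        ∀ y i, (if e y i then (1 : ZMod 2) else 0) = (M.mulVec (fun j => if y j then (1 : ZMod 2) else 0) + c) i) ∧
      ∃ perm : (Fin m → Bool) ≃ (Fin m → Bool), ∃ h : (Fin m → Bool) → Bool, ∀ y' y'' : Fin m → Bool,
        (if b (e (Fin.append y' y'')) then (1 : ZMod 2) else 0) =
          (∑ i, (if y' i then (1 : ZMod 2) else 0) * (if perm y'' i then (1 : ZMod 2) else 0)) +
            (if h y'' then (1 : ZMod 2) else 0)))
    (S U : Finset (Fin (m + m) → Bool))
    (hS : zeroVec ∈ S ∧ ∀ x ∈ S, ∀ y ∈ S, bxor x y ∈ S) (hU : zeroVec ∈ U ∧ ∀ x ∈ U, ∀ y ∈ U, bxor x y ∈ U)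
    (hcb : ClosedF b S U) (hca : ClosedF a U S) (ho : Orth S U) (hlt : S.card < 2 ^ m) :
    ∃ v, v ∉ S ∧ Good b S U v := by
  obtain ⟨V, hV, hSV, hVU⟩ := hTr hT m a b ha hb hΦ horb S U hS hU hcb hca ho
  have hcard : (V.card : ℝ) ^ 2 = (2 : ℝ) ^ (m + m) := hV.2.1
  have hVc : V.card = 2 ^ m := by
    have h2 : (2 : ℝ) ^ (m + m) = ((2 : ℝ) ^ m) ^ 2 := by rw [← pow_mul]; ring_nf
    rw [h2] at hcard
    have hn : (0 : ℝ) ≤ V.card := by positivity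
    have hp : (0 : ℝ) ≤ (2 : ℝ) ^ m := by positivity
    have := (pow_left_inj₀ hn hp two_ne_zero).1 hcard
    exact_mod_cast this
  have hne : ¬ V ⊆ S := fun h => by
    have := Finset.card_le_card h
    omega
  obtain ⟨v, hvV, hvS⟩ := Finset.not_subset.1 hne
  exact ⟨v, hvS, V, hV, hSV, hvV, hVU⟩

/-- **r5 ⇒ the coin finder is total on the exact slice** (as `pairFinderExact_of`, with the soundness/probability clauses carried along). -/
theorem pairFinderExactCoins_of (hF : PairFinderMMCoins) (h5 : ExactPairsMaioranaMcFarland) : PairFinderExactCoins := by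
  obtain ⟨find, hfind, p, hspec⟩ := hF
  refine ⟨find, hfind, p, ?_⟩
  rintro ⟨n, k, C⟩ hk heven hB hdeg hv
  dsimp only at hk heven hB hdeg hv ⊢
  subst hk
  obtain ⟨m, rfl⟩ := heven
  rw [KForrelationInstance.value_mk_two] at hv
  have horb : MMOrbit (C 1).eval := by
    rcases hv with h | h
    · exact h5 m _ _ (hdeg 0) (hdeg 1) h
    · refine h5 m (fun x => !(C 0).eval x) _ (hdeg 0).not (hdeg 1) ?_
      rw [forrelation_not_left, h, neg_neg]
  exact hspec m C hB hdeg hv horb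

end Grow

/-! ## Name-keyed aliases of the stub statements (hypotheses of the composition are keyed by these names) -/
namespace Registered

/-- Alias of the statement of `stub_polarGeometry` (landed p88189). -/
abbrev stub_polarGeometry : Prop := PolarGeometry
/-- Alias of the statement of `stub_dualShape` (landed p87053). -/
abbrev stub_dualShape : Prop := DualMMShape
/-- Alias of the statement of `stub_frameLock` (landed p86221). -/
abbrev stub_frameLock : Prop := FrameLock
/-- Alias of the statement of `stub_signReadout` (landed p86317). -/
abbrev stub_signReadout : Prop := SignReadout
/-- Alias of the statement of `stub_plumbing` (landed p87286; deterministic finder version, kept). -/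
abbrev stub_plumbing : Prop := PairFinderExact → SignReadout → signedExactCubicForrelationProblem 2 ∈ PromiseBPP'
/-- Alias of the statement of `stub_noTrapTemplate`. -/
abbrev stub_noTrapTemplate : Prop := Grow.NoTrapTemplate
/-- Alias of the statement of `stub_noTrapTransport`. -/
abbrev stub_noTrapTransport : Prop := Grow.NoTrapTemplate → Grow.NoTrapOrbit
/-- Alias of the statement of `stub_mpairClosed`. -/
abbrev stub_mpairClosed : Prop := Grow.MPairClosed
/-- Alias of the statement of `stub_kernelStats` (now a composition of `stub_kernelStatsRadical` + bricks and the open `stub_kernelStatsCore`). -/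
abbrev stub_kernelStats : Prop := Grow.KernelStats
/-- Alias of the statement of `stub_growFinder`. -/
abbrev stub_growFinder : Prop := Grow.KernelStats → Grow.MPairClosed → Grow.PairFinderMMCoins
/-- Alias of the statement of `stub_plumbingCoins`. -/
abbrev stub_plumbingCoins : Prop := Grow.PairFinderExactCoins → SignReadout → signedExactCubicForrelationProblem 2 ∈ PromiseBPP'

end Registered

/-! ## Composition: the GROW line concludes the ROUTE'S negation item by name -/

/-- **The line concludes `CubicForrelation.SignedExactCubicForrelationInPrBPP`** (item stmt-QuantumAdvantage-14671, the real route decl,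
`= signedExactCubicForrelationProblem 2 ∈ PromiseBPP'` by `rfl`) with the registered stubs plugged in: kernel statistics + M-pairs-are-closed
feed the GROW machine (`PairFinderMMCoins`); crux r5 (route item, by name) makes it total on the exact slice; the coin plumbing with the
landed sign readout decides (landed `stub_signReadout`, `stub_mpairClosed`, `stub_growFinder`, `stub_plumbingCoins`; `stub_kernelStats` is the
composition of the open stubs). The ONLY hypothesis is r5. THIS is the skeleton's deciding theorem. -/
theorem SignedExactCubicForrelationInPrBPP_of_stubs (h5 : ExactPairsMaioranaMcFarland) : SignedExactCubicForrelationInPrBPP := by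
  show signedExactCubicForrelationProblem 2 ∈ PromiseBPP'
  exact Grow.stub_plumbingCoins (Grow.pairFinderExactCoins_of (Grow.stub_growFinder Grow.stub_kernelStats Grow.stub_mpairClosed) h5)
    stub_signReadout

/-- The same conclusion (stated UNFOLDED, so that the skeleton audit sees exactly one deciding theorem) with the kernel statistics kept
as a NAMED hypothesis — documentation of the dependency `KernelStats → r5 → SignedExactCubicForrelationInPrBPP` (landed as p126292). -/
theorem signedExact_mem_PromiseBPP_of_grow (hK : Registered.stub_kernelStats)
    (h5 : ExactPairsMaioranaMcFarland) : signedExactCubicForrelationProblem 2 ∈ PromiseBPP' :=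
  Grow.stub_plumbingCoins (Grow.pairFinderExactCoins_of (Grow.stub_growFinder hK Grow.stub_mpairClosed) h5) stub_signReadout

/-- … hence the crux is FALSE under the stubs and r5. -/
theorem SignedExactCubicForrelationNotPrBPP_false_of_grow (h5 : ExactPairsMaioranaMcFarland) : ¬ SignedExactCubicForrelationNotPrBPP :=
  fun h3 => h3 (SignedExactCubicForrelationInPrBPP_of_stubs h5)

/-- The no-trap stubs are the proof road of `stub_kernelStats` (existence half, `Grow.seedExists`). -/
example := Grow.seedExists Grow.stub_noTrapTemplate Grow.stub_noTrapTransport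

/-! ## Sanity checks (sorry-free): the named `Prop`s are literally the registered (unfolded) statements -/

example : Grow.NoTrapTemplate := Grow.stub_noTrapTemplate
example : Grow.NoTrapTemplate → Grow.NoTrapOrbit := Grow.stub_noTrapTransport
example : Grow.MPairClosed := Grow.stub_mpairClosed
example : Grow.KernelStats := Grow.stub_kernelStats
example : Grow.KernelStats → Grow.MPairClosed → Grow.PairFinderMMCoins := Grow.stub_growFinder
example : Grow.PairFinderExactCoins → SignReadout → signedExactCubicForrelationProblem 2 ∈ PromiseBPP' := Grow.stub_plumbingCoins

/-- `Grow.ClosedF` unfolds to the clause used in the stubs (definitional). -/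
example (m : ℕ) (b : (Fin (m + m) → Bool) → Bool) (S U : Finset (Fin (m + m) → Bool)) :
    Grow.ClosedF b S U ↔ ((∀ s ∈ S, ∀ y : Fin (m + m) → Bool, (fun k => (b zeroVec ^^ b (bxor zeroVec s) ^^ b (bxor zeroVec y) ^^ b (bxor zeroVec (bxor s y))) ^^ (b (fun j => decide (j = k)) ^^ b (bxor (fun j => decide (j = k)) s) ^^ b (bxor (fun j => decide (j = k)) y) ^^ b (bxor (fun j => decide (j = k)) (bxor s y)))) ∈ U) ∧ (∀ s ∈ S, ∃ ℓ ∈ U, ∀ r : Fin (m + m) → Bool, (∀ y z : Fin (m + m) → Bool, ((b z ^^ b (bxor z s) ^^ b (bxor z r) ^^ b (bxor z (bxor s r))) ^^ (b (bxor z y) ^^ b (bxor (bxor z y) s) ^^ b (bxor (bxor z y) r) ^^ b (bxor (bxor z y) (bxor s r)))) = false) → (b r ^^ b (bxor r s) ^^ b zeroVec ^^ b s) = ((Finset.univ.filter fun i => ℓ i && r i).card).bodd)) := Iff.rfl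

/-- `Grow.MSub` unfolds to the clause used in the stubs (definitional). -/
example (m : ℕ) (b : (Fin (m + m) → Bool) → Bool) (V : Finset (Fin (m + m) → Bool)) :
    Grow.MSub b V ↔ ((zeroVec ∈ V ∧ ∀ x ∈ V, ∀ y ∈ V, bxor x y ∈ V) ∧ (((V).card : ℝ) ^ 2 = (2 : ℝ) ^ (m + m)) ∧ ∀ u ∈ V, ∀ v ∈ V, ∀ x, (b x ^^ b (bxor x u) ^^ b (bxor x v) ^^ b (bxor x (bxor u v))) = false) := Iff.rfl

/-- `Grow.goodMass` unfolds to the sum used in `stub_kernelStats` (definitional). -/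
example (m : ℕ) (b : (Fin (m + m) → Bool) → Bool) (S U : Finset (Fin (m + m) → Bool)) (r : ℕ) :
    Grow.goodMass b S U r = (∑ xs : Fin (r) → (Fin (m + m) → Bool), (((@Finset.filter (Fin (m + m) → Bool) (fun v => v ∉ S ∧ (∃ V : Finset (Fin (m + m) → Bool), ((zeroVec ∈ V ∧ ∀ x ∈ V, ∀ y ∈ V, bxor x y ∈ V) ∧ (((V).card : ℝ) ^ 2 = (2 : ℝ) ^ (m + m)) ∧ ∀ u ∈ V, ∀ v ∈ V, ∀ x, (b x ^^ b (bxor x u) ^^ b (bxor x v) ^^ b (bxor x (bxor u v))) = false) ∧ S ⊆ V ∧ v ∈ V ∧ (∀ s ∈ V, ∀ u ∈ U, ((Finset.univ.filter fun i => s i && u i).card).bodd = false))) (Classical.decPred _) (Finset.univ.filter fun (v : Fin (m + m) → Bool) => (∀ s ∈ S, ∀ x, (b x ^^ b (bxor x s) ^^ b (bxor x v) ^^ b (bxor x (bxor s v))) = false) ∧ (∀ u ∈ U, ((Finset.univ.filter fun i => u i && v i).card).bodd = false) ∧ ∀ j, (∀ y z : Fin (m + m) → Bool, ((b z ^^ b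 (bxor z (xs j)) ^^ b (bxor z v) ^^ b (bxor z (bxor (xs j) v))) ^^ (b (bxor z y) ^^ b (bxor (bxor z y) (xs j)) ^^ b (bxor (bxor z y) v) ^^ b (bxor (bxor z y) (bxor (xs j) v)))) = false))).card : ℝ) / (((Finset.univ.filter fun (v : Fin (m + m) → Bool) => (∀ s ∈ S, ∀ x, (b x ^^ b (bxor x s) ^^ b (bxor x v) ^^ b (bxor x (bxor s v))) = false) ∧ (∀ u ∈ U, ((Finset.univ.filter fun i => u i && v i).card).bodd = false) ∧ ∀ j, (∀ y z : Fin (m + m) → Bool, ((b z ^^ b (bxor z (xs j)) ^^ b (bxor z v) ^^ b (bxor z (bxor (xs j) v))) ^^ (b (bxor z y) ^^ b (bxor (bxor z y) (xs j)) ^^ b (bxor (bxor z y) v) ^^ b (bxor (bxor z y) (bxor (xs j) v)))) = false))).card : ℝ))) := rfl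

/-! ## Sanity checks (sorry-free) -/

/-- The crux, by name, is non-membership of the tree's `signedExactCubicForrelationProblem 2` (Disproof `crux_eq`). -/
example : SignedExactCubicForrelationNotPrBPP = (signedExactCubicForrelationProblem 2 ∉ PromiseBPP') := rfl

/-- `IsMSubspace`'s affineness clause is verbatim the hypothesis `hM` of the landed duality theorem: an M-subspace of
`b` in this file's sense feeds `DerivativeWalsh.dual_affine_on_perp_cosets` directly (used by `stub_frameLock`). -/
example (a b : (Fin n → Bool) → Bool) (V : Finset (Fin n → Bool))
    (hΦ : forrelation a b = 1 ∨ forrelation a b = -1) (hV : IsMSubspace b V) (x₀ : Fin n → Bool) :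
    ∃ r : Fin n → Bool, ∀ x ∈ perp V, signOf (a (bxor x₀ x)) * twist x r = signOf (a x₀) :=
  DerivativeWalsh.dual_affine_on_perp_cosets hΦ hV.1.1 hV.1.2 hV.2.1 hV.2.2 x₀

/-- Test object for `stub_polarGeometry` / `stub_finder` (imported negative knowledge of the sibling crux r7,
`Negative.GoldCube`): a biquadratic permutation of `𝔽₂³` WITHOUT affine component — the finder must not (and does
not) rely on affine components; the `𝔽₈`-cube products built from it are the family on which single-tensor finders
score 0/31 and the two-tensor ping-pong closes (card §Cheapest falsifier (b)). -/
example : ∃ π : Equiv.Perm (Fin 3 → Bool), (∀ i, IsDegLeFun 2 fun x => π x i) ∧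
    (∀ i, IsDegLeFun 2 fun x => π.symm x i) ∧
    ∀ ℓ : Fin 3 → Bool, ℓ ≠ (fun _ => false) →
      ¬ IsDegLeFun 1 fun x => Theorems.SignedCubicForrelationInPrBPP.Negative.dotB ℓ (π x) :=
  Theorems.SignedCubicForrelationInPrBPP.Negative.exists_biquadratic_perm_without_affine_component


end Summit.QuantumAdvantage.QuantumAdvantage.Cruxes.SignedExactCubicForrelationNotPrBPP.DualPingpongFrame

end
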